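import Mathlib
import Literature.NumberTheory.EllipticCurves.IwasawaAlgebra
import Literature.NumberTheory.EllipticCurves.Rubin1991.TwoVariableMainConjecture
import Literature.NumberTheory.EllipticCurves.Kobayashi2003.SignedPAdicLFunctionConstantTermProofs
import Literature.NumberTheory.EllipticCurves.Kobayashi2003.SignedColemanKatoZetaJoint
import Literature.NumberTheory.EllipticCurves.KatoFineSelmerDualTorsion
import Literature.NumberTheory.EllipticCurves.Kato2004.IwasawaH1LambdaTorsionFreeProofs
import Literature.NumberTheory.IwasawaTheory.IwasawaAlgebraTwoVarRegularProofs
import Literature.NumberTheory.EllipticCurves.IwasawaAlgebraUnitTwistPair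
import Summits.BirchSwinnertonDyer.BirchSwinnertonDyer.Theorems.SignedBaseChangeAnticyclotomicEisensteinDivisibilitySpecializationHerbrand
import Summits.BirchSwinnertonDyer.BirchSwinnertonDyer.Theorems.ErratumRoadFiveCharIdealTransferTorsion
import Literature.NumberTheory.EllipticCurves.IwasawaAlgebraEisensteinCoefficientRingProofs

/-!
# QtameEngine v1.4 — the END-TO-END patching engine of the crux idea `qtame`
(crux `TwoVariableEulerSystemDivisibility`, stmt-BirchSwinnertonDyer-20728, route SignedBaseChange; ideator
bsd-idea-14 g15–g17; companion of `IdeaSketchQtame.lean` v4.7 — an idea sketch, NOT a registered skeleton; the line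
of record stays `Lines/ratlift.lean` v4; the version narrative lives in the card `Ideas/qtame.md` § V#23d′/f′/i′).

`IdeaSketchQtame.lean` v4.7 (at the 200 KB cap) proves `PatchingTarget` (§7), `PatchingBeta` (§9), `VerticalApprox`
(§8, vertical primes with a root in `ℚ_p` only) and the First lemma (§1) SEPARATELY; this file assembles them and
reaches EVERY height-one prime `𝔓 ∌ p` of `Λ₂ = ℤ_p⟦T₂⟧⟦T₁⟧`. Contents (each § has its own header below):
§E0 the sketch's Props restated verbatim · §E1–E2 quantitative endgame `endgame_quant` and depth lemma
`exists_depth` at a height-one prime of a Noetherian domain · §E3 the prime `(p, T₂)/(Q)` · §E4 the vertical theorem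
`vertical_dvd` for EVERY good prime `P` of `Λ₁ = ℤ_p⟦T₂⟧` from fibre bounds along approximants (`VFamily`) ·
§E5 twisted translates `ι_v(P)` as canonical approximants (`TwistBounds`, `engine_twist`) · §E6 classification of
the height-one primes `∌ p` and the end-to-end theorem **`engine`** · §E7 (v1.1) standard currencies:
`FibreTorsionAt`, the Kato line `katoLine`, (UNIF) `UnifTwistBounds`, **`engine_std`** · §E8 (v1.2) the depth
currency: (XS) torsion from one fibre (`engine_std'`), eventual constancy of depth and rank along `ι_v(P)` (the
two-variable replica of CGLS20 arXiv:2008.02571 Thm 3.4.1), `DepthFibreBounds`, **`engine_depth`** · §E9 (v1.3) the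
S-DOOR: the vertical binder over COMPLETE DVRs `S ⊇ ℤ_p` (`DepthFibreBoundsDVR`, the printed Kolyvagin-system
coefficient class), Weierstrass evaluation, the degree-one vertical theorem `verticalS_dvd` over `S⟦T₂⟧⟦T₁⟧`,
isolated zeros, FLAT base change `Λ₂ → Λ_{2,S}` + length inequality + descent, (LB) proved in-file,
**`engine_doorS`** · §E10 (v1.4) ROOT DATA EXIST (`rootDatumS`: `S = O_K`, `K` a splitting field over `ℚ_p` of the
Weierstrass polynomial of `P` with the spectral norm — compact ⟹ DVR, complete, module-finite over `ℤ_p`), hence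
**`engine_doorS'`**: `PatchingTarget + PatchingBeta` + non-vertical fibre bounds + Kato-line torsion +
`DepthFibreBoundsDVR` ⟹ `(p^a · G) ⊆ ch_{Λ₂}(X)`.

What the line still owes is ARITHMETIC: the fibre bounds at the algebraic points (inhabitants of
`DepthFibreBoundsDVR` / `DepthFibreBounds` / `UnifTwistBounds` and of the non-vertical binder), Kato-line torsion, the
inhabitants of the sketch's §H.2/§H.3 structures. NO `sorry`; every arithmetic input is a hypothesis. BSD is not
proved by this file; no summit statement is proved by this seat.
-/

set_option autoImplicit false
set_option linter.dupNamespace false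

open scoped Pointwise TensorProduct

namespace Summit.BirchSwinnertonDyer.BirchSwinnertonDyer.Cruxes.TwoVariableEulerSystemDivisibility.QtameEngine

open Literature.NumberTheory.EllipticCurves

/-! ## E0. Verbatim restatements from `IdeaSketchQtame.lean` v4.7 (§1 First lemma with proof; §2–§4 and §9.1–§9.3
definitions and Props; small helper lemmas with proofs). Texts byte-identical up to the namespace. -/

/-- Nakayama at a prime: if `s ∉ 𝔭` and `s • M ⊆ π • M` with `π ∈ 𝔭`, then `M_𝔭 = 0`. -/
theorem subsingleton_localizedModule_of_smul_le
    {R : Type*} [CommRing R] {M : Type*} [AddCommGroup M] [Module R M] [Module.Finite R M]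
    (𝔭 : Ideal R) [𝔭.IsPrime] {π s : R} (hπ : π ∈ 𝔭) (hs : s ∉ 𝔭)
    (hsM : ∀ x : M, s • x ∈ π • (⊤ : Submodule R M)) :
    Subsingleton (LocalizedModule 𝔭.primeCompl M) := by
  classical
  set Rp := Localization.AtPrime 𝔭
  set Mp := LocalizedModule 𝔭.primeCompl M
  -- every element of `Mp` lies in `𝔪 • ⊤`
  have hle : (⊤ : Submodule Rp Mp) ≤ IsLocalRing.maximalIdeal Rp • (⊤ : Submodule Rp Mp) := by
    rintro y -
    induction y using LocalizedModule.induction_on with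
    | h m t =>
      obtain ⟨m', -, hm'⟩ := (Submodule.mem_smul_pointwise_iff_exists _ _ _).mp (hsM m)
      have hunit : IsUnit (algebraMap R Rp s) :=
        IsLocalization.map_units Rp (⟨s, hs⟩ : 𝔭.primeCompl)
      obtain ⟨u, hu⟩ := hunit
      have hπmem : algebraMap R Rp π ∈ IsLocalRing.maximalIdeal Rp :=
        (IsLocalization.AtPrime.to_map_mem_maximal_iff Rp 𝔭 π).mpr hπ
      have key : (LocalizedModule.mk m t : Mp) =
          ((↑u⁻¹ : Rp) * algebraMap R Rp π) • (LocalizedModule.mk m' t : Mp) := by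
        have h1 : algebraMap R Rp s • (LocalizedModule.mk m t : Mp) =
            algebraMap R Rp π • (LocalizedModule.mk m' t : Mp) := by
          rw [algebraMap_smul, algebraMap_smul, LocalizedModule.smul'_mk, LocalizedModule.smul'_mk, hm']
        calc (LocalizedModule.mk m t : Mp)
            = (↑u⁻¹ : Rp) • ((↑u : Rp) • (LocalizedModule.mk m t : Mp)) := by
                rw [smul_smul, Units.inv_mul, one_smul]
          _ = (↑u⁻¹ : Rp) • (algebraMap R Rp π • (LocalizedModule.mk m' t : Mp)) := by rw [hu, h1]
          _ = ((↑u⁻¹ : Rp) * algebraMap R Rp π) • (LocalizedModule.mk m' t : Mp) := by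
                rw [mul_smul]
      rw [key]
      exact Submodule.smul_mem_smul (Ideal.mul_mem_left _ _ hπmem) Submodule.mem_top
  have htop : (⊤ : Submodule Rp Mp) = ⊥ :=
    Submodule.eq_bot_of_le_smul_of_le_jacobson_bot _ _ Module.Finite.fg_top hle
      (IsLocalRing.maximalIdeal_le_jacobson _)
  refine subsingleton_of_forall_eq 0 fun y => ?_
  have hy : y ∈ (⊤ : Submodule Rp Mp) := Submodule.mem_top
  rw [htop] at hy
  exact (Submodule.mem_bot Rp).mp hy

/-- **First lemma (vertical exclusion by fibre torsion = Nakayama at a height-one prime). PROVED (v4.3).**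
If the fibre `M/πM` of a finitely generated module over a Noetherian domain at a prime element `π` is
killed by some `s ∉ (π)`, then `M_{(π)} = 0`, i.e. the local length of `M` at `(π)` is `0`. At
`R = ℤ_p⟦T₂⟧⟦T₁⟧`, `π = T₂ - u` this is "fibre Euler-system class at `u` non-zero ⇒ fibre Selmer torsion ⇒
no vertical component at `u`". -/
theorem lengthAt_eq_zero_of_fibre_torsion
    {R : Type*} [CommRing R] [IsDomain R] [IsNoetherianRing R]
    {M : Type*} [AddCommGroup M] [Module R M] [Module.Finite R M]
    {π : R} (hπ : Prime π) {s : R} (hs : s ∉ Ideal.span {π})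
    (hsM : ∀ x : M, s • x ∈ π • (⊤ : Submodule R M)) :
    Literature.NumberTheory.EllipticCurves.Module.lengthAt R M
      ⟨Ideal.span {π}, (Ideal.span_singleton_prime hπ.ne_zero).mpr hπ⟩ = 0 := by
  haveI : (Ideal.span {π}).IsPrime := (Ideal.span_singleton_prime hπ.ne_zero).mpr hπ
  haveI := subsingleton_localizedModule_of_smul_le (M := M) (Ideal.span {π})
    (Ideal.mem_span_singleton_self π) hs hsM
  exact Module.length_eq_zero

/-! ## 2. Fibres of the inner (anticyclotomic) variable over a coefficient ring `O` -/

section Fibres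

variable (O : Type*) [CommRing O]

/-- The vertical prime of `O⟦T₂⟧⟦T₁⟧` through the point `u` of the inner disc: `T₂ - u`, via the constants
embedding `C : O⟦T₂⟧ → O⟦T₂⟧⟦T₁⟧`. (`u = 0`: the KATO LINE.) -/
noncomputable def verticalPrimeO (u : O) : PowerSeries (PowerSeries O) :=
  PowerSeries.C (R := PowerSeries O) (PowerSeries.X - PowerSeries.C (R := O) u)

/-- The SECTION `O⟦T⟧ → O⟦T₂⟧⟦T₁⟧`, `T ↦ T₁` (outer variable), constants to constants. Composed with the
quotient by `(T₂ - u)` it is the isomorphism `O⟦T₂⟧⟦T₁⟧/(T₂ - u) ≅ O⟦T₁⟧`; it is the `Λ_cyc`-structure of a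
qtame fibre. (NOT the constants map `PowerSeries.C`, which is the `Λ_ac`-structure used on the anticyclotomic
line by the tree's Herbrand lemmas — SMUL-TRAP of `IwasawaAlgebraSpecialization`.) -/
noncomputable def fibreSection : PowerSeries O →+* PowerSeries (PowerSeries O) :=
  PowerSeries.map (PowerSeries.C (R := O))

/-- **Fibre bound at `u` with slack `p^t`**: `p^t · G(T₁,u) ∈ ch_{O⟦T₁⟧}(Y/(T₂-u)Y)`, written inside
`O⟦T₂⟧⟦T₁⟧` without an evaluation map: `p^t G ∈ ch(fibre)·(section) + (T₂ - u)`. This is what ONE rational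
Euler-system argument over `ℚ_∞` for the fibre representation `V_f ⊗ Ind ψ_u⁻¹` plus EXACT fibre control
delivers. v2: the engine is the `Λ_cyc`-adic form of Rubin's FUNCTIONAL-AT-`p` theorem (Euler Systems,
Thm 2.2.10; printed Greenberg-condition variant at finite level = LLZ14, arXiv:1311.0175, App. Thm 9.2.3);
Rubin's standard-structure Thm 2.3.3 is VACUOUS here because `d⁻(T_u) = 2 = rank_Λ H¹_Iw(ℚ, T_u)`. -/
def FibreBoundAt (p : ℕ) (Y : Type*) [AddCommGroup Y] [Module (PowerSeries (PowerSeries O)) Y]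
    (G : PowerSeries (PowerSeries O)) (u : O) (t : ℕ) : Prop :=
  letI : Module (PowerSeries O) (QuotSMulTop (verticalPrimeO O u) Y) :=
    Module.compHom _ (fibreSection O)
  (p : PowerSeries (PowerSeries O)) ^ t * G ∈
    (Literature.NumberTheory.EllipticCurves.Module.charIdeal (PowerSeries O)
        (QuotSMulTop (verticalPrimeO O u) Y)).map (fibreSection O) ⊔
      Ideal.span {verticalPrimeO O u}

end Fibres

/-- The vertical prime of `Λ₂ = ℤ_p⟦T₂⟧⟦T₁⟧` through `b ∈ ℤ_p` (v1 name, now a special case). -/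
noncomputable def verticalPrime (p : ℕ) [Fact p.Prime] (b : ℤ_[p]) : IwasawaAlgebra₂ p :=
  verticalPrimeO ℤ_[p] b



/-- **Final patching (pure algebra over the UFD `Λ₂`, P4-fixed)**: if every height-one `𝔓 ∌ p` carries
exponent in `ch(X)` at most its exponent in `G`, then `(p^a · G) ⊆ ch(X)` for some `a` (`= μ(X)`).
(`ch(X) = ∏ 𝔓^{lengthAt}`.) PROVED below (v4.2, `patchingTarget_holds`) from the tree's `Module.charIdeal`
and the tree's PROVED factoriality of `Λ₂` (Auslander–Buchsbaum). -/
def PatchingTarget (p : ℕ) [Fact p.Prime] (X : Type*) [AddCommGroup X]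
    [Module (IwasawaAlgebra₂ p) X] [Module.Finite (IwasawaAlgebra₂ p) X] (G : IwasawaAlgebra₂ p) : Prop :=
  Module.IsTorsion (IwasawaAlgebra₂ p) X →
  (∀ 𝔓 : PrimeSpectrum (IwasawaAlgebra₂ p), 𝔓.asIdeal.height = 1 →
      (p : IwasawaAlgebra₂ p) ∉ 𝔓.asIdeal →
      𝔓.asIdeal ^ (Literature.NumberTheory.EllipticCurves.Module.lengthAt
        (IwasawaAlgebra₂ p) X 𝔓).toNat ∣ Ideal.span {G}) →
    ∃ a : ℕ, Ideal.span {(p : IwasawaAlgebra₂ p) ^ a * G} ≤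
      Literature.NumberTheory.EllipticCurves.Module.charIdeal (IwasawaAlgebra₂ p) X

/-! ## 4. NEW (P1, repair β): patching from ALL algebraic fibres detects every non-vertical prime -/

/-- **(Q2-β) Patching over all algebraic points — PROVED (§9, `patchingBeta_holds`).** Hypothesis: there is
ONE non-zero `z ∈ ℤ_p[X]` such that for every finite `ℤ_p`-order `O` (a domain) and every non-unit `u ∈ O` with
`z(u) ≠ 0`, the base-changed module `O⟦T₂⟧⟦T₁⟧ ⊗_{Λ₂} X` satisfies the fibre bound at `u` with SOME slack `p^t`
(depending on `u`). Conclusion: every NON-VERTICAL height-one prime `𝔓` of `Λ₂` (`𝔓 ∩ ℤ_p⟦T₂⟧ = 0`) carries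
exponent in `ch(X)` at most its exponent in `G`. (The critic's `(T₁T₂ + p)` has NO unramified points — hence ALL
algebraic `u`; the points actually used in §9 are the residue orders `O_P = Λ₁/(P)`, `u_P = T₂ mod P`.) -/
def PatchingBeta (p : ℕ) [Fact p.Prime] (X : Type) [AddCommGroup X]
    [Module (IwasawaAlgebra₂ p) X] [Module.Finite (IwasawaAlgebra₂ p) X] (G : IwasawaAlgebra₂ p) : Prop :=
  Module.IsTorsion (IwasawaAlgebra₂ p) X →
  (∃ z : Polynomial ℤ_[p], z ≠ 0 ∧
    ∀ (O : Type) [CommRing O] [IsDomain O] [CharZero O] [Algebra ℤ_[p] O] [Module.Finite ℤ_[p] O]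
      (u : O), u ∈ nonunits O → Polynomial.aeval u z ≠ 0 →
      letI : Algebra (IwasawaAlgebra₂ p) (PowerSeries (PowerSeries O)) :=
        (PowerSeries.map (PowerSeries.map (algebraMap ℤ_[p] O))).toAlgebra
      ∃ t : ℕ, FibreBoundAt O p ((PowerSeries (PowerSeries O)) ⊗[IwasawaAlgebra₂ p] X)
        (PowerSeries.map (PowerSeries.map (algebraMap ℤ_[p] O)) G) u t) →
  ∀ 𝔓 : PrimeSpectrum (IwasawaAlgebra₂ p), 𝔓.asIdeal.height = 1 →
    Ideal.comap (PowerSeries.C (R := IwasawaAlgebra p)) 𝔓.asIdeal = ⊥ →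
    𝔓.asIdeal ^ (Literature.NumberTheory.EllipticCurves.Module.lengthAt
      (IwasawaAlgebra₂ p) X 𝔓).toNat ∣ Ideal.span {G}

/-! ## 5. NEW: vertical primes by p-adic approximation from neighbouring fibres (model case `u ∈ ℤ_p`) -/


/-! ### E0.1 Good primes of `Λ₁` (sketch §9.1) and the Props (FT), (LB) (sketch §9.3) -/

section GoodPrimes

variable {p : ℕ} [Fact p.Prime]

theorem C_dvd_of_forall_dvd_coeff {R : Type*} [CommRing R] {a : R} {w : PowerSeries R}
    (h : ∀ n, a ∣ PowerSeries.coeff n w) : PowerSeries.C a ∣ w := by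
  choose q hq using h
  refine ⟨PowerSeries.mk q, PowerSeries.ext fun n => ?_⟩
  rw [PowerSeries.coeff_C_mul, PowerSeries.coeff_mk, hq n]



/-- `C a ∣ w` in `R⟦X⟧` forces `a ∣ coeff n w` for every `n`. -/
theorem dvd_coeff_of_C_dvd {R : Type*} [CommRing R] {a : R} {w : PowerSeries R}
    (h : PowerSeries.C a ∣ w) (n : ℕ) : a ∣ PowerSeries.coeff n w := by
  obtain ⟨q, rfl⟩ := h
  exact ⟨PowerSeries.coeff n q, by rw [PowerSeries.coeff_C_mul]⟩

/-! ### 9.1 Points: prime elements `P ∤ p` of `Λ₁ = ℤ_p⟦T₂⟧` and the finite `ℤ_p`-orders `O_P = Λ₁/(P)` -/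

/-- A **good prime** of `Λ₁ = ℤ_p⟦T₂⟧`: a prime element not dividing `p` (equivalently: associated to a
distinguished irreducible polynomial). Its residue ring `O_P = Λ₁/(P)` is a finite `ℤ_p`-order and a domain of
characteristic zero, and `u_P := T₂ mod P` is a non-unit of `O_P`: these are the algebraic points fed to
`PatchingBeta`. -/
structure GoodPrime (p : ℕ) [Fact p.Prime] where
  /-- the prime element -/
  P : IwasawaAlgebra p
  prime : Prime P
  not_dvd : ¬ P ∣ (p : IwasawaAlgebra p)

namespace GoodPrime

variable (P : GoodPrime p)

/-- `O_P = Λ₁/(P)`. -/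
abbrev O : Type := IwasawaAlgebra p ⧸ Ideal.span {P.P}

theorem span_isPrime : (Ideal.span {P.P}).IsPrime :=
  (Ideal.span_singleton_prime P.prime.ne_zero).mpr P.prime

instance : (Ideal.span {P.P}).IsPrime := P.span_isPrime

instance : IsDomain P.O := Ideal.Quotient.isDomain _

theorem not_isUnit : ¬ IsUnit P.P := P.prime.not_unit

/-- `P` divides no non-zero constant. -/
theorem not_dvd_C {c : ℤ_[p]} (hc : c ≠ 0) : ¬ P.P ∣ PowerSeries.C c := by
  intro h
  have hc' : c = (PadicInt.unitCoeff hc : ℤ_[p]) * (p : ℤ_[p]) ^ c.valuation :=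
    PadicInt.unitCoeff_spec hc
  rw [hc', map_mul, map_pow, map_natCast] at h
  have h1 : P.P ∣ (p : IwasawaAlgebra p) ^ c.valuation :=
    ((P.prime.dvd_or_dvd h).resolve_left fun h' => P.not_isUnit
      (isUnit_of_dvd_unit h' ((PadicInt.unitCoeff hc).isUnit.map _)))
  exact P.not_dvd (P.prime.dvd_of_dvd_pow h1)

theorem algebraMap_injective : Function.Injective (algebraMap ℤ_[p] P.O) := by
  rw [injective_iff_map_eq_zero]
  intro c hc
  by_contra h0
  rw [← Ideal.Quotient.mk_algebraMap, Ideal.Quotient.eq_zero_iff_mem, Ideal.mem_span_singleton,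
    ← PowerSeries.C_eq_algebraMap] at hc
  exact P.not_dvd_C h0 hc

instance : CharZero P.O := charZero_of_injective_algebraMap P.algebraMap_injective

theorem not_isUnit_p : ¬ IsUnit (p : IwasawaAlgebra p) := by
  rw [show (p : IwasawaAlgebra p) = PowerSeries.C (p : ℤ_[p]) by rw [map_natCast],
    PowerSeries.isUnit_iff_constantCoeff, PowerSeries.constantCoeff_C]
  exact PadicInt.irreducible_p.not_isUnit

/-- `P mod p ≠ 0` (as `P ∤ p` and `P` is prime). -/
theorem map_residue_ne_zero : (P.P).map (IsLocalRing.residue ℤ_[p]) ≠ 0 := by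
  intro h
  have hcoeff : ∀ n, (p : ℤ_[p]) ∣ PowerSeries.coeff n P.P := by
    intro n
    have := congrArg (PowerSeries.coeff n) h
    rw [PowerSeries.coeff_map, map_zero, IsLocalRing.residue_eq_zero_iff,
      PadicInt.maximalIdeal_eq_span_p, Ideal.mem_span_singleton] at this
    exact this
  have hdvd : (p : IwasawaAlgebra p) ∣ P.P := by
    have := C_dvd_of_forall_dvd_coeff hcoeff
    rwa [map_natCast] at this
  obtain ⟨Q, hQ⟩ := hdvd
  rcases P.prime.dvd_or_dvd (dvd_of_eq hQ) with h1 | h1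
  · exact P.not_dvd h1
  · obtain ⟨R, hR⟩ := h1
    apply not_isUnit_p (p := p)
    have h2 : P.P * 1 = P.P * ((p : IwasawaAlgebra p) * R) := by
      rw [mul_one, mul_left_comm, ← hR]; exact hQ
    exact IsUnit.of_mul_eq_one R (mul_left_cancel₀ P.prime.ne_zero h2).symm

/-- The Weierstrass factorisation `P = f · h` over `ℤ_p` (`f` distinguished, `h` a unit). -/
theorem isWeierstrassFactorization :
    (P.P).IsWeierstrassFactorization ((P.P).weierstrassDistinguished P.map_residue_ne_zero)
      ((P.P).weierstrassUnit P.map_residue_ne_zero) :=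
  PowerSeries.isWeierstrassFactorization_weierstrassDistinguished_weierstrassUnit P.map_residue_ne_zero

/-- `O_P` is a finite `ℤ_p`-module (Weierstrass preparation: `Λ₁/(P) ≅ ℤ_p[X]/(f)`, `f` distinguished). -/
instance moduleFinite : Module.Finite ℤ_[p] P.O := by
  have H := P.isWeierstrassFactorization
  have hf : ((P.P).weierstrassDistinguished P.map_residue_ne_zero).Monic := H.isDistinguishedAt.monic
  haveI : Module.Finite ℤ_[p]
      (Polynomial ℤ_[p] ⧸ Ideal.span {(P.P).weierstrassDistinguished P.map_residue_ne_zero}) :=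
    Module.Finite.of_basis (AdjoinRoot.powerBasis' hf).basis
  exact Module.Finite.equiv H.algEquivQuotient.toLinearEquiv

/-- The point `u_P = T₂ mod P ∈ O_P`. -/
noncomputable def u : P.O := Ideal.Quotient.mk _ PowerSeries.X

theorem u_def : P.u = Ideal.Quotient.mk (Ideal.span {P.P}) PowerSeries.X := rfl

theorem u_mem_nonunits : P.u ∈ nonunits P.O := by
  intro hu
  obtain ⟨v, hv⟩ := hu.exists_right_inv
  obtain ⟨a, rfl⟩ := Ideal.Quotient.mk_surjective v
  rw [u_def, ← map_mul, ← (Ideal.Quotient.mk _).map_one, Ideal.Quotient.mk_eq_mk_iff_sub_mem,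
    Ideal.mem_span_singleton] at hv
  obtain ⟨b, hb⟩ := hv
  have h := congrArg PowerSeries.constantCoeff hb
  rw [map_sub, map_mul, PowerSeries.constantCoeff_X, zero_mul, map_one, zero_sub, map_mul] at h
  have hP0 : ¬ IsUnit (PowerSeries.constantCoeff P.P) := fun h' =>
    P.not_isUnit (PowerSeries.isUnit_iff_constantCoeff.mpr h')
  exact hP0 (isUnit_of_dvd_unit (dvd_neg.mp ⟨_, h⟩) isUnit_one)

theorem aeval_X_eq_coe {R : Type*} [CommRing R] (q : Polynomial R) :
    Polynomial.aeval (PowerSeries.X : PowerSeries R) q = (q : PowerSeries R) := by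
  have : (Polynomial.aeval (PowerSeries.X : PowerSeries R) : Polynomial R →ₐ[R] PowerSeries R) =
      Polynomial.coeToPowerSeries.algHom R := by
    apply Polynomial.algHom_ext
    rw [Polynomial.aeval_X, Polynomial.coeToPowerSeries.algHom_apply, Algebra.algebraMap_self,
      PowerSeries.map_id, id_eq, Polynomial.coe_X]
  rw [this, Polynomial.coeToPowerSeries.algHom_apply, Algebra.algebraMap_self, PowerSeries.map_id, id_eq]

theorem aeval_u (z : Polynomial ℤ_[p]) :
    Polynomial.aeval P.u z = Ideal.Quotient.mk (Ideal.span {P.P}) (z : PowerSeries ℤ_[p]) := by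
  rw [u_def, ← Ideal.Quotient.mkₐ_eq_mk ℤ_[p], Polynomial.aeval_algHom_apply, aeval_X_eq_coe]

theorem aeval_u_ne_zero {z : Polynomial ℤ_[p]} (hz : ¬ P.P ∣ (z : PowerSeries ℤ_[p])) :
    Polynomial.aeval P.u z ≠ 0 := by
  rwa [aeval_u, Ne, Ideal.Quotient.eq_zero_iff_mem, Ideal.mem_span_singleton]

end GoodPrime

variable (p) in
/-- Reduction of coefficients `Λ₁⟦T⟧ → O_P⟦T⟧`. -/
noncomputable def redP (P : GoodPrime p) : PowerSeries (IwasawaAlgebra p) →+* PowerSeries P.O :=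
  PowerSeries.map (Ideal.Quotient.mk (Ideal.span {P.P}))


theorem redP_apply (P : GoodPrime p) (F : PowerSeries (IwasawaAlgebra p)) :
    redP p P F = PowerSeries.map (Ideal.Quotient.mk (Ideal.span {P.P})) F := rfl

theorem C_dvd_of_redP_eq_zero (P : GoodPrime p) {F : PowerSeries (IwasawaAlgebra p)} (hF : redP p P F = 0) :
    PowerSeries.C P.P ∣ F := by
  apply C_dvd_of_forall_dvd_coeff
  intro n
  have := congrArg (PowerSeries.coeff n) hF
  rwa [redP_apply, PowerSeries.coeff_map, map_zero, Ideal.Quotient.eq_zero_iff_mem,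
    Ideal.mem_span_singleton] at this

/-- `ker (Λ₂ → O_P⟦T⟧) = P·Λ₂`. -/
theorem ker_redP (P : GoodPrime p) :
    RingHom.ker (redP p P) = Ideal.span {(PowerSeries.C P.P : IwasawaAlgebra₂ p)} := by
  refine le_antisymm (fun F hF => Ideal.mem_span_singleton.mpr (C_dvd_of_redP_eq_zero P hF)) ?_
  rw [Ideal.span_le, Set.singleton_subset_iff, SetLike.mem_coe, RingHom.mem_ker, redP_apply,
    PowerSeries.map_C, Ideal.Quotient.eq_zero_iff_mem.mpr (Ideal.mem_span_singleton_self _), map_zero]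

theorem GoodPrime.C_ne_zero (P : GoodPrime p) : (PowerSeries.C P.P : IwasawaAlgebra₂ p) ≠ 0 := by
  intro h
  have := congrArg (PowerSeries.constantCoeff (R := IwasawaAlgebra p)) h
  rw [PowerSeries.constantCoeff_C, map_zero] at this
  exact P.prime.ne_zero this

/-- `P` stays prime in `Λ₂ = Λ₁⟦T₁⟧`: `Λ₂/PΛ₂ ≅ O_P⟦T₁⟧` is a domain. -/
theorem GoodPrime.prime_C (P : GoodPrime p) : Prime (PowerSeries.C P.P : IwasawaAlgebra₂ p) := by
  rw [← Ideal.span_singleton_prime P.C_ne_zero, ← ker_redP]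
  exact RingHom.ker_isPrime _

/-- `C P ∤ p` in `Λ₂`. -/
theorem GoodPrime.not_C_dvd_natCast (P : GoodPrime p) :
    ¬ (PowerSeries.C P.P : IwasawaAlgebra₂ p) ∣ (p : IwasawaAlgebra₂ p) := by
  intro h
  have h0 := dvd_coeff_of_C_dvd h 0
  rw [PowerSeries.coeff_zero_eq_constantCoeff, map_natCast] at h0
  exact P.not_dvd h0

/-- `C Q ∣ C a` in `Λ₂` iff `Q ∣ a` in `Λ₁`. -/
theorem C_dvd_C_iff {Q a : IwasawaAlgebra p} :
    (PowerSeries.C Q : IwasawaAlgebra₂ p) ∣ PowerSeries.C a ↔ Q ∣ a := by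
  refine ⟨fun h => ?_, fun h => map_dvd _ h⟩
  have h0 := dvd_coeff_of_C_dvd h 0
  rwa [PowerSeries.coeff_zero_eq_constantCoeff, PowerSeries.constantCoeff_C] at h0

theorem natCast_p_eq_C : (p : IwasawaAlgebra₂ p) = PowerSeries.C (p : IwasawaAlgebra p) :=
  (map_natCast (PowerSeries.C (R := IwasawaAlgebra p)) p).symm

theorem natCast_p_ne_zero₁ : (p : IwasawaAlgebra p) ≠ 0 := by
  intro h
  have := congrArg (PowerSeries.constantCoeff (R := ℤ_[p])) h
  rw [map_natCast, map_zero] at this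
  exact (Nat.cast_ne_zero.mpr (Fact.out : p.Prime).ne_zero) this

theorem natCast_p_ne_zero₂ : (p : IwasawaAlgebra₂ p) ≠ 0 := by
  rw [natCast_p_eq_C]
  intro h
  have := congrArg (PowerSeries.constantCoeff (R := IwasawaAlgebra p)) h
  rw [PowerSeries.constantCoeff_C, map_zero] at this
  exact natCast_p_ne_zero₁ this

variable (p)


/-- The fibre bound of `PatchingBeta`'s hypothesis over a coefficient ring `O`, for `Λ_{2,O} ⊗_{Λ₂} X` and
the image of `G` (the `letI`-algebra structure and tensor product exactly as in `PatchingBeta`). -/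
def FibreBoundOver (O : Type) [CommRing O] [Algebra ℤ_[p] O] (X : Type) [AddCommGroup X]
    [Module (IwasawaAlgebra₂ p) X] (G : IwasawaAlgebra₂ p) (u : O) (t : ℕ) : Prop :=
  letI : Algebra (IwasawaAlgebra₂ p) (PowerSeries (PowerSeries O)) :=
    (PowerSeries.map (PowerSeries.map (algebraMap ℤ_[p] O))).toAlgebra
  FibreBoundAt O p ((PowerSeries (PowerSeries O)) ⊗[IwasawaAlgebra₂ p] X)
    (PowerSeries.map (PowerSeries.map (algebraMap ℤ_[p] O)) G) u t

/-- **(FT) Fibre transport.** The fibre bound at the point `u_P ∈ O_P` for `Λ_{2,O_P} ⊗ X` IS the statement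
`p^t · G ∈ ch_{Λ₂/PΛ₂}(X/PX)` (image of `p^t G` modulo `P`): the evaluation `T₂ ↦ u_P` identifies
`Λ_{2,O_P}/(T₂ - u_P) ≅ O_P⟦T₁⟧ ≅ Λ₂/PΛ₂` (§9.2, §9.4) and the fibre `(Λ_{2,O_P} ⊗ X)/(T₂ - u_P)` with `X/PX`
semilinearly, and characteristic ideals are transported along semilinear isomorphisms
(`Literature…Module.charIdeal_eq_map_of_semilinearEquiv`). -/
def FibreTransport : Prop :=
  ∀ (P : GoodPrime p) (X : Type) [AddCommGroup X] [Module (IwasawaAlgebra₂ p) X]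
    [Module.Finite (IwasawaAlgebra₂ p) X] (G : IwasawaAlgebra₂ p) (t : ℕ),
    FibreBoundOver p P.O X G P.u t →
      Ideal.Quotient.mk (Ideal.span {(PowerSeries.C P.P : IwasawaAlgebra₂ p)})
          ((p : IwasawaAlgebra₂ p) ^ t * G) ∈
        Module.charIdeal (IwasawaAlgebra₂ p ⧸ Ideal.span {(PowerSeries.C P.P : IwasawaAlgebra₂ p)})
          (QuotSMulTop (PowerSeries.C P.P : IwasawaAlgebra₂ p) X)

/-- **(LB) Fibre length lower bound** (PROVED in §9.6, `fibreLengthLowerBound_holds`; the inequality half of a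
Herbrand/Koszul formula for the quotient by a prime `s` transversal to `π`, in the currency of the domain
`R̄ = Λ₂/(s)`): if `X` is killed by some `c` with `s ∤ c`, then at every height-one prime `𝔔` of `R̄`,
`ℓ_𝔔(X/sX) ≥ ℓ_{(π)}(X) · ℓ_𝔔(R̄/π̄R̄)` (dévissage along a prime filtration + the snake for multiplication by
`s` read over `R̄`; the `s`-torsion lengths are finite). -/
def FibreLengthLowerBound : Prop :=
  ∀ (X : Type) [AddCommGroup X] [Module (IwasawaAlgebra₂ p) X] [Module.Finite (IwasawaAlgebra₂ p) X]
    (s π c : IwasawaAlgebra₂ p) (hπ : Prime π)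
    (𝔔 : PrimeSpectrum (IwasawaAlgebra₂ p ⧸ Ideal.span {s})),
    Prime s → ¬ π ∣ s → ¬ s ∣ c → (∀ x : X, c • x = 0) → 𝔔.asIdeal.height = 1 →
    Module.lengthAt (IwasawaAlgebra₂ p) X
          ⟨Ideal.span {π}, (Ideal.span_singleton_prime hπ.ne_zero).mpr hπ⟩ *
        Module.lengthAt (IwasawaAlgebra₂ p ⧸ Ideal.span {s})
          ((IwasawaAlgebra₂ p ⧸ Ideal.span {s}) ⧸
            Ideal.span {Ideal.Quotient.mk (Ideal.span {s}) π}) 𝔔 ≤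
      Module.lengthAt (IwasawaAlgebra₂ p ⧸ Ideal.span {s}) (QuotSMulTop s X) 𝔔


variable {p}

end GoodPrimes

/-! ## E1. The quantitative local endgame (PROVED)

Over a Noetherian domain `A` with a height-one prime `𝔔 ∋ q`: a finitely generated module `M` killed by some
`c ≠ 0`, `π = q^N · r ≠ 0`, `v ∉ 𝔔`. Then `k · ℓ_𝔔(A/π) ≤ ℓ_𝔔(M)` and `q^t · π^g · q^m · v ∈ ch_A(M)` with
`g < k` force `N ≤ t + m`: `ch_A(M) ⊆ 𝔔^ℓ` (`ℓ = ℓ_𝔔(M) < ∞`), `ℓ ≤ ℓ_𝔔(A/𝔔^ℓ) ≤ ℓ_𝔔(A/(q^t π^g q^m v)) =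
(t + m)·d + g·ℓ_𝔔(A/π)` (`d = ℓ_𝔔(A/q) ≥ 1`), while `ℓ_𝔔(A/π) ≥ N·d`. In the sketch's (LE) the slack `p^t` and
the prime `π̄` live at DIFFERENT primes (`v̄ ∉ 𝔔`); at a vertical prime they meet at `𝔔 = (p, T₂)/(Q)`, and the
contradiction becomes quantitative — distance `N` against slack `t` plus depth `m`. -/

section Endgame

open Summit.BirchSwinnertonDyer.BirchSwinnertonDyer.Theorems.SignedBaseChangeAcDivSpecialization

variable {A : Type*} [CommRing A] [IsNoetherianRing A] [IsDomain A]

/-- `n ≤ ℓ_𝔮(A/𝔮^n)` for a non-zero prime `𝔮` of a Noetherian domain (verbatim from the sketch §9.5). -/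
theorem natCast_le_lengthAt_quotient_pow (𝔮 : PrimeSpectrum A) (h𝔮 : 𝔮.asIdeal ≠ ⊥) (n : ℕ) :
    (n : ℕ∞) ≤ Module.lengthAt A (A ⧸ 𝔮.asIdeal ^ n) 𝔮 := by
  classical
  induction n with
  | zero => simp
  | succ n ih =>
    have hST : 𝔮.asIdeal ^ (n + 1) ≤ 𝔮.asIdeal ^ n := Ideal.pow_le_pow_right (Nat.le_succ n)
    -- the layer `K = 𝔮^n/𝔮^(n+1) ⊆ A/𝔮^(n+1)`
    let K : Submodule A (A ⧸ 𝔮.asIdeal ^ (n + 1)) :=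
      Submodule.map (𝔮.asIdeal ^ (n + 1)).mkQ (𝔮.asIdeal ^ n)
    have hsplit := Module.lengthAt_eq_add_quotient (R := A) (M := A ⧸ 𝔮.asIdeal ^ (n + 1)) K 𝔮
    have hquot : Module.lengthAt A ((A ⧸ 𝔮.asIdeal ^ (n + 1)) ⧸ K) 𝔮 =
        Module.lengthAt A (A ⧸ 𝔮.asIdeal ^ n) 𝔮 :=
      Module.lengthAt_eq_of_linearEquiv
        (Submodule.quotientQuotientEquivQuotient (𝔮.asIdeal ^ (n + 1)) (𝔮.asIdeal ^ n) hST) 𝔮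
    -- the layer is non-zero at `𝔮`
    have hK : Module.lengthAt A K 𝔮 ≠ 0 := by
      intro h0
      obtain ⟨u, hu, huK⟩ := LocalLength.exists_notMem_forall_smul_eq_zero_of_lengthAt_eq_zero h0
      -- `u • 𝔮^n ⊆ 𝔮^(n+1)`
      have hincl : ∀ x ∈ 𝔮.asIdeal ^ n, u * x ∈ 𝔮.asIdeal ^ (n + 1) := by
        intro x hx
        have h := congrArg Subtype.val
          (huK ⟨(𝔮.asIdeal ^ (n + 1)).mkQ x, Submodule.mem_map_of_mem (f := (𝔮.asIdeal ^ (n + 1)).mkQ) hx⟩)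
        simp only [Submodule.coe_smul, ZeroMemClass.coe_zero, Submodule.mkQ_apply] at h
        rw [← Submodule.Quotient.mk_smul, Submodule.Quotient.mk_eq_zero, smul_eq_mul] at h
        exact h
      -- so `𝔮^n` (a finitely generated torsion-free module) is zero at `𝔮`: absurd
      have hT0 : Module.lengthAt A ↥(𝔮.asIdeal ^ n) 𝔮 = 0 := by
        refine LocalLength.lengthAt_eq_zero_of_forall_exists_notMem 𝔮 fun m => ⟨u, hu, ?_⟩
        rw [Submodule.mem_smul_top_iff, Submodule.coe_smul, Ideal.smul_eq_mul, ← pow_succ']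
        exact hincl m m.2
      obtain ⟨w, hw, hwT⟩ := LocalLength.exists_notMem_forall_smul_eq_zero_of_lengthAt_eq_zero hT0
      obtain ⟨a, ha, ha0⟩ := Submodule.exists_mem_ne_zero_of_ne_bot h𝔮
      have h2 := congrArg Subtype.val (hwT ⟨a ^ n, Ideal.pow_mem_pow ha n⟩)
      simp only [Submodule.coe_smul, ZeroMemClass.coe_zero, smul_eq_mul] at h2
      rcases mul_eq_zero.mp h2 with h3 | h3
      · exact hw (h3 ▸ 𝔮.asIdeal.zero_mem)
      · exact pow_ne_zero n ha0 h3
    calc ((n + 1 : ℕ) : ℕ∞) = (n : ℕ∞) + 1 := by push_cast; rfl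
      _ ≤ Module.lengthAt A (A ⧸ 𝔮.asIdeal ^ n) 𝔮 + Module.lengthAt A K 𝔮 :=
          add_le_add ih (Order.one_le_iff_ne_zero.mpr hK)
      _ = Module.lengthAt A (A ⧸ 𝔮.asIdeal ^ (n + 1)) 𝔮 := by rw [hsplit, hquot, add_comm]

/-- A finite local length as a natural number. -/
theorem exists_eq_natCast_of_ne_top {x : ℕ∞} (h : x ≠ ⊤) : ∃ n : ℕ, x = n :=
  ⟨x.toNat, (ENat.coe_toNat h).symm⟩

/-- **The quantitative endgame.** See the section docstring. -/
theorem endgame_quant {M : Type*} [AddCommGroup M] [Module A M] [Module.Finite A M]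
    {c q π r v : A} {g k t m N : ℕ} (hc : c ≠ 0) (hcM : ∀ x : M, c • x = 0)
    (𝔔 : PrimeSpectrum A) (hht : 𝔔.asIdeal.height = 1) (hq𝔔 : q ∈ 𝔔.asIdeal) (hq : q ≠ 0)
    (hπ : π ≠ 0) (hπr : π = q ^ N * r) (hv𝔔 : v ∉ 𝔔.asIdeal) (hgk : g < k) (hN : t + m < N)
    (H1 : (k : ℕ∞) * Module.lengthAt A (A ⧸ Ideal.span {π}) 𝔔 ≤ Module.lengthAt A M 𝔔)
    (H2 : q ^ t * π ^ g * (q ^ m * v) ∈ Module.charIdeal A M) : False := by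
  classical
  have hr : r ≠ 0 := by rintro rfl; exact hπ (by rw [hπr, mul_zero])
  have hv0 : v ≠ 0 := fun h => hv𝔔 (h ▸ 𝔔.asIdeal.zero_mem)
  have hcM' : Module.IsTorsionBy A M c := fun x => hcM x
  have hT : Module.IsTorsion A M := fun x => ⟨⟨c, mem_nonZeroDivisors_of_ne_zero hc⟩, hcM x⟩
  -- `ℓ = ℓ_𝔔(M) < ∞`, `x ∈ 𝔔^ℓ`
  have hℓtop : Module.lengthAt A M 𝔔 ≠ ⊤ := Module.lengthAt_ne_top_of_isTorsionBy hc hcM' 𝔔 hht.le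
  have hmem : q ^ t * π ^ g * (q ^ m * v) ∈ 𝔔.asIdeal ^ (Module.lengthAt A M 𝔔).toNat :=
    Summit.BirchSwinnertonDyer.Rank1Residual.X11b.CongruenceLimit.charIdeal_le_pow_lengthAt
      (M := M) hT 𝔔 hht H2
  -- cyclic lengths are finite
  have hcyc_top : ∀ {a : A}, a ≠ 0 → Module.lengthAt A (A ⧸ Ideal.span {a}) 𝔔 ≠ ⊤ := by
    intro a ha
    refine Module.lengthAt_ne_top_of_isTorsionBy (M := A ⧸ Ideal.span {a}) ha (fun x => ?_) 𝔔 hht.le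
    obtain ⟨b, rfl⟩ := Ideal.Quotient.mk_surjective x
    rw [Algebra.smul_def, Ideal.Quotient.algebraMap_eq, ← map_mul, Ideal.Quotient.eq_zero_iff_mem]
    exact Ideal.mul_mem_right b _ (Ideal.mem_span_singleton_self a)
  -- `d = ℓ_𝔔(A/q) ≥ 1`
  have hd1 : 1 ≤ Module.lengthAt A (A ⧸ Ideal.span {q}) 𝔔 := by
    have hle : Ideal.span {q} ≤ 𝔔.asIdeal := (Ideal.span_singleton_le_iff_mem _).mpr hq𝔔
    calc (1 : ℕ∞) = Module.lengthAt A (A ⧸ 𝔔.asIdeal) 𝔔 := (Module.lengthAt_quotient_self 𝔔).symm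
      _ ≤ Module.lengthAt A (A ⧸ Ideal.span {q}) 𝔔 :=
          Module.lengthAt_le_of_surjective (Submodule.factor hle) (Submodule.factor_surjective hle) 𝔔
  -- `ℓ_𝔔(A/π) = N·d + ℓ_𝔔(A/r)`
  have hLeq : Module.lengthAt A (A ⧸ Ideal.span {π}) 𝔔 =
      N • Module.lengthAt A (A ⧸ Ideal.span {q}) 𝔔 + Module.lengthAt A (A ⧸ Ideal.span {r}) 𝔔 := by
    rw [hπr, Module.lengthAt_quotient_span_singleton_mul r (pow_ne_zero N hq) 𝔔,
      Module.lengthAt_quotient_span_singleton_pow hq N 𝔔]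
  -- `ℓ ≤ ℓ_𝔔(A/𝔔^ℓ) ≤ ℓ_𝔔(A/x) = t·d + g·ℓ_𝔔(A/π) + m·d + 0`
  have h𝔔ne : 𝔔.asIdeal ≠ ⊥ := fun h => hq (by rw [h, Ideal.mem_bot] at hq𝔔; exact hq𝔔)
  have hN1 := natCast_le_lengthAt_quotient_pow 𝔔 h𝔔ne (Module.lengthAt A M 𝔔).toNat
  have hle2 : Module.lengthAt A (A ⧸ 𝔔.asIdeal ^ (Module.lengthAt A M 𝔔).toNat) 𝔔 ≤
      Module.lengthAt A (A ⧸ Ideal.span {q ^ t * π ^ g * (q ^ m * v)}) 𝔔 := by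
    have hle : Ideal.span {q ^ t * π ^ g * (q ^ m * v)} ≤ 𝔔.asIdeal ^ (Module.lengthAt A M 𝔔).toNat :=
      (Ideal.span_singleton_le_iff_mem _).mpr hmem
    exact Module.lengthAt_le_of_surjective (Submodule.factor hle) (Submodule.factor_surjective hle) 𝔔
  have hxeq : Module.lengthAt A (A ⧸ Ideal.span {q ^ t * π ^ g * (q ^ m * v)}) 𝔔 =
      t • Module.lengthAt A (A ⧸ Ideal.span {q}) 𝔔 + g • Module.lengthAt A (A ⧸ Ideal.span {π}) 𝔔 +
        m • Module.lengthAt A (A ⧸ Ideal.span {q}) 𝔔 := by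
    rw [Module.lengthAt_quotient_span_singleton_mul (q ^ m * v)
        (mul_ne_zero (pow_ne_zero t hq) (pow_ne_zero g hπ)) 𝔔,
      Module.lengthAt_quotient_span_singleton_mul (π ^ g) (pow_ne_zero t hq) 𝔔,
      Module.lengthAt_quotient_span_singleton_mul v (pow_ne_zero m hq) 𝔔,
      Module.lengthAt_quotient_span_singleton_pow hq t 𝔔, Module.lengthAt_quotient_span_singleton_pow hπ g 𝔔,
      Module.lengthAt_quotient_span_singleton_pow hq m 𝔔,
      Module.lengthAt_quotient_eq_zero_of_not_le (I := Ideal.span {v})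
        (by rwa [Ideal.span_singleton_le_iff_mem]), add_zero]
  -- pass to `ℕ`
  obtain ⟨ℓ₀, hℓ₀⟩ := exists_eq_natCast_of_ne_top hℓtop
  obtain ⟨d₀, hd₀⟩ := exists_eq_natCast_of_ne_top (hcyc_top hq)
  obtain ⟨L₀, hL₀⟩ := exists_eq_natCast_of_ne_top (hcyc_top hπ)
  obtain ⟨R₀, hR₀⟩ := exists_eq_natCast_of_ne_top (hcyc_top hr)
  have key : (k : ℕ∞) * L₀ ≤ t • (d₀ : ℕ∞) + g • (L₀ : ℕ∞) + m • (d₀ : ℕ∞) := by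
    calc (k : ℕ∞) * L₀ = (k : ℕ∞) * Module.lengthAt A (A ⧸ Ideal.span {π}) 𝔔 := by rw [hL₀]
      _ ≤ Module.lengthAt A M 𝔔 := H1
      _ = (Module.lengthAt A M 𝔔).toNat := (ENat.coe_toNat hℓtop).symm
      _ ≤ _ := hN1
      _ ≤ _ := hle2
      _ = _ := hxeq
      _ = _ := by rw [hd₀, hL₀]
  rw [hd₀, hR₀, hL₀] at hLeq
  rw [hd₀] at hd1
  simp only [nsmul_eq_mul] at key hLeq
  have key' : k * L₀ ≤ t * d₀ + g * L₀ + m * d₀ := by exact_mod_cast key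
  have hLeq' : L₀ = N * d₀ + R₀ := by exact_mod_cast hLeq
  have hd1' : 1 ≤ d₀ := by exact_mod_cast hd1
  -- `(k - g)·L₀ ≤ (t + m)·d₀`, `L₀ ≥ N·d₀ ≥ (t + m + 1)·d₀`
  have h1 : (g + 1) * L₀ ≤ k * L₀ := Nat.mul_le_mul_right L₀ hgk
  have h2 : L₀ ≤ (t + m) * d₀ := by nlinarith
  have h3 : (t + m + 1) * d₀ ≤ N * d₀ := Nat.mul_le_mul_right d₀ hN
  nlinarith

end Endgame

/-! ## E2. The depth lemma (PROVED): `p`-adic depth of a non-zero element at a height-one prime -/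

section Depth

variable {A : Type*} [CommRing A] [IsNoetherianRing A] [IsDomain A]

/-- **Depth.** For a height-one prime `𝔔` of a Noetherian domain, `q ∈ 𝔔` and `y ≠ 0` there are `m`, `s ∉ 𝔔`
and `h` with `s · q^m = y · h` (if `y ∈ 𝔔`, `𝔔` is minimal over `(y)`, so `𝔔 A_𝔔 = √(y A_𝔔)` and
`q^m ∈ y A_𝔔`; if `y ∉ 𝔔` take `m = 0`, `s = y`). -/
theorem exists_depth (𝔔 : PrimeSpectrum A) (hht : 𝔔.asIdeal.height = 1) {q y : A}
    (hq : q ∈ 𝔔.asIdeal) (hy : y ≠ 0) :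
    ∃ (m : ℕ) (s h : A), s ∉ 𝔔.asIdeal ∧ s * q ^ m = y * h := by
  classical
  by_cases hy𝔔 : y ∈ 𝔔.asIdeal
  swap
  · exact ⟨0, y, 1, hy𝔔, by ring⟩
  -- `𝔔` is a minimal prime of `(y)`
  have hmin : 𝔔.asIdeal ∈ (Ideal.span {y}).minimalPrimes := by
    refine ⟨⟨𝔔.isPrime, (Ideal.span_singleton_le_iff_mem _).mpr hy𝔔⟩, ?_⟩
    rintro 𝔮 ⟨h𝔮, hy𝔮⟩ h𝔮𝔔
    haveI := h𝔮
    have h𝔮ne : 𝔮 ≠ ⊥ := fun h => hy (by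
      have := hy𝔮 (Ideal.mem_span_singleton_self y)
      rwa [h, Ideal.mem_bot] at this)
    have h1 : 𝔔.asIdeal.height ≤ 𝔮.height := by
      rw [hht, Order.one_le_iff_ne_zero, Ne, Ideal.height_eq_zero_iff_eq_bot]
      exact h𝔮ne
    exact (Ideal.eq_of_le_of_height_le (I := 𝔮) (J := 𝔔.asIdeal) h𝔮𝔔 h1).ge
  -- localise at `𝔔`
  let B := Localization.AtPrime 𝔔.asIdeal
  have hrad := IsLocalization.AtPrime.radical_map_of_mem_minimalPrimes (A := B) 𝔔.asIdeal
    (Ideal.span {y}) hmin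
  have hqrad : algebraMap A B q ∈ ((Ideal.span {y}).map (algebraMap A B)).radical := by
    rw [hrad]; exact Ideal.mem_map_of_mem _ hq
  obtain ⟨m, hm⟩ := hqrad
  rw [← map_pow, IsLocalization.mem_map_algebraMap_iff 𝔔.asIdeal.primeCompl B] at hm
  obtain ⟨⟨⟨a, ha⟩, ⟨b, hb⟩⟩, hab⟩ := hm
  simp only at hab
  rw [← map_mul, IsLocalization.eq_iff_exists 𝔔.asIdeal.primeCompl B] at hab
  obtain ⟨⟨e, he⟩, hab⟩ := hab
  simp only at hab
  obtain ⟨a', rfl⟩ := Ideal.mem_span_singleton'.mp ha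
  refine ⟨m, e * b, e * a', ?_, ?_⟩
  · intro hmem
    rcases 𝔔.isPrime.mem_or_mem hmem with h | h
    · exact he h
    · exact hb h
  · calc e * b * q ^ m = e * (q ^ m * b) := by ring
      _ = e * (a' * y) := hab
      _ = y * (e * a') := by ring

end Depth

/-! ## E3. The prime `𝔔̄_Q = (p, T₂)/(Q)` of `Λ₂/(Q)` (PROVED)

`𝔔₀ = ker (Λ₂ → 𝔽_p⟦T₁⟧) = (p, T₂)` has height `2` (`≠ 𝔪`, `dim Λ₂ = 3`); for a good prime `Q` of `Λ₁`,
`C Q ∈ 𝔔₀` and `𝔔̄_Q = 𝔔₀/(C Q)` is a height-one prime of the domain `Λ₂/(C Q)` through `p̄`: a prime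
`𝔮̄ ∋ p̄` below `𝔔̄_Q` lifts to `(C Q) ⊊ 𝔮 ⊆ 𝔔₀`, `ht 𝔮 ≥ 2 ≥ ht 𝔔₀`, so `𝔮 = 𝔔₀` — `𝔔̄_Q` is minimal over the
principal ideal `(p̄)` (Krull). It is the ONLY prime of `Λ₂/(C Q)` above `p̄`, for every `Q`: this is where the
fibres of all approximants of a vertical prime are read, with no comparison of residue orders. -/

section KerResidue

open Literature.NumberTheory.IwasawaTheory

variable {p : ℕ} [Fact p.Prime]

variable (p) in
/-- `ht 𝔪_{Λ₂} = 3` (sketch §9.7). -/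
theorem height_maximalIdeal₂ :
    (IsLocalRing.maximalIdeal (IwasawaAlgebra₂ p)).height = 3 := by
  have h : ((IsLocalRing.maximalIdeal (IwasawaAlgebra₂ p)).height : WithBot ℕ∞) =
      ((3 : ℕ∞) : WithBot ℕ∞) := by
    rw [IsLocalRing.maximalIdeal_height_eq_ringKrullDim]
    exact ringKrullDim_iwasawaAlgebraTwoVar p
  exact_mod_cast h

/-- In a Noetherian ring: a prime strictly above a principal prime `(π)`, `π` a non-zero-divisor, has
height `≥ 2` (sketch §9.7). -/
theorem two_le_height_of_span_lt {R : Type*} [CommRing R] [IsNoetherianRing R] {π : R}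
    (hπ : π ∈ nonZeroDivisors R) [(Ideal.span {π}).IsPrime] {𝔔 : Ideal R} [𝔔.IsPrime]
    (hlt : Ideal.span {π} < 𝔔) : (2 : ℕ∞) ≤ 𝔔.height := by
  have h1 := Ideal.one_le_height_span_singleton_of_mem_nonZeroDivisors hπ
  have h2 := Ideal.height_strict_mono_of_isPrime hlt
  calc (2 : ℕ∞) = 1 + 1 := one_add_one_eq_two.symm
    _ ≤ (Ideal.span {π}).height + 1 := add_le_add h1 le_rfl
    _ ≤ 𝔔.height := Order.add_one_le_of_lt h2

variable (p) in
/-- The prime `𝔔₀ = ker (Λ₂ → k⟦T₁⟧)` of `T₁`-coefficientwise reduction modulo `𝔪_{Λ₁} = (p, T₂)` (sketch §9.7). -/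
noncomputable def kerResidue : Ideal (IwasawaAlgebra₂ p) :=
  RingHom.ker (PowerSeries.map (IsLocalRing.residue (IwasawaAlgebra p)))

theorem mem_kerResidue_iff {y : IwasawaAlgebra₂ p} :
    y ∈ kerResidue p ↔ PowerSeries.map (IsLocalRing.residue (IwasawaAlgebra p)) y = 0 :=
  RingHom.mem_ker

theorem kerResidue_isPrime : (kerResidue p).IsPrime :=
  RingHom.ker_isPrime _

theorem X_notMem_kerResidue : (PowerSeries.X : IwasawaAlgebra₂ p) ∉ kerResidue p := by
  intro h
  rw [mem_kerResidue_iff, PowerSeries.map_X] at h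
  exact PowerSeries.X_ne_zero h

theorem X_mem_maximalIdeal₂ :
    (PowerSeries.X : IwasawaAlgebra₂ p) ∈ IsLocalRing.maximalIdeal (IwasawaAlgebra₂ p) := by
  rw [IsLocalRing.mem_maximalIdeal, mem_nonunits_iff, PowerSeries.isUnit_iff_constantCoeff,
    PowerSeries.constantCoeff_X]
  exact not_isUnit_zero

theorem kerResidue_ne_maximalIdeal :
    kerResidue p ≠ IsLocalRing.maximalIdeal (IwasawaAlgebra₂ p) := fun h =>
  X_notMem_kerResidue (h ▸ X_mem_maximalIdeal₂)

/-- `C a ∈ 𝔔₀` for every non-unit `a ∈ Λ₁`. -/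
theorem C_mem_kerResidue {a : IwasawaAlgebra p} (ha : ¬ IsUnit a) :
    (PowerSeries.C a : IwasawaAlgebra₂ p) ∈ kerResidue p := by
  rw [mem_kerResidue_iff, PowerSeries.map_C, (IsLocalRing.residue_eq_zero_iff _).mpr
    ((IsLocalRing.mem_maximalIdeal _).mpr ha), map_zero]

theorem natCast_mem_kerResidue : (p : IwasawaAlgebra₂ p) ∈ kerResidue p := by
  rw [natCast_p_eq_C]; exact C_mem_kerResidue GoodPrime.not_isUnit_p

/-- `ht 𝔔₀ ≤ 2`. -/
theorem height_kerResidue_le_two : (kerResidue p).height ≤ 2 := by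
  haveI := kerResidue_isPrime (p := p)
  have hlt : kerResidue p < IsLocalRing.maximalIdeal (IwasawaAlgebra₂ p) :=
    lt_of_le_of_ne (IsLocalRing.le_maximalIdeal (kerResidue_isPrime.ne_top)) kerResidue_ne_maximalIdeal
  have h := Ideal.height_strict_mono_of_isPrime hlt
  rw [height_maximalIdeal₂ p] at h
  have h3 : (3 : ℕ∞) = 2 + 1 := by norm_num
  rw [h3] at h
  exact Order.le_of_lt_add_one h

/-- The prime `𝔔̄_Q = 𝔔₀/(C Q)` of `Λ₂/(C Q)`. -/
noncomputable def qbar (Q : GoodPrime p) :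
    PrimeSpectrum (IwasawaAlgebra₂ p ⧸ Ideal.span {(PowerSeries.C Q.P : IwasawaAlgebra₂ p)}) :=
  ⟨(kerResidue p).map (Ideal.Quotient.mk (Ideal.span {(PowerSeries.C Q.P : IwasawaAlgebra₂ p)})), by
    haveI := kerResidue_isPrime (p := p)
    refine Ideal.map_isPrime_of_surjective Ideal.Quotient.mk_surjective ?_
    rw [Ideal.mk_ker]
    exact (Ideal.span_singleton_le_iff_mem _).mpr (C_mem_kerResidue Q.not_isUnit)⟩

theorem span_C_le_kerResidue (Q : GoodPrime p) :
    Ideal.span {(PowerSeries.C Q.P : IwasawaAlgebra₂ p)} ≤ kerResidue p :=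
  (Ideal.span_singleton_le_iff_mem _).mpr (C_mem_kerResidue Q.not_isUnit)

theorem qbar_asIdeal (Q : GoodPrime p) : (qbar Q).asIdeal =
    (kerResidue p).map (Ideal.Quotient.mk (Ideal.span {(PowerSeries.C Q.P : IwasawaAlgebra₂ p)})) := rfl

/-- `mk z ∈ 𝔔̄_Q ↔ z ∈ 𝔔₀`. -/
theorem mk_mem_qbar_iff (Q : GoodPrime p) {z : IwasawaAlgebra₂ p} :
    Ideal.Quotient.mk (Ideal.span {(PowerSeries.C Q.P : IwasawaAlgebra₂ p)}) z ∈ (qbar Q).asIdeal ↔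
      z ∈ kerResidue p :=
  Ideal.mem_quotient_iff_mem (span_C_le_kerResidue Q)

theorem natCast_mem_qbar (Q : GoodPrime p) :
    Ideal.Quotient.mk (Ideal.span {(PowerSeries.C Q.P : IwasawaAlgebra₂ p)}) (p : IwasawaAlgebra₂ p) ∈
      (qbar Q).asIdeal :=
  (mk_mem_qbar_iff Q).mpr natCast_mem_kerResidue

theorem mk_natCast_ne_zero (Q : GoodPrime p) :
    Ideal.Quotient.mk (Ideal.span {(PowerSeries.C Q.P : IwasawaAlgebra₂ p)}) (p : IwasawaAlgebra₂ p) ≠ 0 := by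
  rw [Ne, Ideal.Quotient.eq_zero_iff_mem, Ideal.mem_span_singleton]
  exact Q.not_C_dvd_natCast

/-- **`𝔔̄_Q` has height one.** -/
theorem height_qbar (Q : GoodPrime p) : (qbar Q).asIdeal.height = 1 := by
  classical
  haveI h0 := kerResidue_isPrime (p := p)
  set s : IwasawaAlgebra₂ p := PowerSeries.C Q.P with hs_def
  haveI hsI : (Ideal.span {s}).IsPrime := (Ideal.span_singleton_prime Q.C_ne_zero).mpr Q.prime_C
  have hker : Ideal.span {s} ≤ kerResidue p := span_C_le_kerResidue Q
  apply le_antisymm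
  · -- `≤ 1`: minimal over the principal ideal `(p̄)`
    refine Ideal.height_le_one_of_isPrincipal_of_mem_minimalPrimes
      (Ideal.span {Ideal.Quotient.mk (Ideal.span {s}) (p : IwasawaAlgebra₂ p)}) _ ⟨⟨(qbar Q).isPrime, ?_⟩, ?_⟩
    · exact (Ideal.span_singleton_le_iff_mem _).mpr (natCast_mem_qbar Q)
    · rintro 𝔮 ⟨h𝔮prime, h𝔮p⟩ h𝔮le
      haveI := h𝔮prime
      -- lift to `Λ₂`
      set 𝔮' := Ideal.comap (Ideal.Quotient.mk (Ideal.span {s})) 𝔮 with h𝔮'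
      have hp𝔮' : (p : IwasawaAlgebra₂ p) ∈ 𝔮' := h𝔮p (Ideal.mem_span_singleton_self _)
      have hs𝔮' : s ∈ 𝔮' := by
        rw [h𝔮', Ideal.mem_comap, Ideal.Quotient.eq_zero_iff_mem.mpr (Ideal.mem_span_singleton_self _)]
        exact 𝔮.zero_mem
      have h𝔮'le : 𝔮' ≤ kerResidue p := fun z hz => (Ideal.mem_quotient_iff_mem hker).mp (h𝔮le hz)
      have hlt : Ideal.span {s} < 𝔮' := by
        refine lt_of_le_of_ne ((Ideal.span_singleton_le_iff_mem _).mpr hs𝔮') (fun h => ?_)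
        have : (p : IwasawaAlgebra₂ p) ∈ Ideal.span {s} := by rw [h]; exact hp𝔮'
        exact Q.not_C_dvd_natCast (Ideal.mem_span_singleton.mp this)
      have h2 := two_le_height_of_span_lt (mem_nonZeroDivisors_of_ne_zero Q.C_ne_zero) hlt
      have heq : 𝔮' = kerResidue p :=
        Ideal.eq_of_le_of_height_le (I := 𝔮') (J := kerResidue p) h𝔮'le (height_kerResidue_le_two.trans h2)
      intro z hz
      rw [qbar_asIdeal, ← heq, h𝔮', Ideal.map_comap_of_surjective _ Ideal.Quotient.mk_surjective] at hz
      exact hz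
  · -- `≥ 1`: `𝔔̄_Q ≠ 0` in the domain `Λ₂/(C Q)`
    rw [Order.one_le_iff_ne_zero, Ne, Ideal.height_eq_zero_iff_eq_bot]
    intro h0
    have hmem := natCast_mem_qbar Q
    rw [h0, Ideal.mem_bot] at hmem
    exact mk_natCast_ne_zero Q hmem

end KerResidue

/-! ## E4. The vertical theorem for EVERY good prime (PROVED)

`P` a good prime of `Λ₁` (any Weierstrass degree), `π = C P`, `k = ℓ_{(π)}(X)`, `G = π^g · G₁`, `π ∤ G₁`.
Suppose `g < k`. DEPTH (E2 at `𝔔̄_P`): `s₀ p^m ≡ G₁ h₀ (mod π)` with `s₀ ∉ 𝔔₀`. AVOIDANCE (`exists_avoid`):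
a non-zero `w ∈ Λ₁`, divisible by `P` and by one `Λ₁`-element under each of the finitely many height-one
support primes of `X`; a good prime `Q ∤ w` then has `Q ≁ P` and `ℓ_{(Q)}(X) = 0`, whence an annihilator
`u ∉ (Q)`. FAMILY (`VFamily`): such a `Q` with `P ≡ Q (mod p^N)`, `N ≥ m + 1 + t`, and the fibre bound
`p^t G ∈ ch(fibre at Q)`. Read in `A = Λ₂/(Q)` at `𝔔 = 𝔔̄_Q ∋ q = p̄`: `π̄ = q^N · C r̄`, `Ḡ₁ h̄₀ = q^m · v̄`
with `v = s₀ - p^{N-m} (C r) r₁ ∉ 𝔔₀`; (FT) gives `q^t π̄^g q^m v̄ ∈ ch_A(X/QX)`, (LB) gives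
`k · ℓ_𝔔(A/π̄) ≤ ℓ_𝔔(X/QX)`; `endgame_quant` ⟹ `N ≤ t + m`, contradiction. -/

section Vertical

open Summit.BirchSwinnertonDyer.BirchSwinnertonDyer.Theorems.SignedBaseChangeAcDivSpecialization

variable {p : ℕ} [Fact p.Prime]

/-- The point `(C P) ∈ Spec Λ₂` of a good prime. -/
noncomputable def GoodPrime.pt (P : GoodPrime p) : PrimeSpectrum (IwasawaAlgebra₂ p) :=
  ⟨Ideal.span {(PowerSeries.C P.P : IwasawaAlgebra₂ p)},
    (Ideal.span_singleton_prime P.C_ne_zero).mpr P.prime_C⟩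

theorem GoodPrime.pt_asIdeal (P : GoodPrime p) :
    P.pt.asIdeal = Ideal.span {(PowerSeries.C P.P : IwasawaAlgebra₂ p)} := rfl

theorem GoodPrime.height_pt (P : GoodPrime p) : P.pt.asIdeal.height = 1 :=
  Ideal.height_span_singleton_eq_one_of_mem_nonZeroDivisors (mem_nonZeroDivisors_of_ne_zero P.C_ne_zero)
    P.prime_C.not_unit

variable (p) in
/-- **(VFamily P X G)** — fibre bounds along an approximating family of `P` with SUBLINEAR slack: for every
`B` and every non-zero `w ∈ Λ₁` there is a good prime `Q ∤ w` with `P ≡ Q (mod p^N)`, `N ≥ B + t`, and the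
fibre bound `p^t · G ∈ ch_{Λ_{2,O_Q}}(Λ_{2,O_Q} ⊗ X / (T₂ - u_Q))` (`FibreBoundOver`, the hypothesis shape of
`PatchingBeta`). The canonical suppliers are the twisted translates `ι_{1+c}(P)` of §E5 (for which `Q ∤ w`
excludes only finitely many `c`); the arithmetic content is the fibre bound at those points. -/
def VFamily (P : GoodPrime p) (X : Type) [AddCommGroup X] [Module (IwasawaAlgebra₂ p) X]
    (G : IwasawaAlgebra₂ p) : Prop :=
  ∀ (B : ℕ) (w : IwasawaAlgebra p), w ≠ 0 →
    ∃ (Q : GoodPrime p) (N t : ℕ), ¬ Q.P ∣ w ∧ (p : IwasawaAlgebra p) ^ N ∣ (P.P - Q.P) ∧ B + t ≤ N ∧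
      FibreBoundOver p Q.O X G Q.u t

/-- **Avoidance.** For a finitely generated torsion `X` and a good prime `P` there is a non-zero `w ∈ Λ₁`,
divisible by `P`, such that every good prime `Q ∤ w` has `ℓ_{(Q)}(X) = 0`, i.e. an annihilator `u` of `X`
with `C Q ∤ u` (finiteness of the height-one support, tree `finite_heightOne_inter_mulSupport`, and
`exists_notMem_forall_smul_eq_zero_of_lengthAt_eq_zero`). -/
theorem exists_avoid (X : Type) [AddCommGroup X] [Module (IwasawaAlgebra₂ p) X]
    [Module.Finite (IwasawaAlgebra₂ p) X] (hT : Module.IsTorsion (IwasawaAlgebra₂ p) X) (P : GoodPrime p) :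
    ∃ w : IwasawaAlgebra p, w ≠ 0 ∧ P.P ∣ w ∧ ∀ Q : GoodPrime p, ¬ Q.P ∣ w →
      ∃ u : IwasawaAlgebra₂ p, ¬ (PowerSeries.C Q.P : IwasawaAlgebra₂ p) ∣ u ∧ ∀ x : X, u • x = 0 := by
  classical
  obtain ⟨c, hc, hc0⟩ := Submodule.exists_mem_ne_zero_of_ne_bot
    (Module.annihilator_ne_bot_of_isTorsion X hT)
  have hcX : Module.IsTorsionBy (IwasawaAlgebra₂ p) X c := fun x => Module.mem_annihilator.mp hc x
  have hfin := Module.finite_heightOne_inter_mulSupport (M := X) hc0 hcX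
  -- one `Λ₁`-witness under each support prime meeting `C(Λ₁) ∖ 0`
  let e : PrimeSpectrum (IwasawaAlgebra₂ p) → IwasawaAlgebra p := fun 𝔭 =>
    if h : ∃ a : IwasawaAlgebra p, a ≠ 0 ∧ (PowerSeries.C a : IwasawaAlgebra₂ p) ∈ 𝔭.asIdeal
    then h.choose else 1
  have he0 : ∀ 𝔭, e 𝔭 ≠ 0 := by
    intro 𝔭
    simp only [e]
    split_ifs with h
    · exact h.choose_spec.1
    · exact one_ne_zero
  refine ⟨P.P * ∏ 𝔭 ∈ hfin.toFinset, e 𝔭, mul_ne_zero P.prime.ne_zero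
    (Finset.prod_ne_zero_iff.mpr fun 𝔭 _ => he0 𝔭), dvd_mul_right _ _, fun Q hQw => ?_⟩
  -- `ℓ_{(C Q)}(X) = 0`
  have hℓ : Module.lengthAt (IwasawaAlgebra₂ p) X Q.pt = 0 := by
    by_contra hne
    have htop : Module.lengthAt (IwasawaAlgebra₂ p) X Q.pt ≠ ⊤ :=
      Module.lengthAt_ne_top_of_isTorsionBy hc0 hcX Q.pt Q.height_pt.le
    have hmem : Q.pt ∈ hfin.toFinset := by
      rw [Set.Finite.mem_toFinset]
      refine ⟨Q.height_pt, ?_⟩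
      rw [Function.mem_mulSupport]
      have hn : (Module.lengthAt (IwasawaAlgebra₂ p) X Q.pt).toNat ≠ 0 := by
        rw [Ne, ENat.toNat_eq_zero, not_or]; exact ⟨hne, htop⟩
      intro h1
      rw [Ideal.one_eq_top] at h1
      exact Q.pt.isPrime.ne_top (top_le_iff.mp (h1 ▸ Ideal.pow_le_self hn))
    have hex : ∃ a : IwasawaAlgebra p, a ≠ 0 ∧ (PowerSeries.C a : IwasawaAlgebra₂ p) ∈ Q.pt.asIdeal :=
      ⟨Q.P, Q.prime.ne_zero, Ideal.mem_span_singleton_self _⟩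
    have heQ : (PowerSeries.C (e Q.pt) : IwasawaAlgebra₂ p) ∈ Q.pt.asIdeal := by
      simp only [e, dif_pos hex]; exact hex.choose_spec.2
    rw [GoodPrime.pt_asIdeal, Ideal.mem_span_singleton, C_dvd_C_iff] at heQ
    exact hQw (dvd_mul_of_dvd_right (heQ.trans (Finset.dvd_prod_of_mem e hmem)) _)
  obtain ⟨u, hu, huX⟩ := LocalLength.exists_notMem_forall_smul_eq_zero_of_lengthAt_eq_zero (N₁ := X) hℓ
  exact ⟨u, fun h => hu (by rw [GoodPrime.pt_asIdeal, Ideal.mem_span_singleton]; exact h), huX⟩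

/-- **The vertical theorem.** See the section docstring. -/
theorem vertical_dvd (hFT : FibreTransport p) (hLB : FibreLengthLowerBound p) (P : GoodPrime p)
    (X : Type) [AddCommGroup X] [Module (IwasawaAlgebra₂ p) X] [Module.Finite (IwasawaAlgebra₂ p) X]
    (G : IwasawaAlgebra₂ p) (hT : Module.IsTorsion (IwasawaAlgebra₂ p) X) (hfam : VFamily p P X G) :
    (PowerSeries.C P.P : IwasawaAlgebra₂ p) ^ (Module.lengthAt (IwasawaAlgebra₂ p) X P.pt).toNat ∣ G := by
  classical
  have hπ : Prime (PowerSeries.C P.P : IwasawaAlgebra₂ p) := P.prime_C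
  set k := (Module.lengthAt (IwasawaAlgebra₂ p) X P.pt).toNat with hk
  by_cases hG0 : G = 0
  · rw [hG0]; exact dvd_zero _
  obtain ⟨g, G₁, hG₁, rfl⟩ := WfDvdMonoid.max_power_factor hG0 hπ.irreducible
  by_cases hkg : k ≤ g
  · exact (pow_dvd_pow _ hkg).trans (dvd_mul_right _ _)
  exfalso
  have hgk : g < k := by omega
  -- `k = ℓ_{(π)}(X) < ∞`
  obtain ⟨c, hc, hc0⟩ := Submodule.exists_mem_ne_zero_of_ne_bot
    (Module.annihilator_ne_bot_of_isTorsion X hT)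
  have hcX : ∀ x : X, c • x = 0 := fun x => Module.mem_annihilator.mp hc x
  have hktop : Module.lengthAt (IwasawaAlgebra₂ p) X P.pt ≠ ⊤ :=
    Module.lengthAt_ne_top_of_isTorsionBy hc0 (fun x => hcX x) P.pt P.height_pt.le
  have hkeq : (k : ℕ∞) = Module.lengthAt (IwasawaAlgebra₂ p) X P.pt := by
    rw [hk]; exact ENat.coe_toNat hktop
  -- DEPTH of `G₁` at `P`, read at `𝔔̄_P`
  haveI : (Ideal.span {(PowerSeries.C P.P : IwasawaAlgebra₂ p)}).IsPrime :=
    (Ideal.span_singleton_prime hπ.ne_zero).mpr hπ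
  have hG₁bar : Ideal.Quotient.mk (Ideal.span {(PowerSeries.C P.P : IwasawaAlgebra₂ p)}) G₁ ≠ 0 := by
    rw [Ne, Ideal.Quotient.eq_zero_iff_mem, Ideal.mem_span_singleton]; exact hG₁
  obtain ⟨m, sbar, hbar, hs𝔔, hdepth⟩ :=
    exists_depth (qbar P) (height_qbar P) (natCast_mem_qbar P) hG₁bar
  obtain ⟨s₀, rfl⟩ := Ideal.Quotient.mk_surjective sbar
  obtain ⟨h₀, rfl⟩ := Ideal.Quotient.mk_surjective hbar
  have hs₀ : s₀ ∉ kerResidue p := fun h => hs𝔔 ((mk_mem_qbar_iff P).mpr h)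
  have hr₁ : ∃ r₁ : IwasawaAlgebra₂ p,
      s₀ * (p : IwasawaAlgebra₂ p) ^ m = G₁ * h₀ + PowerSeries.C P.P * r₁ := by
    have h1 : Ideal.Quotient.mk (Ideal.span {(PowerSeries.C P.P : IwasawaAlgebra₂ p)})
        (s₀ * (p : IwasawaAlgebra₂ p) ^ m) =
        Ideal.Quotient.mk (Ideal.span {(PowerSeries.C P.P : IwasawaAlgebra₂ p)}) (G₁ * h₀) := by
      rw [map_mul, map_mul, map_pow]; exact hdepth
    rw [Ideal.Quotient.eq, Ideal.mem_span_singleton] at h1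
    obtain ⟨r₁, hr₁⟩ := h1
    exact ⟨r₁, by rw [← hr₁]; ring⟩
  obtain ⟨r₁, hr₁⟩ := hr₁
  -- AVOIDANCE and the FAMILY member
  obtain ⟨w, hw0, hPw, havoid⟩ := exists_avoid X hT P
  obtain ⟨Q, N, t, hQw, hPQ, hBN, hFB⟩ := hfam (m + 1) w hw0
  obtain ⟨u, hQu, huX⟩ := havoid Q hQw
  have hQP : ¬ Q.P ∣ P.P := fun h => hQw (h.trans hPw)
  have hπs : ¬ (PowerSeries.C P.P : IwasawaAlgebra₂ p) ∣ PowerSeries.C Q.P := fun h =>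
    hQP (P.prime.irreducible.dvd_symm Q.prime.irreducible (C_dvd_C_iff.mp h))
  obtain ⟨r, hr⟩ := hPQ
  obtain ⟨e, hNe⟩ := Nat.exists_eq_add_of_le hBN
  -- currency `A = Λ₂/(C Q)`, `M = X / (C Q) X`
  have hs : Prime (PowerSeries.C Q.P : IwasawaAlgebra₂ p) := Q.prime_C
  haveI : (Ideal.span {(PowerSeries.C Q.P : IwasawaAlgebra₂ p)}).IsPrime :=
    (Ideal.span_singleton_prime hs.ne_zero).mpr hs
  haveI : IsScalarTower (IwasawaAlgebra₂ p)
      (IwasawaAlgebra₂ p ⧸ Ideal.span {(PowerSeries.C Q.P : IwasawaAlgebra₂ p)})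
      (QuotSMulTop (PowerSeries.C Q.P : IwasawaAlgebra₂ p) X) :=
    ⟨fun r' a x => by
      obtain ⟨a, rfl⟩ := Ideal.Quotient.mk_surjective a
      obtain ⟨x, rfl⟩ := Submodule.mkQ_surjective _ x
      show (r' * a) • (Submodule.Quotient.mk x : QuotSMulTop (PowerSeries.C Q.P : IwasawaAlgebra₂ p) X) =
        r' • a • (Submodule.Quotient.mk x : QuotSMulTop (PowerSeries.C Q.P : IwasawaAlgebra₂ p) X)
      rw [mul_smul]⟩
  haveI : Module.Finite (IwasawaAlgebra₂ p ⧸ Ideal.span {(PowerSeries.C Q.P : IwasawaAlgebra₂ p)})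
      (QuotSMulTop (PowerSeries.C Q.P : IwasawaAlgebra₂ p) X) :=
    Module.Finite.of_restrictScalars_finite (IwasawaAlgebra₂ p) _ _
  -- (FT) and (LB) at `Q`
  have hmem := hFT Q X ((PowerSeries.C P.P : IwasawaAlgebra₂ p) ^ g * G₁) t hFB
  have hlen := hLB X (PowerSeries.C Q.P) (PowerSeries.C P.P) u hπ (qbar Q) hs hπs hQu huX (height_qbar Q)
  have hpt : (⟨Ideal.span {(PowerSeries.C P.P : IwasawaAlgebra₂ p)},
      (Ideal.span_singleton_prime hπ.ne_zero).mpr hπ⟩ : PrimeSpectrum (IwasawaAlgebra₂ p)) = P.pt := rfl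
  rw [hpt, ← hkeq] at hlen
  -- the elements of `A`
  set mk := Ideal.Quotient.mk (Ideal.span {(PowerSeries.C Q.P : IwasawaAlgebra₂ p)}) with hmk
  have hcbar : mk u ≠ 0 := by
    rw [Ne, hmk, Ideal.Quotient.eq_zero_iff_mem, Ideal.mem_span_singleton]; exact hQu
  have hcM : ∀ x : QuotSMulTop (PowerSeries.C Q.P : IwasawaAlgebra₂ p) X, mk u • x = 0 := by
    intro x
    obtain ⟨x, rfl⟩ := Submodule.mkQ_surjective _ x
    show u • (Submodule.Quotient.mk x : QuotSMulTop (PowerSeries.C Q.P : IwasawaAlgebra₂ p) X) = 0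
    rw [← Submodule.Quotient.mk_smul, huX, Submodule.Quotient.mk_zero]
  have hq0 : mk (p : IwasawaAlgebra₂ p) ≠ 0 := mk_natCast_ne_zero Q
  have hπ0 : mk (PowerSeries.C P.P) ≠ 0 := by
    rw [Ne, hmk, Ideal.Quotient.eq_zero_iff_mem, Ideal.mem_span_singleton]
    exact fun h => hQP (C_dvd_C_iff.mp h)
  -- `C P = C Q + p^N · C r`, so `π̄ = q^N · C r̄`
  have hCP : (PowerSeries.C P.P : IwasawaAlgebra₂ p) =
      PowerSeries.C Q.P + (p : IwasawaAlgebra₂ p) ^ N * PowerSeries.C r := by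
    have : P.P = Q.P + (p : IwasawaAlgebra p) ^ N * r := by rw [← hr]; ring
    rw [this, map_add, map_mul, map_pow, natCast_p_eq_C]
  have hπr : mk (PowerSeries.C P.P) = mk (p : IwasawaAlgebra₂ p) ^ N * mk (PowerSeries.C r) := by
    rw [hCP, map_add, map_mul, map_pow, hmk, Ideal.Quotient.eq_zero_iff_mem.mpr
      (Ideal.mem_span_singleton_self _), zero_add]
  -- `v = s₀ - p^{N-m} (C r) r₁ ∉ 𝔔₀`, `Ḡ₁ h̄₀ = q^m v̄`
  set v : IwasawaAlgebra₂ p := s₀ - (p : IwasawaAlgebra₂ p) ^ (1 + t + e) * PowerSeries.C r * r₁ with hv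
  have hv𝔔 : mk v ∉ (qbar Q).asIdeal := by
    intro h
    rw [hmk, mk_mem_qbar_iff] at h
    apply hs₀
    have hmem' : (p : IwasawaAlgebra₂ p) ^ (1 + t + e) * PowerSeries.C r * r₁ ∈ kerResidue p := by
      rw [pow_add, pow_add, pow_one, mul_assoc, mul_assoc, mul_assoc]
      exact Ideal.mul_mem_right _ _ natCast_mem_kerResidue
    have := (kerResidue p).add_mem h hmem'
    rwa [hv, sub_add_cancel] at this
  have hGh : mk (G₁ * h₀) = mk (p : IwasawaAlgebra₂ p) ^ m * mk v := by
    have hid : G₁ * h₀ = (p : IwasawaAlgebra₂ p) ^ m * v - PowerSeries.C Q.P * r₁ := by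
      have hN' : (p : IwasawaAlgebra₂ p) ^ N = (p : IwasawaAlgebra₂ p) ^ m *
          (p : IwasawaAlgebra₂ p) ^ (1 + t + e) := by
        rw [← pow_add, hNe]; ring_nf
      have h1 : G₁ * h₀ = s₀ * (p : IwasawaAlgebra₂ p) ^ m - PowerSeries.C P.P * r₁ := by
        rw [hr₁]; ring
      rw [h1, hCP, hN', hv]; ring
    rw [hid, map_sub, map_mul, map_mul, map_pow, hmk,
      Ideal.Quotient.eq_zero_iff_mem.mpr (Ideal.mem_span_singleton_self _), zero_mul, sub_zero]
  -- H2: `q^t π̄^g (q^m v̄) ∈ ch_A(M)`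
  have H2 : mk (p : IwasawaAlgebra₂ p) ^ t * mk (PowerSeries.C P.P) ^ g *
      (mk (p : IwasawaAlgebra₂ p) ^ m * mk v) ∈
      Module.charIdeal (IwasawaAlgebra₂ p ⧸ Ideal.span {(PowerSeries.C Q.P : IwasawaAlgebra₂ p)})
        (QuotSMulTop (PowerSeries.C Q.P : IwasawaAlgebra₂ p) X) := by
    have h2 := Ideal.mul_mem_right (mk h₀) _ hmem
    have heq : mk ((p : IwasawaAlgebra₂ p) ^ t * ((PowerSeries.C P.P : IwasawaAlgebra₂ p) ^ g * G₁)) * mk h₀ =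
        mk (p : IwasawaAlgebra₂ p) ^ t * mk (PowerSeries.C P.P) ^ g * (mk (p : IwasawaAlgebra₂ p) ^ m * mk v) := by
      rw [← hGh]; simp only [map_mul, map_pow]; ring
    rw [hmk] at heq h2
    rw [hmk, ← heq]; exact h2
  have hN : t + m < N := by omega
  exact endgame_quant hcbar hcM (qbar Q) (height_qbar Q) (natCast_mem_qbar Q) hq0 hπ0 hπr hv𝔔 hgk hN
    hlen H2

end Vertical

/-! ## E6. Classification of the height-one primes `𝔓 ∌ p` and the END-TO-END engine (PROVED)

A height-one prime `𝔓` of `Λ₂` with `p ∉ 𝔓` is either NON-VERTICAL (`𝔓 ∩ Λ₁ = 0`, handled by `PatchingBeta`)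
or `𝔓 ∩ Λ₁ ∋` a prime element `P` of the UFD `Λ₁` with `P ∤ p`, and then `𝔓 = (C P)` (a height-one prime
containing a prime element is generated by it): `𝔓 = P.pt` for a GOOD prime `P`. At a good prime the exponent
bound comes from the First lemma (fibre torsion ⟹ exponent `0`) or from `vertical_dvd` (VFamily).
`PatchingTarget` then patches the exponents into `(p^a G) ⊆ ch_{Λ₂}(X)`. -/

section Engine

variable {p : ℕ} [Fact p.Prime]

/-- **Classification.** A height-one prime `𝔓 ∌ p` of `Λ₂` meeting `Λ₁ ∖ 0` is `(C P)` for a good prime `P`. -/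
theorem exists_goodPrime_of_comap_ne_bot (𝔓 : PrimeSpectrum (IwasawaAlgebra₂ p))
    (hht : 𝔓.asIdeal.height = 1) (hp : (p : IwasawaAlgebra₂ p) ∉ 𝔓.asIdeal)
    (hvert : Ideal.comap (PowerSeries.C (R := IwasawaAlgebra p)) 𝔓.asIdeal ≠ ⊥) :
    ∃ P : GoodPrime p, 𝔓 = P.pt := by
  obtain ⟨P₀, hmem, hprime⟩ := Ideal.IsPrime.exists_mem_prime_of_ne_bot
    (inferInstance : (Ideal.comap (PowerSeries.C (R := IwasawaAlgebra p)) 𝔓.asIdeal).IsPrime) hvert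
  rw [Ideal.mem_comap] at hmem
  have hP₀p : ¬ P₀ ∣ (p : IwasawaAlgebra p) := fun h =>
    hp (by rw [natCast_p_eq_C]; exact mem_of_dvd_of_mem (map_dvd PowerSeries.C h) hmem)
  refine ⟨⟨P₀, hprime, hP₀p⟩, PrimeSpectrum.ext ?_⟩
  exact Ideal.eq_span_singleton_of_height_eq_one hht hmem (GoodPrime.prime_C ⟨P₀, hprime, hP₀p⟩)
  where
  /-- `π ∣ z`, `π ∈ 𝔓` ⟹ `z ∈ 𝔓` -/
  mem_of_dvd_of_mem {π z : IwasawaAlgebra₂ p} {I : Ideal (IwasawaAlgebra₂ p)} (h : π ∣ z) (hπ : π ∈ I) :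
      z ∈ I := by obtain ⟨c, rfl⟩ := h; exact I.mul_mem_right c hπ

variable (p) in
/-- **(FT_P) Fibre torsion at the good prime `P`**: the fibre `X/(C P)X` is killed by some `s ∉ (C P)` — the
First lemma's hypothesis (at `P = T₂` this is the torsion of `X(K_Δ)`, supplied by Kato, sketch §G′/§H.2). -/
def FibreTorsionAt (P : GoodPrime p) (X : Type) [AddCommGroup X] [Module (IwasawaAlgebra₂ p) X] : Prop :=
  ∃ s : IwasawaAlgebra₂ p, s ∉ Ideal.span {(PowerSeries.C P.P : IwasawaAlgebra₂ p)} ∧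
    ∀ x : X, s • x ∈ (PowerSeries.C P.P : IwasawaAlgebra₂ p) • (⊤ : Submodule (IwasawaAlgebra₂ p) X)

/-- **THE ENGINE (end-to-end, PROVED).** For a finitely generated torsion `Λ₂`-module `X` and `G ∈ Λ₂`:
`PatchingTarget` + `PatchingBeta` + (FT) + (LB) (the four Props PROVED in `IdeaSketchQtame.lean` v4.7:
`patchingTarget_holds`, `PB.patchingBeta_holds`, `PB.fibreTransport_holds`, `PB.fibreLengthLowerBound_holds`),
the non-vertical fibre bounds (the hypothesis of `PatchingBeta`, verbatim), and at every good prime `P` of `Λ₁`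
either fibre torsion or a `VFamily` of fibre bounds ⟹ `(p^a · G) ⊆ ch_{Λ₂}(X)` for some `a`.
This is the algebra of the crux idea `qtame` in one statement; its remaining hypotheses are exactly the
ARITHMETIC inputs (Q1-β)/(VFamily)/(FT_P). -/
theorem engine (X : Type) [AddCommGroup X] [Module (IwasawaAlgebra₂ p) X]
    [Module.Finite (IwasawaAlgebra₂ p) X] (G : IwasawaAlgebra₂ p)
    (hPT : PatchingTarget p X G) (hPB : PatchingBeta p X G)
    (hFT : FibreTransport p) (hLB : FibreLengthLowerBound p)
    (hT : Module.IsTorsion (IwasawaAlgebra₂ p) X)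
    (hnv : ∃ z : Polynomial ℤ_[p], z ≠ 0 ∧
      ∀ (O : Type) [CommRing O] [IsDomain O] [CharZero O] [Algebra ℤ_[p] O] [Module.Finite ℤ_[p] O]
        (u : O), u ∈ nonunits O → Polynomial.aeval u z ≠ 0 →
        letI : Algebra (IwasawaAlgebra₂ p) (PowerSeries (PowerSeries O)) :=
          (PowerSeries.map (PowerSeries.map (algebraMap ℤ_[p] O))).toAlgebra
        ∃ t : ℕ, FibreBoundAt O p ((PowerSeries (PowerSeries O)) ⊗[IwasawaAlgebra₂ p] X)
          (PowerSeries.map (PowerSeries.map (algebraMap ℤ_[p] O)) G) u t)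
    (hv : ∀ P : GoodPrime p, FibreTorsionAt p P X ∨ VFamily p P X G) :
    ∃ a : ℕ, Ideal.span {(p : IwasawaAlgebra₂ p) ^ a * G} ≤
      Literature.NumberTheory.EllipticCurves.Module.charIdeal (IwasawaAlgebra₂ p) X := by
  classical
  refine hPT hT fun 𝔓 hht hp𝔓 => ?_
  by_cases hvert : Ideal.comap (PowerSeries.C (R := IwasawaAlgebra p)) 𝔓.asIdeal = ⊥
  · exact hPB hT hnv 𝔓 hht hvert
  obtain ⟨P, rfl⟩ := exists_goodPrime_of_comap_ne_bot 𝔓 hht hp𝔓 hvert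
  have goal_of : ∀ {k : ℕ} {H : IwasawaAlgebra₂ p}, (PowerSeries.C P.P : IwasawaAlgebra₂ p) ^ k ∣ H →
      P.pt.asIdeal ^ k ∣ Ideal.span {H} := fun {k H} ⟨K, hK⟩ =>
    ⟨Ideal.span {K}, by
      rw [hK, GoodPrime.pt_asIdeal, Ideal.span_singleton_pow, Ideal.span_singleton_mul_span_singleton]⟩
  rcases hv P with ⟨s, hs, hsX⟩ | hfam
  · -- First lemma: exponent `0`
    have h0 : Module.lengthAt (IwasawaAlgebra₂ p) X P.pt = 0 :=
      lengthAt_eq_zero_of_fibre_torsion (M := X) P.prime_C hs hsX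
    rw [h0]
    simp
  · exact goal_of (vertical_dvd hFT hLB P X G hT hfam)

end Engine

/-! ## E5. The canonical approximants: twisted translates `ι_v(P)` (PROVED)

`ι_v : T ↦ v(1 + T) - 1` (`v ∈ 1 + pℤ_p`, tree `PadicIntSeries.unitTwistEquiv`, Li–Tian–Yan–Zhu's `ι_c` in one
variable) is a `ℤ_p`-algebra automorphism of `Λ₁`, so `Q_v := ι_v(P)` is again a good prime; `ι_v(f) ≡ f
(mod (v - 1))` for EVERY `f ∈ Λ₁` (polynomials by `a - b ∣ q(a) - q(b)`, then coefficientwise by truncation), so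
`p^N ∣ v - 1 ⟹ p^N ∣ P - Q_v`; and for `w ≠ 0` only FINITELY many `v` have `Q_v ∣ w` (Weierstrass-prepare the
`p`-free part of `w`; `Q_v ∣ w` makes `v⁻¹(1 + u_P) - 1 ∈ O_P` a root of the distinguished factor, and
`v ↦ v⁻¹(1 + u_P) - 1` is injective since `1 + u_P ≠ 0` in the domain `O_P`). Hence fibre bounds with
sublinear slack along the twisted translates of `P` (`TwistBounds`) supply `VFamily P`. -/

section Twist

variable {p : ℕ} [Fact p.Prime]

/-- The unit twist as a `ℤ_p`-algebra endomorphism of `Λ₁`. -/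
noncomputable def twistAlgHom (v : ℤ_[p]) (hv : ‖v - 1‖ < 1) :
    PowerSeries ℤ_[p] →ₐ[ℤ_[p]] PowerSeries ℤ_[p] :=
  { PadicIntSeries.unitTwistRingHom v hv with
    commutes' := fun a => by
      show PadicIntSeries.unitTwist (algebraMap ℤ_[p] (PowerSeries ℤ_[p]) a) v =
        algebraMap ℤ_[p] (PowerSeries ℤ_[p]) a
      rw [← PowerSeries.C_eq_algebraMap]
      exact PadicIntSeries.unitTwist_C a hv }

theorem twistAlgHom_apply (v : ℤ_[p]) (hv : ‖v - 1‖ < 1) (f : PowerSeries ℤ_[p]) :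
    twistAlgHom v hv f = PadicIntSeries.unitTwist f v := rfl

/-- **`ι_v(f) ≡ f (mod (v - 1))` for every `f ∈ Λ₁`.** -/
theorem C_dvd_unitTwist_sub (f : PowerSeries ℤ_[p]) {v : ℤ_[p]} (hv : ‖v - 1‖ < 1) :
    PowerSeries.C (v - 1) ∣ PadicIntSeries.unitTwist f v - f := by
  classical
  have hX : PowerSeries.C (v - 1) ∣
      PadicIntSeries.unitTwist (PowerSeries.X : PowerSeries ℤ_[p]) v - PowerSeries.X :=
    ⟨1 + PowerSeries.X, by rw [PadicIntSeries.unitTwist_X hv, map_sub, map_one]; ring⟩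
  -- polynomials: `a - b ∣ q(a) - q(b)`
  have hpoly : ∀ q : Polynomial ℤ_[p],
      PowerSeries.C (v - 1) ∣ PadicIntSeries.unitTwist (q : PowerSeries ℤ_[p]) v - q := by
    intro q
    have h1 : PadicIntSeries.unitTwist (q : PowerSeries ℤ_[p]) v =
        Polynomial.aeval (PadicIntSeries.unitTwist (PowerSeries.X : PowerSeries ℤ_[p]) v) q := by
      rw [← GoodPrime.aeval_X_eq_coe q, ← twistAlgHom_apply v hv, ← twistAlgHom_apply v hv,
        Polynomial.aeval_algHom_apply]
    rw [h1, ← GoodPrime.aeval_X_eq_coe q, ← Polynomial.eval_map_algebraMap, ← Polynomial.eval_map_algebraMap]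
    exact hX.trans (Polynomial.sub_dvd_eval_sub _ _ _)
  -- coefficientwise, by truncation at order `k + 1`
  apply C_dvd_of_forall_dvd_coeff
  intro k
  have hsplit := PowerSeries.eq_X_pow_mul_shift_add_trunc (k + 1) f
  set g : PowerSeries ℤ_[p] := PowerSeries.mk fun i => PowerSeries.coeff (i + (k + 1)) f with hg
  set t : PowerSeries ℤ_[p] := ((PowerSeries.trunc (k + 1) f : Polynomial ℤ_[p]) : PowerSeries ℤ_[p])
    with ht
  obtain ⟨A, hA⟩ := hpoly (PowerSeries.trunc (k + 1) f)
  obtain ⟨Bq, hB⟩ := hX.trans (sub_dvd_pow_sub_pow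
    (PadicIntSeries.unitTwist (PowerSeries.X : PowerSeries ℤ_[p]) v) PowerSeries.X (k + 1))
  have hf : PadicIntSeries.unitTwist f v =
      PadicIntSeries.unitTwist (PowerSeries.X : PowerSeries ℤ_[p]) v ^ (k + 1) *
        PadicIntSeries.unitTwist g v + PadicIntSeries.unitTwist t v := by
    conv_lhs => rw [hsplit]
    rw [PadicIntSeries.unitTwist_add _ _ hv, PadicIntSeries.unitTwist_mul _ _ hv,
      ← twistAlgHom_apply v hv (PowerSeries.X ^ (k + 1)), map_pow, twistAlgHom_apply]
  have hdecomp : PadicIntSeries.unitTwist f v - f =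
      PowerSeries.C (v - 1) * (Bq * PadicIntSeries.unitTwist g v + A) +
        PowerSeries.X ^ (k + 1) * (PadicIntSeries.unitTwist g v - g) := by
    rw [hf]
    conv_lhs => rw [hsplit]
    linear_combination (PadicIntSeries.unitTwist g v) * hB + hA
  rw [hdecomp, map_add, PowerSeries.coeff_C_mul, PowerSeries.coeff_X_pow_mul', if_neg (by omega), add_zero]
  exact dvd_mul_right _ _

namespace GoodPrime

/-- **The twisted translate `ι_v(P)`** of a good prime: a good prime. -/
noncomputable def twist (P : GoodPrime p) (v : ℤ_[p]ˣ) (hv : ‖(v : ℤ_[p]) - 1‖ < 1) : GoodPrime p where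
  P := PadicIntSeries.unitTwist P.P (v : ℤ_[p])
  prime := by
    have h := (MulEquiv.prime_iff (PadicIntSeries.unitTwistEquiv v hv)).mpr P.prime
    rwa [PadicIntSeries.unitTwistEquiv_apply] at h
  not_dvd := by
    intro h
    apply P.not_dvd
    have h2 := map_dvd (PadicIntSeries.unitTwistEquiv v hv).symm h
    have h3 : (PadicIntSeries.unitTwistEquiv v hv).symm (PadicIntSeries.unitTwist P.P (v : ℤ_[p])) = P.P :=
      (PadicIntSeries.unitTwistEquiv v hv).symm_apply_apply P.P
    rw [h3, PadicIntSeries.unitTwistEquiv_symm_apply, ← map_natCast (PowerSeries.C (R := ℤ_[p])) p,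
      PadicIntSeries.unitTwist_C _ (PadicIntSeries.norm_inv_sub_one_lt hv)] at h2
    rwa [← map_natCast (PowerSeries.C (R := ℤ_[p])) p]

theorem twist_P (P : GoodPrime p) (v : ℤ_[p]ˣ) (hv : ‖(v : ℤ_[p]) - 1‖ < 1) :
    (P.twist v hv).P = PadicIntSeries.unitTwist P.P (v : ℤ_[p]) := rfl

/-- `p^N ∣ v - 1 ⟹ p^N ∣ P - ι_v(P)`. -/
theorem pow_dvd_sub_twist (P : GoodPrime p) (v : ℤ_[p]ˣ) (hv : ‖(v : ℤ_[p]) - 1‖ < 1) {N : ℕ}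
    (hN : (p : ℤ_[p]) ^ N ∣ (v : ℤ_[p]) - 1) :
    (p : IwasawaAlgebra p) ^ N ∣ P.P - (P.twist v hv).P := by
  have h1 := C_dvd_unitTwist_sub P.P hv
  have h2 : (p : IwasawaAlgebra p) ^ N ∣ PowerSeries.C ((v : ℤ_[p]) - 1) := by
    have : (p : IwasawaAlgebra p) ^ N = PowerSeries.C ((p : ℤ_[p]) ^ N) := by
      rw [map_pow, map_natCast]
    rw [this]
    exact map_dvd _ hN
  rw [← dvd_neg, neg_sub, twist_P]
  exact h2.trans h1

theorem one_add_u_ne_zero (P : GoodPrime p) : (1 : P.O) + P.u ≠ 0 := by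
  intro h
  have hu : P.u = -1 := by linear_combination h
  apply P.u_mem_nonunits
  rw [hu]
  exact ⟨⟨-1, -1, by ring, by ring⟩, rfl⟩

/-- **Finiteness of the bad twists**: for `w ≠ 0` only finitely many `v` have `ι_v(P) ∣ w`. -/
theorem finite_twist_dvd (P : GoodPrime p) {w : IwasawaAlgebra p} (hw : w ≠ 0) :
    {v : ℤ_[p]ˣ | ∃ hv : ‖(v : ℤ_[p]) - 1‖ < 1, (P.twist v hv).P ∣ w}.Finite := by
  classical
  -- strip the power of `p`: `w = (C p)^μ · w'`, `C p ∤ w'`, so `w'` has non-zero reduction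
  have hpC : Prime (PowerSeries.C (p : ℤ_[p]) : IwasawaAlgebra p) := IwasawaAlgebra.prime_C p
  obtain ⟨μ, w', hw', rfl⟩ := WfDvdMonoid.max_power_factor hw hpC.irreducible
  have hres : w'.map (IsLocalRing.residue ℤ_[p]) ≠ 0 := by
    intro h
    apply hw'
    apply C_dvd_of_forall_dvd_coeff
    intro n
    have := congrArg (PowerSeries.coeff n) h
    rw [PowerSeries.coeff_map, map_zero, IsLocalRing.residue_eq_zero_iff,
      PadicInt.maximalIdeal_eq_span_p, Ideal.mem_span_singleton] at this
    exact this
  -- Weierstrass: `w' = D · U`, `D` distinguished (monic), `U` a unit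
  have HW := PowerSeries.isWeierstrassFactorization_weierstrassDistinguished_weierstrassUnit hres
  set D := w'.weierstrassDistinguished hres with hD
  set U := w'.weierstrassUnit hres with hU
  have hDmonic : D.Monic := HW.isDistinguishedAt.monic
  -- the root map `v ↦ v⁻¹ (1 + u_P) - 1 ∈ O_P`
  let θ : ℤ_[p]ˣ → P.O := fun v => algebraMap ℤ_[p] P.O ((v⁻¹ : ℤ_[p]ˣ) : ℤ_[p]) * (1 + P.u) - 1
  let T : Finset P.O := (D.map (algebraMap ℤ_[p] P.O)).roots.toFinset
  refine Set.Finite.of_injOn (f := θ) (t := (T : Set P.O)) ?_ ?_ T.finite_toSet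
  · -- bad `v` ↦ a root of `D`
    rintro v ⟨hv, hdvd⟩
    set Q := P.twist v hv with hQ
    have hQp : ¬ Q.P ∣ PowerSeries.C (p : ℤ_[p]) := by rw [map_natCast]; exact Q.not_dvd
    have hQw' : Q.P ∣ w' :=
      (Q.prime.dvd_or_dvd hdvd).resolve_left (fun h => hQp (Q.prime.dvd_of_dvd_pow h))
    have hQD : Q.P ∣ (D : PowerSeries ℤ_[p]) := by
      rw [HW.eq_mul] at hQw'
      exact (Q.prime.dvd_or_dvd hQw').resolve_right
        (fun h => Q.prime.not_unit (isUnit_of_dvd_unit h HW.isUnit))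
    -- pull back by `ι_v⁻¹`: `P ∣ ι_{v⁻¹}(D)`
    have hPD : P.P ∣ PadicIntSeries.unitTwist (D : PowerSeries ℤ_[p]) ((v⁻¹ : ℤ_[p]ˣ) : ℤ_[p]) := by
      have h2 := map_dvd (PadicIntSeries.unitTwistEquiv v hv).symm hQD
      have h3 : (PadicIntSeries.unitTwistEquiv v hv).symm Q.P = P.P :=
        (PadicIntSeries.unitTwistEquiv v hv).symm_apply_apply P.P
      rwa [h3, PadicIntSeries.unitTwistEquiv_symm_apply] at h2
    have hv' : ‖((v⁻¹ : ℤ_[p]ˣ) : ℤ_[p]) - 1‖ < 1 := PadicIntSeries.norm_inv_sub_one_lt hv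
    -- evaluate in `O_P`
    have hroot : Polynomial.aeval (θ v) D = 0 := by
      have h1 : PadicIntSeries.unitTwist (D : PowerSeries ℤ_[p]) ((v⁻¹ : ℤ_[p]ˣ) : ℤ_[p]) =
          Polynomial.aeval (PadicIntSeries.unitTwist (PowerSeries.X : PowerSeries ℤ_[p])
            ((v⁻¹ : ℤ_[p]ˣ) : ℤ_[p])) D := by
        rw [← GoodPrime.aeval_X_eq_coe D, ← twistAlgHom_apply _ hv', ← twistAlgHom_apply _ hv',
          Polynomial.aeval_algHom_apply]
      have h2 : Ideal.Quotient.mkₐ ℤ_[p] (Ideal.span {P.P})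
          (PadicIntSeries.unitTwist (D : PowerSeries ℤ_[p]) ((v⁻¹ : ℤ_[p]ˣ) : ℤ_[p])) = 0 := by
        rw [Ideal.Quotient.mkₐ_eq_mk, Ideal.Quotient.eq_zero_iff_mem, Ideal.mem_span_singleton]
        exact hPD
      rw [h1, ← Polynomial.aeval_algHom_apply, Ideal.Quotient.mkₐ_eq_mk,
        PadicIntSeries.unitTwist_X hv', map_add, map_mul, PowerSeries.C_eq_algebraMap,
        PowerSeries.C_eq_algebraMap, Ideal.Quotient.mk_algebraMap, Ideal.Quotient.mk_algebraMap, ← u_def,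
        map_sub, map_one] at h2
      have hθ : θ v = algebraMap ℤ_[p] P.O ((v⁻¹ : ℤ_[p]ˣ) : ℤ_[p]) - 1 +
          algebraMap ℤ_[p] P.O ((v⁻¹ : ℤ_[p]ˣ) : ℤ_[p]) * P.u := by
        simp only [θ]; ring
      rw [hθ]; exact h2
    show θ v ∈ (T : Set P.O)
    rw [Finset.mem_coe, Multiset.mem_toFinset, Polynomial.mem_roots (Polynomial.map_monic_ne_zero hDmonic),
      Polynomial.IsRoot.def, Polynomial.eval_map_algebraMap]
    exact hroot
  · -- injectivity of the root map
    rintro v₁ - v₂ - h12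
    have h1 : algebraMap ℤ_[p] P.O ((v₁⁻¹ : ℤ_[p]ˣ) : ℤ_[p]) * (1 + P.u) =
        algebraMap ℤ_[p] P.O ((v₂⁻¹ : ℤ_[p]ˣ) : ℤ_[p]) * (1 + P.u) := by
      have := h12
      simp only [θ] at this
      exact sub_left_injective this
    have h2 := P.algebraMap_injective (mul_right_cancel₀ P.one_add_u_ne_zero h1)
    exact inv_injective (Units.ext h2)

end GoodPrime

variable (p) in
/-- **(TwistBounds P X G)** — the arithmetic input in its canonical form: for every `B` and every finite
exceptional set `S` of parameters there is a principal unit `v ∉ S` with `p^N ∣ v - 1`, `N ≥ B + t`, and the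
fibre bound with slack `p^t` at the twisted translate `ι_v(P)` (a rank-one ES bound at the algebraic point
`(O_{ι_v P}, u_{ι_v P})` with SUBLINEAR slack in the `p`-adic distance `N`). -/
def TwistBounds (P : GoodPrime p) (X : Type) [AddCommGroup X] [Module (IwasawaAlgebra₂ p) X]
    (G : IwasawaAlgebra₂ p) : Prop :=
  ∀ (B : ℕ) (S : Finset ℤ_[p]ˣ), ∃ (v : ℤ_[p]ˣ) (hv : ‖(v : ℤ_[p]) - 1‖ < 1) (N t : ℕ),
    v ∉ S ∧ (p : ℤ_[p]) ^ N ∣ (v : ℤ_[p]) - 1 ∧ B + t ≤ N ∧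
      FibreBoundOver p (P.twist v hv).O X G (P.twist v hv).u t

/-- **Twisted translates supply `VFamily`.** -/
theorem vFamily_of_twistBounds (P : GoodPrime p) (X : Type) [AddCommGroup X]
    [Module (IwasawaAlgebra₂ p) X] (G : IwasawaAlgebra₂ p) (h : TwistBounds p P X G) :
    VFamily p P X G := by
  classical
  intro B w hw
  obtain ⟨v, hv, N, t, hvS, hpN, hBt, hFB⟩ := h B (P.finite_twist_dvd hw).toFinset
  refine ⟨P.twist v hv, N, t, fun hdvd => hvS ?_, P.pow_dvd_sub_twist v hv hpN, hBt, hFB⟩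
  rw [Set.Finite.mem_toFinset]
  exact ⟨hv, hdvd⟩

/-- **The engine with twisted translates**: as `engine`, the vertical input at each good prime being fibre
torsion or `TwistBounds`. -/
theorem engine_twist (X : Type) [AddCommGroup X] [Module (IwasawaAlgebra₂ p) X]
    [Module.Finite (IwasawaAlgebra₂ p) X] (G : IwasawaAlgebra₂ p)
    (hPT : PatchingTarget p X G) (hPB : PatchingBeta p X G)
    (hFT : FibreTransport p) (hLB : FibreLengthLowerBound p)
    (hT : Module.IsTorsion (IwasawaAlgebra₂ p) X)
    (hnv : ∃ z : Polynomial ℤ_[p], z ≠ 0 ∧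
      ∀ (O : Type) [CommRing O] [IsDomain O] [CharZero O] [Algebra ℤ_[p] O] [Module.Finite ℤ_[p] O]
        (u : O), u ∈ nonunits O → Polynomial.aeval u z ≠ 0 →
        letI : Algebra (IwasawaAlgebra₂ p) (PowerSeries (PowerSeries O)) :=
          (PowerSeries.map (PowerSeries.map (algebraMap ℤ_[p] O))).toAlgebra
        ∃ t : ℕ, FibreBoundAt O p ((PowerSeries (PowerSeries O)) ⊗[IwasawaAlgebra₂ p] X)
          (PowerSeries.map (PowerSeries.map (algebraMap ℤ_[p] O)) G) u t)
    (hv : ∀ P : GoodPrime p, FibreTorsionAt p P X ∨ TwistBounds p P X G) :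
    ∃ a : ℕ, Ideal.span {(p : IwasawaAlgebra₂ p) ^ a * G} ≤
      Literature.NumberTheory.EllipticCurves.Module.charIdeal (IwasawaAlgebra₂ p) X :=
  engine X G hPT hPB hFT hLB hT hnv fun P => (hv P).imp_right (vFamily_of_twistBounds P X G)

end Twist

/-! ## E7. Currencies of the two vertical inputs (PROVED)

(a) `FibreTorsionAt P X` ⟺ the fibre `X/(C P)X` is a torsion module over the domain `Λ₂/(C P)` — the standard
currency; on the KATO LINE `P = T₂` (`katoLine`, the good prime `X ∈ Λ₁ = ℤ_p⟦T₂⟧`) this is «`X/T₂X` is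
`Λ₂/(T₂) = ℤ_p⟦T₁⟧`-torsion», the output of the sketch's §H.2 rank bookkeeping (`D ≢ 0`).
(b) (UNIF) in the twisted-translate language — slack bounded by `t₀` on a punctured `p`-adic neighbourhood of
`P`, off finitely many exceptional twists (the (Q1-β) exceptions) — implies `TwistBounds` (sublinear slack):
the principal units `1 + p^N·n`, `n ∈ ℕ`, are infinitely many. -/

section Currencies

variable {p : ℕ} [Fact p.Prime]

/-- `FibreTorsionAt` from torsion of the fibre over the quotient domain. -/
theorem fibreTorsionAt_of_isTorsion (P : GoodPrime p) (X : Type) [AddCommGroup X]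
    [Module (IwasawaAlgebra₂ p) X] [Module.Finite (IwasawaAlgebra₂ p) X]
    (hT : Module.IsTorsion (IwasawaAlgebra₂ p ⧸ Ideal.span {(PowerSeries.C P.P : IwasawaAlgebra₂ p)})
      (QuotSMulTop (PowerSeries.C P.P : IwasawaAlgebra₂ p) X)) :
    FibreTorsionAt p P X := by
  classical
  set π : IwasawaAlgebra₂ p := PowerSeries.C P.P with hπdef
  haveI : (Ideal.span {π}).IsPrime := (Ideal.span_singleton_prime P.prime_C.ne_zero).mpr P.prime_C
  haveI : IsScalarTower (IwasawaAlgebra₂ p) (IwasawaAlgebra₂ p ⧸ Ideal.span {π}) (QuotSMulTop π X) :=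
    ⟨fun r' a x => by
      obtain ⟨a, rfl⟩ := Ideal.Quotient.mk_surjective a
      obtain ⟨x, rfl⟩ := Submodule.mkQ_surjective _ x
      show (r' * a) • (Submodule.Quotient.mk x : QuotSMulTop π X) =
        r' • a • (Submodule.Quotient.mk x : QuotSMulTop π X)
      rw [mul_smul]⟩
  haveI : Module.Finite (IwasawaAlgebra₂ p ⧸ Ideal.span {π}) (QuotSMulTop π X) :=
    Module.Finite.of_restrictScalars_finite (IwasawaAlgebra₂ p) _ _
  obtain ⟨cbar, hc, hc0⟩ := Submodule.exists_mem_ne_zero_of_ne_bot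
    (Module.annihilator_ne_bot_of_isTorsion (QuotSMulTop π X) hT)
  obtain ⟨s, rfl⟩ := Ideal.Quotient.mk_surjective cbar
  refine ⟨s, fun h => hc0 (Ideal.Quotient.eq_zero_iff_mem.mpr h), fun x => ?_⟩
  have h1 : (Ideal.Quotient.mk (Ideal.span {π}) s) • (Submodule.Quotient.mk x : QuotSMulTop π X) = 0 :=
    Module.mem_annihilator.mp hc _
  have h2 : (Submodule.Quotient.mk (s • x) : QuotSMulTop π X) = 0 := by
    rw [Submodule.Quotient.mk_smul]; exact h1
  exact (Submodule.Quotient.mk_eq_zero _).mp h2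

/-- Conversely `FibreTorsionAt` gives torsion of the fibre over the quotient domain. -/
theorem isTorsion_of_fibreTorsionAt (P : GoodPrime p) (X : Type) [AddCommGroup X]
    [Module (IwasawaAlgebra₂ p) X] (h : FibreTorsionAt p P X) :
    Module.IsTorsion (IwasawaAlgebra₂ p ⧸ Ideal.span {(PowerSeries.C P.P : IwasawaAlgebra₂ p)})
      (QuotSMulTop (PowerSeries.C P.P : IwasawaAlgebra₂ p) X) := by
  classical
  set π : IwasawaAlgebra₂ p := PowerSeries.C P.P with hπdef
  haveI : (Ideal.span {π}).IsPrime := (Ideal.span_singleton_prime P.prime_C.ne_zero).mpr P.prime_C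
  obtain ⟨s, hs, hsX⟩ := h
  have hs0 : Ideal.Quotient.mk (Ideal.span {π}) s ≠ 0 := fun h0 => hs (Ideal.Quotient.eq_zero_iff_mem.mp h0)
  intro y
  obtain ⟨x, rfl⟩ := Submodule.mkQ_surjective _ y
  refine ⟨⟨Ideal.Quotient.mk (Ideal.span {π}) s, mem_nonZeroDivisors_of_ne_zero hs0⟩, ?_⟩
  show (Ideal.Quotient.mk (Ideal.span {π}) s) • (Submodule.Quotient.mk x : QuotSMulTop π X) = 0
  have : (Submodule.Quotient.mk (s • x) : QuotSMulTop π X) = 0 :=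
    (Submodule.Quotient.mk_eq_zero _).mpr (hsX x)
  rwa [Submodule.Quotient.mk_smul] at this

/-- **The Kato line** `T₂ = 0`: the good prime `X ∈ Λ₁ = ℤ_p⟦T₂⟧` (so `C X = T₂ ∈ Λ₂`). -/
noncomputable def katoLine (p : ℕ) [Fact p.Prime] : GoodPrime p where
  P := PowerSeries.X
  prime := PowerSeries.X_prime
  not_dvd := by
    intro h
    rw [PowerSeries.X_dvd_iff, map_natCast] at h
    exact (NeZero.ne p) (by exact_mod_cast h)

theorem katoLine_P : (katoLine p).P = PowerSeries.X := rfl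

/-- **(UNIF) in the twisted-translate language**: on a punctured `p`-adic neighbourhood (`p^{N₀} ∣ v - 1`) of
`P`, off a finite exceptional set `S₀` of twists, fibre bounds with slack `≤ t₀`. -/
def UnifTwistBounds (p : ℕ) [Fact p.Prime] (P : GoodPrime p) (X : Type) [AddCommGroup X]
    [Module (IwasawaAlgebra₂ p) X] (G : IwasawaAlgebra₂ p) : Prop :=
  ∃ (t₀ N₀ : ℕ) (S₀ : Finset ℤ_[p]ˣ), ∀ (v : ℤ_[p]ˣ) (hv : ‖(v : ℤ_[p]) - 1‖ < 1), v ∉ S₀ →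
    (p : ℤ_[p]) ^ N₀ ∣ (v : ℤ_[p]) - 1 →
      ∃ t, t ≤ t₀ ∧ FibreBoundOver p (P.twist v hv).O X G (P.twist v hv).u t

/-- The principal unit `1 + p^(N+1)·n`. -/
theorem isUnit_one_add_pow_mul (N n : ℕ) : IsUnit (1 + (p : ℤ_[p]) ^ (N + 1) * n : ℤ_[p]) := by
  have hmem : -((p : ℤ_[p]) ^ (N + 1) * n) ∈ nonunits ℤ_[p] := by
    rw [← IsLocalRing.mem_maximalIdeal, PadicInt.maximalIdeal_eq_span_p, Ideal.mem_span_singleton]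
    exact (Dvd.intro _ rfl : (p : ℤ_[p]) ∣ (p : ℤ_[p]) * ((p : ℤ_[p]) ^ N * n)).trans
      ⟨-1, by ring⟩
  have := IsLocalRing.isUnit_one_sub_self_of_mem_nonunits _ hmem
  rwa [sub_neg_eq_add] at this

/-- **(UNIF) ⟹ TwistBounds.** -/
theorem twistBounds_of_unif (P : GoodPrime p) (X : Type) [AddCommGroup X]
    [Module (IwasawaAlgebra₂ p) X] (G : IwasawaAlgebra₂ p) (h : UnifTwistBounds p P X G) :
    TwistBounds p P X G := by
  classical
  obtain ⟨t₀, N₀, S₀, hU⟩ := h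
  intro B S
  -- the level `N + 1` with `N + 1 ≥ N₀` and `N + 1 ≥ B + t₀`
  set N : ℕ := N₀ + B + t₀ with hN
  let v : ℕ → ℤ_[p]ˣ := fun n => (isUnit_one_add_pow_mul (p := p) N n).unit
  have hv_val : ∀ n, ((v n : ℤ_[p]ˣ) : ℤ_[p]) = 1 + (p : ℤ_[p]) ^ (N + 1) * n := fun n =>
    IsUnit.unit_spec _
  have hinj : Function.Injective v := by
    intro a b hab
    have h1 := congrArg (fun w : ℤ_[p]ˣ => (w : ℤ_[p])) hab
    simp only [hv_val, add_right_inj] at h1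
    have hp0 : (p : ℤ_[p]) ^ (N + 1) ≠ 0 := pow_ne_zero _ (NeZero.ne _)
    exact_mod_cast mul_left_cancel₀ hp0 h1
  obtain ⟨w, ⟨n, rfl⟩, hnS⟩ := (Set.infinite_range_of_injective hinj).exists_notMem_finset (S ∪ S₀)
  rw [Finset.mem_union, not_or] at hnS
  have hsub : ((v n : ℤ_[p]ˣ) : ℤ_[p]) - 1 = (p : ℤ_[p]) ^ (N + 1) * n := by rw [hv_val]; ring
  have hvn : ‖((v n : ℤ_[p]ˣ) : ℤ_[p]) - 1‖ < 1 := by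
    rw [hsub, PadicInt.norm_lt_one_iff_dvd]
    exact Dvd.intro ((p : ℤ_[p]) ^ N * n) (by ring)
  have hdvd : (p : ℤ_[p]) ^ (N + 1) ∣ ((v n : ℤ_[p]ˣ) : ℤ_[p]) - 1 := by rw [hsub]; exact dvd_mul_right _ _
  obtain ⟨t, ht, hFB⟩ := hU (v n) hvn hnS.2 ((pow_dvd_pow _ (by omega)).trans hdvd)
  exact ⟨v n, hvn, N + 1, t, hnS.1, hdvd, by omega, hFB⟩

/-- `FibreTorsionAt` depends only on the prime IDEAL `(C P)`. -/
theorem fibreTorsionAt_of_associated (P Q : GoodPrime p) (hPQ : Associated P.P Q.P) (X : Type)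
    [AddCommGroup X] [Module (IwasawaAlgebra₂ p) X] (h : FibreTorsionAt p P X) :
    FibreTorsionAt p Q X := by
  have hC : Associated (PowerSeries.C P.P : IwasawaAlgebra₂ p) (PowerSeries.C Q.P) :=
    associated_of_dvd_dvd (map_dvd _ hPQ.dvd) (map_dvd _ hPQ.symm.dvd)
  have hspan : Ideal.span {(PowerSeries.C P.P : IwasawaAlgebra₂ p)} = Ideal.span {PowerSeries.C Q.P} :=
    Ideal.span_singleton_eq_span_singleton.mpr hC
  have htop : (PowerSeries.C P.P : IwasawaAlgebra₂ p) • (⊤ : Submodule (IwasawaAlgebra₂ p) X) =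
      (PowerSeries.C Q.P : IwasawaAlgebra₂ p) • (⊤ : Submodule (IwasawaAlgebra₂ p) X) := by
    rw [← Submodule.ideal_span_singleton_smul, ← Submodule.ideal_span_singleton_smul, hspan]
  obtain ⟨s, hs, hsX⟩ := h
  exact ⟨s, hspan ▸ hs, fun x => htop ▸ hsX x⟩

/-- **The engine in standard currencies**: non-vertical fibre bounds (hypothesis of `PatchingBeta`) +
«`X/T₂X` is `ℤ_p⟦T₁⟧`-torsion» on the Kato line + (UNIF) along the twisted translates of every other good prime
⟹ `(p^a · G) ⊆ ch_{Λ₂}(X)`. -/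
theorem engine_std (X : Type) [AddCommGroup X] [Module (IwasawaAlgebra₂ p) X]
    [Module.Finite (IwasawaAlgebra₂ p) X] (G : IwasawaAlgebra₂ p)
    (hPT : PatchingTarget p X G) (hPB : PatchingBeta p X G)
    (hFT : FibreTransport p) (hLB : FibreLengthLowerBound p)
    (hT : Module.IsTorsion (IwasawaAlgebra₂ p) X)
    (hnv : ∃ z : Polynomial ℤ_[p], z ≠ 0 ∧
      ∀ (O : Type) [CommRing O] [IsDomain O] [CharZero O] [Algebra ℤ_[p] O] [Module.Finite ℤ_[p] O]
        (u : O), u ∈ nonunits O → Polynomial.aeval u z ≠ 0 →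
        letI : Algebra (IwasawaAlgebra₂ p) (PowerSeries (PowerSeries O)) :=
          (PowerSeries.map (PowerSeries.map (algebraMap ℤ_[p] O))).toAlgebra
        ∃ t : ℕ, FibreBoundAt O p ((PowerSeries (PowerSeries O)) ⊗[IwasawaAlgebra₂ p] X)
          (PowerSeries.map (PowerSeries.map (algebraMap ℤ_[p] O)) G) u t)
    (hKato : Module.IsTorsion
      (IwasawaAlgebra₂ p ⧸ Ideal.span {(PowerSeries.C PowerSeries.X : IwasawaAlgebra₂ p)})
      (QuotSMulTop (PowerSeries.C PowerSeries.X : IwasawaAlgebra₂ p) X))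
    (hvert : ∀ P : GoodPrime p, ¬ Associated P.P PowerSeries.X → UnifTwistBounds p P X G) :
    ∃ a : ℕ, Ideal.span {(p : IwasawaAlgebra₂ p) ^ a * G} ≤
      Literature.NumberTheory.EllipticCurves.Module.charIdeal (IwasawaAlgebra₂ p) X := by
  refine engine_twist X G hPT hPB hFT hLB hT hnv fun P => ?_
  by_cases hP : Associated P.P PowerSeries.X
  · exact Or.inl (fibreTorsionAt_of_associated (katoLine p) P hP.symm X
      (fibreTorsionAt_of_isTorsion (katoLine p) X hKato))
  · exact Or.inr (twistBounds_of_unif P X G (hvert P hP))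

end Currencies


/-! ## E8 (v1.2, g16). THE DEPTH CURRENCY — CGLS20 §3.4 one dimension up

(XS) `Module.IsTorsion Λ₂ X` follows from torsion of ONE fibre (Cayley–Hamilton for `s•` with `sX ⊆ πX`), so the
hypothesis «`X` is `Λ₂`-torsion» of `engine_std` is REDUNDANT given the Kato-line torsion (`engine_std'`).

(DEPTH) For a good prime `P` not associated to `T₂` the **depth** `#(O_Q / u_Q O_Q)` and the rank `rk_{ℤ_p} O_Q` of
the residue orders of the twisted translates `Q = ι_v(P)` are EVENTUALLY CONSTANT (equal to those of `P`) as
`v → 1` `p`-adically: `O_Q ≅ O_P` as `ℤ_p`-algebras via `ι_v`, under which `u_Q ↦ v⁻¹(u_P - (v - 1))`, and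
`(u_P - c) = (u_P)` as ideals once `p^{d+1} ∣ c` where `p^d ∈ (u_P)` (`u_P ≠ 0` is integral over `ℤ_p`; `O_P` is
local). This is the two-variable replica of «`C_{α_{𝔓_m}} = C_{α_𝔓}` and `rank S_{𝔓_m} = rank S_𝔓` for `m ≫ 0`,
hence the error term is bounded independently of `m`» in the proof of CGLS20 Thm 3.4.1 (Castella–Grossi–Lee–
Skinner, arXiv:2008.02571, p. 21), where `C_α = v_p(α(γ) - 1)` and the exceptional prime `𝔓₀ = (γ - 1)` (there
`C_α → ∞`) is our Kato line `T₂` (`u → 0`). CONSEQUENCE (`unifTwistBounds_of_depth`, `engine_depth`): fibre bounds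
whose slack is ANY function `F(depth, rank)` — the printed SHAPE of a Kolyvagin-system bound with error «depending
only on `C_α`, `T_pE` and `rank_{ℤ_p} R`» (CGLS20 Thm 3.2.1) — are automatically (UNIF); the engine's arithmetic
input becomes ONE statement `DepthFibreBounds` (+ Kato-line torsion).
-/

section DepthCurrency

variable {p : ℕ} [Fact p.Prime]

/-- **(XS)** A finitely generated `Λ₂`-module one of whose fibres `X/(C P)X` is killed by some `s ∉ (C P)` is
`Λ₂`-torsion: Cayley–Hamilton for the endomorphism `s•` (range in `(C P)·X`) gives a monic relation
`d := q(s) = s^n + ((C P)-multiples)` with `d ∉ (C P)` (prime) and `d·X = 0`. -/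
theorem isTorsion_of_fibreTorsionAt' (P : GoodPrime p) (X : Type) [AddCommGroup X]
    [Module (IwasawaAlgebra₂ p) X] [Module.Finite (IwasawaAlgebra₂ p) X] (h : FibreTorsionAt p P X) :
    Module.IsTorsion (IwasawaAlgebra₂ p) X := by
  classical
  obtain ⟨s, hs, hsX⟩ := h
  set π : IwasawaAlgebra₂ p := PowerSeries.C P.P with hπ
  set I : Ideal (IwasawaAlgebra₂ p) := Ideal.span {π} with hI
  haveI hIp : I.IsPrime := (Ideal.span_singleton_prime P.prime_C.ne_zero).mpr P.prime_C
  let f : Module.End (IwasawaAlgebra₂ p) X := algebraMap (IwasawaAlgebra₂ p) (Module.End (IwasawaAlgebra₂ p) X) s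
  have hf : LinearMap.range f ≤ I • ⊤ := by
    rintro _ ⟨x, rfl⟩
    rw [Module.algebraMap_end_apply, hI, Submodule.ideal_span_singleton_smul]
    exact hsX x
  obtain ⟨q, hmonic, -, hcoeff, hq⟩ :=
    LinearMap.exists_monic_and_natDegree_eq_and_coeff_mem_pow_and_aeval_eq_zero (IwasawaAlgebra₂ p) f I hf
  set d : IwasawaAlgebra₂ p := q.eval s with hd
  have hdX : ∀ x : X, d • x = 0 := by
    intro x
    have h1 : Polynomial.aeval f q = algebraMap (IwasawaAlgebra₂ p) (Module.End (IwasawaAlgebra₂ p) X) d :=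
      Polynomial.aeval_algebraMap_apply_eq_algebraMap_eval s q
    have h2 := congrArg (fun g : Module.End (IwasawaAlgebra₂ p) X => g x) hq
    simpa only [h1, Module.algebraMap_end_apply, LinearMap.zero_apply] using h2
  -- `d - s^n ∈ I`
  have hdiff : d - s ^ q.natDegree ∈ I := by
    rw [hd, Polynomial.eval_eq_sum_range, Finset.sum_range_succ, hmonic.coeff_natDegree, one_mul,
      add_sub_cancel_right]
    refine I.sum_mem fun k hk => ?_
    have hk' : k < q.natDegree := Finset.mem_range.mp hk
    exact I.mul_mem_right _ (Ideal.pow_le_self (by omega) (hcoeff k))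
  have hd0 : d ∉ I := by
    intro hdI
    have hsn : s ^ q.natDegree ∈ I := by
      have := I.sub_mem hdI hdiff
      rwa [sub_sub_cancel] at this
    exact hs (hIp.mem_of_pow_mem _ hsn)
  have hdne : d ≠ 0 := by
    rintro h0
    exact hd0 (h0 ▸ I.zero_mem)
  intro x
  exact ⟨⟨d, mem_nonZeroDivisors_of_ne_zero hdne⟩, hdX x⟩

/-- **`engine_std` without the torsion hypothesis** (XS): torsion of `X` follows from the Kato-line torsion. -/
theorem engine_std' (X : Type) [AddCommGroup X] [Module (IwasawaAlgebra₂ p) X]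
    [Module.Finite (IwasawaAlgebra₂ p) X] (G : IwasawaAlgebra₂ p)
    (hPT : PatchingTarget p X G) (hPB : PatchingBeta p X G)
    (hFT : FibreTransport p) (hLB : FibreLengthLowerBound p)
    (hnv : ∃ z : Polynomial ℤ_[p], z ≠ 0 ∧
      ∀ (O : Type) [CommRing O] [IsDomain O] [CharZero O] [Algebra ℤ_[p] O] [Module.Finite ℤ_[p] O]
        (u : O), u ∈ nonunits O → Polynomial.aeval u z ≠ 0 →
        letI : Algebra (IwasawaAlgebra₂ p) (PowerSeries (PowerSeries O)) :=
          (PowerSeries.map (PowerSeries.map (algebraMap ℤ_[p] O))).toAlgebra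
        ∃ t : ℕ, FibreBoundAt O p ((PowerSeries (PowerSeries O)) ⊗[IwasawaAlgebra₂ p] X)
          (PowerSeries.map (PowerSeries.map (algebraMap ℤ_[p] O)) G) u t)
    (hKato : Module.IsTorsion
      (IwasawaAlgebra₂ p ⧸ Ideal.span {(PowerSeries.C PowerSeries.X : IwasawaAlgebra₂ p)})
      (QuotSMulTop (PowerSeries.C PowerSeries.X : IwasawaAlgebra₂ p) X))
    (hvert : ∀ P : GoodPrime p, ¬ Associated P.P PowerSeries.X → UnifTwistBounds p P X G) :
    ∃ a : ℕ, Ideal.span {(p : IwasawaAlgebra₂ p) ^ a * G} ≤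
      Literature.NumberTheory.EllipticCurves.Module.charIdeal (IwasawaAlgebra₂ p) X :=
  engine_std X G hPT hPB hFT hLB
    (isTorsion_of_fibreTorsionAt' (katoLine p) X (fibreTorsionAt_of_isTorsion (katoLine p) X hKato))
    hnv hKato hvert

namespace GoodPrime

/-- `p` is not a unit of the residue order `O_P` (a quotient of the local ring `Λ₁`). -/
theorem p_mem_nonunits (P : GoodPrime p) : (p : P.O) ∈ nonunits P.O := by
  intro h
  haveI : IsLocalHom (Ideal.Quotient.mk (Ideal.span {P.P})) :=
    IsLocalHom.of_surjective _ Ideal.Quotient.mk_surjective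
  have h' : IsUnit (Ideal.Quotient.mk (Ideal.span {P.P}) (p : IwasawaAlgebra p)) := by
    rwa [map_natCast]
  exact not_isUnit_p (p := p) (IsUnit.of_map _ _ h')

/-- `O_P` is a local ring. -/
theorem isLocalRing_O (P : GoodPrime p) : IsLocalRing P.O :=
  IsLocalRing.of_surjective' (Ideal.Quotient.mk (Ideal.span {P.P})) Ideal.Quotient.mk_surjective

/-- `1 - p·x` is a unit of `O_P`. -/
theorem isUnit_one_sub_p_mul (P : GoodPrime p) (x : P.O) : IsUnit (1 - (p : P.O) * x) := by
  haveI := P.isLocalRing_O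
  refine IsLocalRing.isUnit_one_sub_self_of_mem_nonunits _ ?_
  have hp : (p : P.O) ∈ IsLocalRing.maximalIdeal P.O := P.p_mem_nonunits
  exact (IsLocalRing.maximalIdeal P.O).mul_mem_right x hp

theorem mk_C (P : GoodPrime p) (a : ℤ_[p]) :
    Ideal.Quotient.mk (Ideal.span {P.P}) (PowerSeries.C a) = algebraMap ℤ_[p] P.O a := by
  rw [PowerSeries.C_eq_algebraMap]; rfl

/-- `u_P = 0 ⟺ P` is (associated to) the Kato line `T₂`. -/
theorem u_ne_zero (P : GoodPrime p) (hP : ¬ Associated P.P PowerSeries.X) : P.u ≠ 0 := by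
  intro h
  rw [u_def, Ideal.Quotient.eq_zero_iff_mem, Ideal.mem_span_singleton] at h
  exact hP (P.prime.associated_of_dvd PowerSeries.X_prime h)

/-- **Some power of `p` lies in `u_P·O_P`** (`P` not the Kato line): `u_P ≠ 0` is integral over `ℤ_p`, and the
constant term of a monic relation with non-zero constant term is a multiple of `u_P`. -/
theorem exists_pow_p_mem_span_u (P : GoodPrime p) (hP : ¬ Associated P.P PowerSeries.X) :
    ∃ d : ℕ, (p : P.O) ^ d ∈ Ideal.span {P.u} := by
  classical
  have hu0 := P.u_ne_zero hP
  obtain ⟨q, hqm, hq⟩ := (Algebra.IsIntegral.isIntegral (R := ℤ_[p]) P.u)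
  rw [← Polynomial.aeval_def] at hq
  -- strip the power of `X`
  obtain ⟨q', hqq', hXq'⟩ := Polynomial.exists_eq_pow_rootMultiplicity_mul_and_not_dvd q hqm.ne_zero 0
  rw [map_zero, sub_zero] at hqq' hXq'
  have hq'm : q'.Monic := (Polynomial.monic_X_pow _).of_mul_monic_left (hqq' ▸ hqm)
  have hq'0 : Polynomial.aeval P.u q' = 0 := by
    rw [hqq', map_mul, map_pow, Polynomial.aeval_X] at hq
    exact (mul_eq_zero.mp hq).resolve_left (pow_ne_zero _ hu0)
  have hc0 : q'.coeff 0 ≠ 0 := fun h0 => hXq' (Polynomial.X_dvd_iff.mpr h0)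
  -- the constant term is a multiple of `u_P`
  have hc_mem : algebraMap ℤ_[p] P.O (q'.coeff 0) ∈ Ideal.span {P.u} := by
    have h1 := congrArg (Polynomial.aeval P.u) (Polynomial.X_mul_divX_add q')
    rw [hq'0, map_add, map_mul, Polynomial.aeval_X, Polynomial.aeval_C] at h1
    have h2 : algebraMap ℤ_[p] P.O (q'.coeff 0) = P.u * (-(Polynomial.aeval P.u q'.divX)) := by
      linear_combination h1
    rw [h2]
    exact Ideal.mul_mem_right _ _ (Ideal.mem_span_singleton_self _)
  -- and a power of `p` is a multiple of the constant term in `ℤ_p`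
  obtain ⟨n, hn⟩ := PadicInt.ideal_eq_span_pow_p (s := Ideal.span {q'.coeff 0})
    (by rwa [Ne, Ideal.span_singleton_eq_bot])
  have hpn : (p : ℤ_[p]) ^ n ∈ Ideal.span {q'.coeff 0} := hn ▸ Ideal.mem_span_singleton_self _
  obtain ⟨r, hr⟩ := Ideal.mem_span_singleton'.mp hpn
  refine ⟨n, ?_⟩
  have : (p : P.O) ^ n = algebraMap ℤ_[p] P.O r * algebraMap ℤ_[p] P.O (q'.coeff 0) := by
    rw [← map_mul, hr, map_pow, map_natCast]
  rw [this]
  exact Ideal.mul_mem_left _ _ hc_mem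

/-- `(u_P - c) = (u_P)` as ideals of `O_P` for `c ∈ ℤ_p` divisible by `p^{d+1}`, where `p^d ∈ (u_P)`. -/
theorem span_u_sub_eq (P : GoodPrime p) {d : ℕ} (hd : (p : P.O) ^ d ∈ Ideal.span {P.u}) {c : ℤ_[p]}
    (hc : (p : ℤ_[p]) ^ (d + 1) ∣ c) :
    Ideal.span {P.u - algebraMap ℤ_[p] P.O c} = Ideal.span {P.u} := by
  obtain ⟨w, rfl⟩ := hc
  obtain ⟨r, hr⟩ := Ideal.mem_span_singleton'.mp hd
  have key : P.u - algebraMap ℤ_[p] P.O ((p : ℤ_[p]) ^ (d + 1) * w) =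
      P.u * (1 - (p : P.O) * (r * algebraMap ℤ_[p] P.O w)) := by
    rw [map_mul, map_pow, map_natCast, pow_succ, ← hr]
    ring
  rw [key]
  exact Ideal.span_singleton_mul_right_unit (P.isUnit_one_sub_p_mul _) _

/-- `ι_v` as a `ℤ_p`-algebra AUTOMORPHISM of `Λ₁`. -/
noncomputable def twistAlgEquiv (v : ℤ_[p]ˣ) (hv : ‖(v : ℤ_[p]) - 1‖ < 1) :
    PowerSeries ℤ_[p] ≃ₐ[ℤ_[p]] PowerSeries ℤ_[p] :=
  AlgEquiv.ofRingEquiv (f := PadicIntSeries.unitTwistEquiv v hv) fun a => by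
    show PadicIntSeries.unitTwist (algebraMap ℤ_[p] (PowerSeries ℤ_[p]) a) (v : ℤ_[p]) =
      algebraMap ℤ_[p] (PowerSeries ℤ_[p]) a
    rw [← PowerSeries.C_eq_algebraMap]
    exact PadicIntSeries.unitTwist_C a hv

theorem twistAlgEquiv_apply (v : ℤ_[p]ˣ) (hv : ‖(v : ℤ_[p]) - 1‖ < 1) (f : PowerSeries ℤ_[p]) :
    twistAlgEquiv v hv f = PadicIntSeries.unitTwist f (v : ℤ_[p]) := rfl

/-- **`O_P ≅ O_{ι_v(P)}` as `ℤ_p`-algebras**, induced by `ι_v`. -/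
noncomputable def twistO (P : GoodPrime p) (v : ℤ_[p]ˣ) (hv : ‖(v : ℤ_[p]) - 1‖ < 1) :
    P.O ≃ₐ[ℤ_[p]] (P.twist v hv).O :=
  Ideal.quotientEquivAlg (Ideal.span {P.P}) (Ideal.span {(P.twist v hv).P}) (twistAlgEquiv v hv) (by
    rw [Ideal.map_span, Set.image_singleton]
    rfl)

theorem twistO_mk (P : GoodPrime p) (v : ℤ_[p]ˣ) (hv : ‖(v : ℤ_[p]) - 1‖ < 1) (x : IwasawaAlgebra p) :
    P.twistO v hv (Ideal.Quotient.mk (Ideal.span {P.P}) x) =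
      Ideal.Quotient.mk (Ideal.span {(P.twist v hv).P}) (PadicIntSeries.unitTwist x (v : ℤ_[p])) :=
  rfl

/-- `ι_v(u_P) = (v - 1) + v · u_{ι_v P}`. -/
theorem twistO_u (P : GoodPrime p) (v : ℤ_[p]ˣ) (hv : ‖(v : ℤ_[p]) - 1‖ < 1) :
    P.twistO v hv P.u = algebraMap ℤ_[p] (P.twist v hv).O ((v : ℤ_[p]) - 1) +
      algebraMap ℤ_[p] (P.twist v hv).O (v : ℤ_[p]) * (P.twist v hv).u := by
  rw [u_def, twistO_mk, PadicIntSeries.unitTwist_X hv, map_add, map_mul, mk_C, mk_C, u_def]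

/-- The element of `O_P` corresponding to `u_{ι_v P}`: `y_v = (v⁻¹ - 1) + v⁻¹ u_P = v⁻¹ (u_P - (v - 1))`. -/
theorem twistO_y (P : GoodPrime p) (v : ℤ_[p]ˣ) (hv : ‖(v : ℤ_[p]) - 1‖ < 1) :
    P.twistO v hv (algebraMap ℤ_[p] P.O ((v⁻¹ : ℤ_[p]ˣ) : ℤ_[p]) *
        (P.u - algebraMap ℤ_[p] P.O ((v : ℤ_[p]) - 1))) = (P.twist v hv).u := by
  rw [map_mul, map_sub, AlgEquiv.commutes, AlgEquiv.commutes, twistO_u]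
  have hvv : ((v⁻¹ : ℤ_[p]ˣ) : ℤ_[p]) * (v : ℤ_[p]) = 1 := Units.inv_mul v
  set Q := P.twist v hv
  calc algebraMap ℤ_[p] Q.O ((v⁻¹ : ℤ_[p]ˣ) : ℤ_[p]) *
        (algebraMap ℤ_[p] Q.O ((v : ℤ_[p]) - 1) + algebraMap ℤ_[p] Q.O (v : ℤ_[p]) * Q.u -
          algebraMap ℤ_[p] Q.O ((v : ℤ_[p]) - 1))
        = algebraMap ℤ_[p] Q.O (((v⁻¹ : ℤ_[p]ˣ) : ℤ_[p]) * (v : ℤ_[p])) * Q.u := by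
          rw [map_mul]; ring
    _ = Q.u := by rw [hvv, map_one, one_mul]

/-- **Depth and rank are constant along the twisted translates near `P`** (`P` not the Kato line): if
`p^d ∈ (u_P)` and `p^{d+1} ∣ v - 1` then `#(O_Q/u_Q) = #(O_P/u_P)` for `Q = ι_v(P)` — CGLS20's
«`C_{α_{𝔓_m}} = C_{α_𝔓}` for `m ≫ 0`» one dimension up. -/
theorem card_quot_twist_eq (P : GoodPrime p) {d : ℕ} (hd : (p : P.O) ^ d ∈ Ideal.span {P.u})
    (v : ℤ_[p]ˣ) (hv : ‖(v : ℤ_[p]) - 1‖ < 1) (hN : (p : ℤ_[p]) ^ (d + 1) ∣ (v : ℤ_[p]) - 1) :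
    Nat.card ((P.twist v hv).O ⧸ Ideal.span {(P.twist v hv).u}) = Nat.card (P.O ⧸ Ideal.span {P.u}) := by
  classical
  set y : P.O := algebraMap ℤ_[p] P.O ((v⁻¹ : ℤ_[p]ˣ) : ℤ_[p]) *
    (P.u - algebraMap ℤ_[p] P.O ((v : ℤ_[p]) - 1)) with hy
  -- `(y) = (u_P)`
  have hspan : Ideal.span {y} = Ideal.span {P.u} := by
    have hunit : IsUnit (algebraMap ℤ_[p] P.O ((v⁻¹ : ℤ_[p]ˣ) : ℤ_[p])) :=
      (Units.map (algebraMap ℤ_[p] P.O : ℤ_[p] →* P.O) v⁻¹).isUnit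
    rw [hy, mul_comm, Ideal.span_singleton_mul_right_unit hunit, P.span_u_sub_eq hd hN]
  -- `O_Q/(u_Q) ≃ O_P/(y)` via `ι_v`
  have e : (P.O ⧸ Ideal.span {y}) ≃ₐ[ℤ_[p]] ((P.twist v hv).O ⧸ Ideal.span {(P.twist v hv).u}) :=
    Ideal.quotientEquivAlg (Ideal.span {y}) _ (P.twistO v hv) (by
      rw [Ideal.map_span, Set.image_singleton]
      show _ = Ideal.span {P.twistO v hv y}
      rw [hy, twistO_y])
  rw [← Nat.card_congr e.toEquiv]
  exact Nat.card_congr (Ideal.quotEquivOfEq hspan).toEquiv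

/-- `rk_{ℤ_p} O_{ι_v P} = rk_{ℤ_p} O_P` («`rank S_{𝔓_m} = rank S_𝔓`»). -/
theorem finrank_twist_eq (P : GoodPrime p) (v : ℤ_[p]ˣ) (hv : ‖(v : ℤ_[p]) - 1‖ < 1) :
    Module.finrank ℤ_[p] (P.twist v hv).O = Module.finrank ℤ_[p] P.O :=
  ((P.twistO v hv).toLinearEquiv.finrank_eq).symm

end GoodPrime

/-- **(Q1-depth) Depth/rank-controlled fibre bounds at all algebraic points off one divisor `z`.** At every finite
`ℤ_p`-order `O` (a domain) and non-unit `u ∈ O` with `z(u) ≠ 0`, the fibre bound holds with slack `p^t`,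
`t ≤ F(#(O/uO), rk_{ℤ_p} O)` for ONE function `F` — the printed shape of a rank-one Kolyvagin-system bound with
error term «depending only on `C_α` (`= v_p(α(γ) - 1)`), `T_pE` and `rank_{ℤ_p}(R)`» (CGLS20 Thm 3.2.1), for the
fibre representation `T_f ⊗ Ind ψ_u` (`ψ_u(γ₂) = 1 + u`, so `C = v(u)`). -/
def DepthFibreBounds (p : ℕ) [Fact p.Prime] (X : Type) [AddCommGroup X] [Module (IwasawaAlgebra₂ p) X]
    (G : IwasawaAlgebra₂ p) : Prop :=
  ∃ (F : ℕ → ℕ → ℕ) (z : Polynomial ℤ_[p]), z ≠ 0 ∧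
    ∀ (O : Type) [CommRing O] [IsDomain O] [CharZero O] [Algebra ℤ_[p] O] [Module.Finite ℤ_[p] O]
      (u : O), u ∈ nonunits O → Polynomial.aeval u z ≠ 0 →
      letI : Algebra (IwasawaAlgebra₂ p) (PowerSeries (PowerSeries O)) :=
        (PowerSeries.map (PowerSeries.map (algebraMap ℤ_[p] O))).toAlgebra
      ∃ t : ℕ, t ≤ F (Nat.card (O ⧸ Ideal.span {u})) (Module.finrank ℤ_[p] O) ∧
        FibreBoundAt O p ((PowerSeries (PowerSeries O)) ⊗[IwasawaAlgebra₂ p] X)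
          (PowerSeries.map (PowerSeries.map (algebraMap ℤ_[p] O)) G) u t

/-- **(Q1-depth) ⟹ (UNIF) at every good prime not associated to the Kato line.** The exceptional twists are those
with `ι_v(P) ∣ z` (finitely many, `finite_twist_dvd`); the level is `p^{d+1}` with `p^d ∈ (u_P)`; the uniform
slack is `F(depth P, rank P)`. -/
theorem unifTwistBounds_of_depth (P : GoodPrime p) (hP : ¬ Associated P.P PowerSeries.X) (X : Type)
    [AddCommGroup X] [Module (IwasawaAlgebra₂ p) X] (G : IwasawaAlgebra₂ p) (h : DepthFibreBounds p X G) :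
    UnifTwistBounds p P X G := by
  classical
  obtain ⟨F, z, hz, hF⟩ := h
  obtain ⟨d, hd⟩ := P.exists_pow_p_mem_span_u hP
  have hz' : ((z : PowerSeries ℤ_[p]) : IwasawaAlgebra p) ≠ 0 := by
    rw [Ne, Polynomial.coe_eq_zero_iff]; exact hz
  set S₀ : Finset ℤ_[p]ˣ := (P.finite_twist_dvd hz').toFinset with hS₀
  refine ⟨F (Nat.card (P.O ⧸ Ideal.span {P.u})) (Module.finrank ℤ_[p] P.O), d + 1, S₀, ?_⟩
  intro v hv hvS hdvd
  have hndvd : ¬ (P.twist v hv).P ∣ (z : PowerSeries ℤ_[p]) := fun h' =>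
    hvS ((Set.Finite.mem_toFinset _).mpr ⟨hv, h'⟩)
  obtain ⟨t, ht, hFB⟩ := hF (P.twist v hv).O (P.twist v hv).u (P.twist v hv).u_mem_nonunits
    ((P.twist v hv).aeval_u_ne_zero hndvd)
  refine ⟨t, ?_, hFB⟩
  rwa [P.card_quot_twist_eq hd v hv hdvd, P.finrank_twist_eq v hv] at ht

/-- **THE ENGINE IN THE DEPTH CURRENCY (end-to-end, PROVED).** For a finitely generated `Λ₂`-module `X` and
`G ∈ Λ₂`: the four algebra Props (PROVED in the sketch) + «`X/T₂X` is `ℤ_p⟦T₁⟧`-torsion» (Kato line; CGLS20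
Cor 3.4.2's corank-one input one dimension up) + (Q1-depth) ⟹ `(p^a · G) ⊆ ch_{Λ₂}(X)` for some `a`.
No torsion hypothesis (XS), no separate (UNIF) (DEPTH). -/
theorem engine_depth (X : Type) [AddCommGroup X] [Module (IwasawaAlgebra₂ p) X]
    [Module.Finite (IwasawaAlgebra₂ p) X] (G : IwasawaAlgebra₂ p)
    (hPT : PatchingTarget p X G) (hPB : PatchingBeta p X G)
    (hFT : FibreTransport p) (hLB : FibreLengthLowerBound p)
    (hKato : Module.IsTorsion
      (IwasawaAlgebra₂ p ⧸ Ideal.span {(PowerSeries.C PowerSeries.X : IwasawaAlgebra₂ p)})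
      (QuotSMulTop (PowerSeries.C PowerSeries.X : IwasawaAlgebra₂ p) X))
    (hQ1 : DepthFibreBounds p X G) :
    ∃ a : ℕ, Ideal.span {(p : IwasawaAlgebra₂ p) ^ a * G} ≤
      Literature.NumberTheory.EllipticCurves.Module.charIdeal (IwasawaAlgebra₂ p) X := by
  have hvert : ∀ P : GoodPrime p, ¬ Associated P.P PowerSeries.X → UnifTwistBounds p P X G :=
    fun P hP => unifTwistBounds_of_depth P hP X G hQ1
  obtain ⟨F, z, hz, hF⟩ := hQ1
  refine engine_std' X G hPT hPB hFT hLB ⟨z, hz, fun O _ _ _ _ _ u hu hzu => ?_⟩ hKato hvert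
  obtain ⟨t, -, ht⟩ := hF O u hu hzu
  exact ⟨t, ht⟩

end DepthCurrency


/-! ## E9 (v1.3, g17). THE S-DOOR: the vertical input over COMPLETE DVR coefficient rings (PROVED)

The critic's standing objection (V#16l, V#23i) to `VFamily` / `UnifTwistBounds` / `DepthFibreBounds` is their
COEFFICIENT CLASS (residue orders `O_Q = Λ₁/(Q)`, non-maximal in general) versus the complete DVRs of every printed
Kolyvagin-system bound. The second door asked for in V#23i: §E9.1 (LB) over ANY Noetherian domain (sketch §9.6
verbatim; `fibreLengthLowerBound_holds`) · §E9.2 Weierstrass evaluation `ev_u : S⟦T⟧ → S` at `u ∈ 𝔪_S` (division by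
`T - u`), kernel `(T - u)`, `ev_{u'} f ≡ ev_u f (mod u' - u)` · §E9.3 complete DVRs `S ⊇ ℤ_p` module-finite of
characteristic `0`: `p ∈ 𝔪_S`, `p^d ∈ (u)`, `(u + p^N) = (u)`, Krull · §E9.4 over `Λ_{2,S} = S⟦T₂⟧⟦T₁⟧`: `π_u = T₂ - u`
prime, `Λ_{2,S}/(π_u) ≅ S⟦T₁⟧`, the height-one prime `𝔔̄_u ∋ p̄` of the fibre ring with a `u`-independent residue
criterion, (FT_S) · §E9.5 ISOLATED ZEROS `f(u₀ + p^N) ≠ 0` for `N ≫ 0` (replaces avoidance and twists) · §E9.6 the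
degree-one vertical theorem **`verticalS_dvd`** (= `vertical_dvd` with good primes ↦ points of `𝔪_S`, `r = 1`) ·
§E9.7 FLAT base change `Λ₂ → Λ_{2,S}` (free of rank `rk S`) and `ord_π(C P)·ℓ_{(C P)}(X) ≤ ℓ_{(π)}(Λ_{2,S} ⊗ X)` ·
§E9.8 descent `ker(a ↦ a(u₀)) = (P)` in `Λ₁`, `(C P)^{ℓ_{(C P)}(X)} ∣ G` (multiplicity of the root carried:
`m·k ≤ k_S ≤ m·g`) · §E9.9 `DepthFibreBoundsDVR`, `RootDatumS`, **`engine_doorS`**. Base change is used one good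
prime at a time, BEFORE taking fibres (flat), so no comparison `O_Q⟦T₁⟧` vs `S⟦T₁⟧` (the non-flat dead end (N2))
ever occurs; no UFD / dimension / finite-support facts over `S` are needed. -/

set_option linter.unusedSectionVars false

/-! ### E9.1 (LB) over any Noetherian domain — the sketch's §9.6, verbatim (namespace `LB`) -/

section LowerBoundGeneric

namespace LB

section LowerBoundProof

open Summit.BirchSwinnertonDyer.BirchSwinnertonDyer.Theorems.SignedBaseChangeAcDivSpecialization

variable {R : Type*} [CommRing R]

/-- `R → R̄ → N/sN`: scalar tower for the `R̄`-module structure of `N/sN`. -/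
theorem isScalarTower_quotSMulTop (a : R) (N : Type*) [AddCommGroup N] [Module R N] :
    IsScalarTower R (R ⧸ Ideal.span {a}) (QuotSMulTop a N) :=
  ⟨fun r b m => by
    obtain ⟨b, rfl⟩ := Ideal.Quotient.mk_surjective b
    obtain ⟨x, rfl⟩ := Submodule.mkQ_surjective _ m
    show (r * b) • (Submodule.Quotient.mk x : QuotSMulTop a N) =
      r • b • (Submodule.Quotient.mk x : QuotSMulTop a N)
    rw [mul_smul]⟩

/-- `R → R̄ → N[s]`: scalar tower for the `R̄`-module structure of the `s`-torsion. -/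
theorem isScalarTower_torsionBy (a : R) (N : Type*) [AddCommGroup N] [Module R N] :
    IsScalarTower R (R ⧸ Ideal.span {a}) (Submodule.torsionBy R N a) :=
  ⟨fun r b m => by
    obtain ⟨b, rfl⟩ := Ideal.Quotient.mk_surjective b
    show (r * b) • m = r • b • m
    rw [mul_smul]⟩

/-- The snake for multiplication by `a` read over `R̄ = R/(a)` (six-term length identity at a prime of `R̄`;
port of the tree's `LocalLength.lengthAt_smul_snake`). -/
theorem lengthAt_quot_snake (a : R) {N₁ N₂ N₃ : Type*} [AddCommGroup N₁] [Module R N₁]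
    [AddCommGroup N₂] [Module R N₂] [AddCommGroup N₃] [Module R N₃]
    (f : N₁ →ₗ[R] N₂) (g : N₂ →ₗ[R] N₃) (hf : Function.Injective f) (hg : Function.Surjective g)
    (hfg : Function.Exact f g) (𝔔 : PrimeSpectrum (R ⧸ Ideal.span {a})) :
    Module.lengthAt (R ⧸ Ideal.span {a}) (Submodule.torsionBy R N₂ a) 𝔔 +
        Module.lengthAt (R ⧸ Ideal.span {a}) (QuotSMulTop a N₁) 𝔔 +
        Module.lengthAt (R ⧸ Ideal.span {a}) (QuotSMulTop a N₃) 𝔔 =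
      Module.lengthAt (R ⧸ Ideal.span {a}) (Submodule.torsionBy R N₁ a) 𝔔 +
        Module.lengthAt (R ⧸ Ideal.span {a}) (Submodule.torsionBy R N₃ a) 𝔔 +
        Module.lengthAt (R ⧸ Ideal.span {a}) (QuotSMulTop a N₂) 𝔔 := by
  haveI := isScalarTower_torsionBy a N₁
  haveI := isScalarTower_torsionBy a N₂
  haveI := isScalarTower_torsionBy a N₃
  haveI := isScalarTower_quotSMulTop a N₁
  haveI := isScalarTower_quotSMulTop a N₂
  haveI := isScalarTower_quotSMulTop a N₃
  have hsurj : Function.Surjective (algebraMap R (R ⧸ Ideal.span {a})) := Ideal.Quotient.mk_surjective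
  have hsq₁ : f.comp (DistribSMul.toLinearMap R N₁ a) = (DistribSMul.toLinearMap R N₂ a).comp f := by
    ext; simp
  have hsq₂ : g.comp (DistribSMul.toLinearMap R N₂ a) = (DistribSMul.toLinearMap R N₃ a).comp g := by
    ext; simp
  let δ := SnakeLemma.δ' (DistribSMul.toLinearMap R N₁ a) (DistribSMul.toLinearMap R N₂ a)
    (DistribSMul.toLinearMap R N₃ a) f g hfg f g hfg hsq₁ hsq₂
    (Submodule.torsionBy R N₃ a).subtype (Literature.RingTheory.Length.exact_subtype_smulMap a N₃)
    (Submodule.mkQ (a • ⊤)) (Literature.RingTheory.Length.exact_smulMap_mkQ a N₁) hg hf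
  have e₁ : Function.Injective (f.restrict (Literature.RingTheory.Length.mapsTo_torsionBy a f)) :=
    Literature.RingTheory.Length.restrict_torsionBy_injective a f hf
  have e₂ := Literature.RingTheory.Length.exact_restrict_torsionBy a f g hf hfg
  have e₃ : Function.Exact (g.restrict (Literature.RingTheory.Length.mapsTo_torsionBy a g)) δ :=
    SnakeLemma.exact_δ'_right (DistribSMul.toLinearMap R N₁ a) (DistribSMul.toLinearMap R N₂ a)
      (DistribSMul.toLinearMap R N₃ a) f g hfg f g hfg hsq₁ hsq₂
      (Submodule.torsionBy R N₂ a).subtype (Literature.RingTheory.Length.exact_subtype_smulMap a N₂)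
      (Submodule.torsionBy R N₃ a).subtype (Literature.RingTheory.Length.exact_subtype_smulMap a N₃)
      (Submodule.mkQ (a • ⊤)) (Literature.RingTheory.Length.exact_smulMap_mkQ a N₁) hg hf
      (g.restrict (Literature.RingTheory.Length.mapsTo_torsionBy a g)) rfl
      (Submodule.injective_subtype _)
  have e₄ : Function.Exact δ (QuotSMulTop.map a f) :=
    SnakeLemma.exact_δ'_left (DistribSMul.toLinearMap R N₁ a) (DistribSMul.toLinearMap R N₂ a)
      (DistribSMul.toLinearMap R N₃ a) f g hfg f g hfg hsq₁ hsq₂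
      (Submodule.torsionBy R N₃ a).subtype (Literature.RingTheory.Length.exact_subtype_smulMap a N₃)
      (Submodule.mkQ (a • ⊤)) (Literature.RingTheory.Length.exact_smulMap_mkQ a N₁)
      (Submodule.mkQ (a • ⊤)) (Literature.RingTheory.Length.exact_smulMap_mkQ a N₂) hg hf
      (QuotSMulTop.map a f) (QuotSMulTop.map_comp_mkQ a f) (Submodule.mkQ_surjective _)
  have e₅ := QuotSMulTop.map_exact a hfg hg
  have e₆ := QuotSMulTop.map_surjective a hg
  exact LocalLength.lengthAt_six_term
    ((f.restrict (Literature.RingTheory.Length.mapsTo_torsionBy a f)).extendScalarsOfSurjective hsurj)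
    ((g.restrict (Literature.RingTheory.Length.mapsTo_torsionBy a g)).extendScalarsOfSurjective hsurj)
    (δ.extendScalarsOfSurjective hsurj) ((QuotSMulTop.map a f).extendScalarsOfSurjective hsurj)
    ((QuotSMulTop.map a g).extendScalarsOfSurjective hsurj) e₁ e₂ e₃ e₄ e₅ e₆ 𝔔

/-- On a module `N ≃ R/𝔮`, every `q ∈ 𝔮` acts as `0`. -/
theorem smul_eq_zero_of_equiv_quotient {N : Type*} [AddCommGroup N] [Module R N] {𝔮 : Ideal R}
    (e : N ≃ₗ[R] R ⧸ 𝔮) {q : R} (hq : q ∈ 𝔮) (x : N) : q • x = 0 := by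
  apply e.injective
  rw [map_smul, map_zero, ← IsScalarTower.algebraMap_smul (R ⧸ 𝔮) q (e x), smul_eq_mul,
    Ideal.Quotient.algebraMap_eq, Ideal.Quotient.eq_zero_iff_mem.mpr hq, zero_mul]

/-- On a module `N ≃ R/𝔮`, an element acting as `0` lies in `𝔮`. -/
theorem mem_of_equiv_quotient {N : Type*} [AddCommGroup N] [Module R N] {𝔮 : Ideal R}
    (e : N ≃ₗ[R] R ⧸ 𝔮) {q : R} (hq : ∀ x : N, q • x = 0) : q ∈ 𝔮 := by
  have h := congrArg e (hq (e.symm (Ideal.Quotient.mk 𝔮 1)))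
  rw [map_smul, LinearEquiv.apply_symm_apply, map_zero,
    ← IsScalarTower.algebraMap_smul (R ⧸ 𝔮) q, smul_eq_mul, Ideal.Quotient.algebraMap_eq, ← map_mul,
    mul_one, Ideal.Quotient.eq_zero_iff_mem] at h
  exact h

/-- `R/𝔮` for `t ∉ 𝔮` (prime) has no `t`-torsion. -/
theorem subsingleton_torsionBy_of_equiv_quotient {t : R} {N : Type*} [AddCommGroup N] [Module R N]
    {𝔮 : Ideal R} (h𝔮 : 𝔮.IsPrime) (e : N ≃ₗ[R] R ⧸ 𝔮) (htq : t ∉ 𝔮) :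
    Subsingleton (Submodule.torsionBy R N t) := by
  have hz : ∀ z : Submodule.torsionBy R N t, z = 0 := by
    intro ⟨z, hz⟩
    rw [Submodule.mem_torsionBy_iff] at hz
    obtain ⟨r, hr⟩ := Ideal.Quotient.mk_surjective (e z)
    have h0 : t • e z = 0 := by rw [← map_smul, hz, map_zero]
    rw [← hr, ← IsScalarTower.algebraMap_smul (R ⧸ 𝔮) t, smul_eq_mul, Ideal.Quotient.algebraMap_eq,
      ← map_mul, Ideal.Quotient.eq_zero_iff_mem] at h0
    have hr𝔮 : r ∈ 𝔮 := (h𝔮.mem_or_mem h0).resolve_left htq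
    have hez : e z = 0 := by rw [← hr, Ideal.Quotient.eq_zero_iff_mem.mpr hr𝔮]
    exact Subtype.ext ((map_eq_zero_iff e e.injective).mp hez)
  exact ⟨fun x y => by rw [hz x, hz y]⟩

/-- `ℓ_𝔔(N[s]) < ∞` over `R̄ = R/(s)` for `N` finitely generated and killed by `c`, `s ∤ c`, `ht 𝔔 = 1`:
`N[s]` is a finitely generated `R̄`-module killed by `c̄ ≠ 0`. -/
theorem lengthAt_torsionBy_ne_top [IsNoetherianRing R] {s c : R} (hs : Prime s) (hsc : ¬ s ∣ c)
    (𝔔 : PrimeSpectrum (R ⧸ Ideal.span {s})) (hht : 𝔔.asIdeal.height = 1)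
    (N : Type*) [AddCommGroup N] [Module R N] [Module.Finite R N] (hcN : ∀ x : N, c • x = 0) :
    Module.lengthAt (R ⧸ Ideal.span {s}) (Submodule.torsionBy R N s) 𝔔 ≠ ⊤ := by
  haveI : (Ideal.span {s}).IsPrime := (Ideal.span_singleton_prime hs.ne_zero).mpr hs
  haveI := isScalarTower_torsionBy s N
  haveI : Module.Finite (R ⧸ Ideal.span {s}) (Submodule.torsionBy R N s) :=
    Module.Finite.of_restrictScalars_finite R _ _
  have hcbar : Ideal.Quotient.mk (Ideal.span {s}) c ≠ 0 := by
    rw [Ne, Ideal.Quotient.eq_zero_iff_mem, Ideal.mem_span_singleton]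
    exact hsc
  refine Module.lengthAt_ne_top_of_isTorsionBy hcbar (fun x => ?_) 𝔔 hht.le
  show c • x = 0
  exact Subtype.ext (by rw [Submodule.coe_smul, ZeroMemClass.coe_zero]; exact hcN x)

variable [IsNoetherianRing R] [IsDomain R]

/-- Bookkeeping in `ℕ∞` for the exact case of the dévissage. -/
theorem enat_devissage_step {E₁ E₃ m B₁ B₂ B₃ A₁ A₂ A₃ : ℕ∞} (I₁ : E₁ * m + B₁ ≤ A₁)
    (I₃ : E₃ * m + B₃ ≤ A₃) (six : B₂ + A₁ + A₃ = B₁ + B₃ + A₂) (h₁ : B₁ ≠ ⊤) (h₃ : B₃ ≠ ⊤) :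
    (E₁ + E₃) * m + B₂ ≤ A₂ := by
  have hB : B₁ + B₃ ≠ ⊤ := WithTop.add_ne_top.mpr ⟨h₁, h₃⟩
  rw [← ENat.add_le_add_iff_right hB]
  calc (E₁ + E₃) * m + B₂ + (B₁ + B₃) = (E₁ * m + B₁) + (E₃ * m + B₃) + B₂ := by ring
    _ ≤ A₁ + A₃ + B₂ := add_le_add (add_le_add I₁ I₃) le_rfl
    _ = B₂ + A₁ + A₃ := by ring
    _ = B₁ + B₃ + A₂ := six
    _ = A₂ + (B₁ + B₃) := by ring

/-- **The dévissage inequality** `e(N)·m̄ + b(N) ≤ a(N)` (notation of the section docstring). -/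
theorem lowerBound_devissage {s π c : R} (hs : Prime s) (hπ : Prime π) (hπs : ¬ π ∣ s)
    (hsc : ¬ s ∣ c) (𝔔 : PrimeSpectrum (R ⧸ Ideal.span {s})) (hht : 𝔔.asIdeal.height = 1)
    (N : Type*) [AddCommGroup N] [Module R N] [hN : Module.Finite R N] (hcN : ∀ x : N, c • x = 0) :
    Module.lengthAt R N ⟨Ideal.span {π}, (Ideal.span_singleton_prime hπ.ne_zero).mpr hπ⟩ *
          Module.lengthAt (R ⧸ Ideal.span {s})
            ((R ⧸ Ideal.span {s}) ⧸ Ideal.span {Ideal.Quotient.mk (Ideal.span {s}) π}) 𝔔 +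
        Module.lengthAt (R ⧸ Ideal.span {s}) (Submodule.torsionBy R N s) 𝔔 ≤
      Module.lengthAt (R ⧸ Ideal.span {s}) (QuotSMulTop s N) 𝔔 := by
  classical
  haveI hsP : (Ideal.span {s}).IsPrime := (Ideal.span_singleton_prime hs.ne_zero).mpr hs
  have hsurj : Function.Surjective (algebraMap R (R ⧸ Ideal.span {s})) :=
    Ideal.Quotient.mk_surjective
  have hc0 : c ≠ 0 := fun h => hsc (h ▸ dvd_zero s)
  set 𝔓 : PrimeSpectrum R := ⟨Ideal.span {π}, (Ideal.span_singleton_prime hπ.ne_zero).mpr hπ⟩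
    with h𝔓def
  revert hcN
  induction hN using IsNoetherianRing.induction_on_isQuotientEquivQuotientPrime R with
  | subsingleton N =>
    intro hcN
    rw [Module.lengthAt_eq_zero_of_subsingleton (R := R) (M := N),
      Module.lengthAt_eq_zero_of_subsingleton (R := R ⧸ Ideal.span {s})
        (M := Submodule.torsionBy R N s), zero_mul, zero_add]
    exact bot_le
  | quotient N q e =>
    intro hcN
    haveI := isScalarTower_quotSMulTop s N
    haveI := isScalarTower_torsionBy s N
    have hcq : c ∈ q.asIdeal := mem_of_equiv_quotient e hcN
    have hq0 : q.asIdeal ≠ ⊥ := by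
      intro h
      rw [h, Ideal.mem_bot] at hcq
      exact hc0 hcq
    by_cases hqπ : q.asIdeal = Ideal.span {π}
    · -- `𝔮 = (π)`: `e = 1`, `b = 0`, `a ≥ m̄`
      have hsq : s ∉ q.asIdeal := by
        rw [hqπ, Ideal.mem_span_singleton]
        exact hπs
      haveI := subsingleton_torsionBy_of_equiv_quotient q.isPrime e hsq
      obtain rfl : q = 𝔓 := PrimeSpectrum.ext hqπ
      rw [Module.lengthAt_eq_zero_of_subsingleton (R := R ⧸ Ideal.span {s})
        (M := Submodule.torsionBy R N s), add_zero, Module.lengthAt_eq_of_linearEquiv e,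
        Module.lengthAt_quotient_self, one_mul]
      -- the surjection `N/sN ↠ R̄/(π̄)`
      have hker : (𝔓.asIdeal : Submodule R R) ≤ LinearMap.ker (Algebra.linearMap R
          ((R ⧸ Ideal.span {s}) ⧸ Ideal.span {Ideal.Quotient.mk (Ideal.span {s}) π})) := by
        show Ideal.span {π} ≤ _
        rw [Ideal.span_le, Set.singleton_subset_iff, SetLike.mem_coe, LinearMap.mem_ker,
          Algebra.linearMap_apply, ← Ideal.Quotient.mk_algebraMap, Ideal.Quotient.algebraMap_eq,
          Ideal.Quotient.eq_zero_iff_mem]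
        exact Ideal.mem_span_singleton_self _
      let ψ : N →ₗ[R] ((R ⧸ Ideal.span {s}) ⧸ Ideal.span {Ideal.Quotient.mk (Ideal.span {s}) π}) :=
        (Submodule.liftQ 𝔓.asIdeal (Algebra.linearMap R _) hker) ∘ₗ e.toLinearMap
      have hkerψ : (s • ⊤ : Submodule R N) ≤ LinearMap.ker ψ := by
        intro z hz
        obtain ⟨y, -, rfl⟩ := (Submodule.mem_smul_pointwise_iff_exists _ _ _).mp hz
        rw [LinearMap.mem_ker, map_smul,
          ← IsScalarTower.algebraMap_smul (R ⧸ Ideal.span {s}) s (ψ y), Ideal.Quotient.algebraMap_eq,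
          Ideal.Quotient.eq_zero_iff_mem.mpr (Ideal.mem_span_singleton_self s), zero_smul]
      let ψq := ((s • ⊤ : Submodule R N).liftQ ψ hkerψ).extendScalarsOfSurjective hsurj
      refine Module.lengthAt_le_of_surjective ψq (fun y => ?_) 𝔔
      obtain ⟨z, rfl⟩ := Ideal.Quotient.mk_surjective y
      obtain ⟨r, rfl⟩ := Ideal.Quotient.mk_surjective z
      refine ⟨Submodule.Quotient.mk (e.symm (Submodule.Quotient.mk r)), ?_⟩
      rw [LinearMap.extendScalarsOfSurjective_apply, Submodule.liftQ_apply, LinearMap.comp_apply,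
        LinearEquiv.coe_coe, LinearEquiv.apply_symm_apply, Submodule.liftQ_apply, Algebra.linearMap_apply]
      rfl
    · -- `𝔮 ≠ (π)`: `e = 0`
      have hnle : ¬ q.asIdeal ≤ Ideal.span {π} := by
        intro hle
        obtain ⟨x, hx, hx0⟩ := Submodule.exists_mem_ne_zero_of_ne_bot hq0
        obtain ⟨n, y, hy, rfl⟩ := WfDvdMonoid.max_power_factor hx0 hπ.irreducible
        rcases q.isPrime.mem_or_mem hx with h | h
        · have hπq : π ∈ q.asIdeal := q.isPrime.mem_of_pow_mem n h
          exact hqπ (le_antisymm hle ((Ideal.span_singleton_le_iff_mem _).mpr hπq))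
        · exact hy (Ideal.mem_span_singleton.mp (hle h))
      rw [Module.lengthAt_eq_of_linearEquiv e, Module.lengthAt_quotient_eq_zero_of_not_le hnle,
        zero_mul, zero_add]
      by_cases hsq : s ∈ q.asIdeal
      · -- `s ∈ 𝔮`: `sN = 0`, so `N[s] ↪ N/sN`
        have hkill : ∀ x : N, s • x = 0 := smul_eq_zero_of_equiv_quotient e hsq
        have hbot : (s • ⊤ : Submodule R N) = ⊥ := by
          rw [eq_bot_iff]
          intro x hx
          obtain ⟨y, -, rfl⟩ := (Submodule.mem_smul_pointwise_iff_exists _ _ _).mp hx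
          exact (Submodule.mem_bot R).mpr (hkill y)
        let φ := ((s • ⊤ : Submodule R N).mkQ ∘ₗ (Submodule.torsionBy R N s).subtype)
          |>.extendScalarsOfSurjective hsurj
        refine Module.lengthAt_le_of_injective φ (fun x y hxy => ?_) 𝔔
        have : ((x : N) - y) ∈ (s • ⊤ : Submodule R N) := by
          rw [← Submodule.Quotient.eq]; exact hxy
        rw [hbot, Submodule.mem_bot, sub_eq_zero] at this
        exact Subtype.ext this
      · haveI := subsingleton_torsionBy_of_equiv_quotient q.isPrime e hsq
        rw [Module.lengthAt_eq_zero_of_subsingleton (R := R ⧸ Ideal.span {s})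
          (M := Submodule.torsionBy R N s)]
        exact bot_le
  | exact N₁ N₂ N₃ f g hf hg hfg ih₁ ih₃ =>
    intro hc₂
    have hc₁ : ∀ x : N₁, c • x = 0 := fun x => hf (by rw [map_smul, hc₂, map_zero])
    have hc₃ : ∀ x : N₃, c • x = 0 := fun x => by
      obtain ⟨y, rfl⟩ := hg x
      rw [← map_smul, hc₂, map_zero]
    exact enat_devissage_step (ih₁ hc₁) (ih₃ hc₃) (lengthAt_quot_snake s f g hf hg hfg 𝔔)
      (lengthAt_torsionBy_ne_top hs hsc 𝔔 hht N₁ hc₁) (lengthAt_torsionBy_ne_top hs hsc 𝔔 hht N₃ hc₃)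
      |> fun h => by rwa [Module.lengthAt_eq_add_of_exact f g hf hg hfg 𝔓]


end LowerBoundProof

end LB

/-- **(LB) holds** (the engine's hypothesis `FibreLengthLowerBound p`, now proved in this file). -/
theorem fibreLengthLowerBound_holds (p : ℕ) [Fact p.Prime] : FibreLengthLowerBound p := by
  intro X _ _ _ s π c hπ 𝔔 hs hπs hsc hcX hht
  exact le_trans le_self_add (LB.lowerBound_devissage hs hπ hπs hsc 𝔔 hht X hcX)

end LowerBoundGeneric

/-! ### E9.2 Evaluation at a point of `𝔪_S` of a complete local ring `S` (Weierstrass division by `T - u`) -/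

section EvalS

variable {S : Type} [CommRing S] [IsLocalRing S] [IsAdicComplete (IsLocalRing.maximalIdeal S) S]

/-- `T - u` is distinguished for `u ∈ 𝔪_S`. -/
theorem isDistinguishedAt_X_sub_C {u : S} (hu : u ∈ IsLocalRing.maximalIdeal S) :
    (Polynomial.X - Polynomial.C u).IsDistinguishedAt (IsLocalRing.maximalIdeal S) := by
  refine ⟨⟨fun {n} hn => ?_⟩, Polynomial.monic_X_sub_C _⟩
  rw [Polynomial.natDegree_X_sub_C, Nat.lt_one_iff] at hn
  subst hn
  rwa [Polynomial.coeff_sub, Polynomial.coeff_X_zero, Polynomial.coeff_C_zero, zero_sub, neg_mem_iff]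

theorem coe_X_sub_C (u : S) :
    ((Polynomial.X - Polynomial.C u : Polynomial S) : PowerSeries S) = PowerSeries.X - PowerSeries.C u := by
  rw [Polynomial.coe_sub, Polynomial.coe_X, Polynomial.coe_C]

/-- Weierstrass division by `T - u`: `S[T]/(T - u) ≅ S⟦T⟧/(T - u)` (`Polynomial.IsDistinguishedAt.algEquivQuotient`;
the `Algebra S S⟦T⟧` instance is pinned by unification). -/
noncomputable def weqvS {u : S} (hu : u ∈ IsLocalRing.maximalIdeal S) :
    (Polynomial S ⧸ Ideal.span {Polynomial.X - Polynomial.C u}) ≃+*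
      (PowerSeries S ⧸ Ideal.span {((Polynomial.X - Polynomial.C u : Polynomial S) : PowerSeries S)}) :=
  @AlgEquiv.toRingEquiv _ _ _ _ _ _ (_) (_) (isDistinguishedAt_X_sub_C hu).algEquivQuotient

theorem weqvS_mk {u : S} (hu : u ∈ IsLocalRing.maximalIdeal S) (q : Polynomial S) :
    weqvS hu (Ideal.Quotient.mk _ q) = Ideal.Quotient.mk _ (q : PowerSeries S) := by
  show Ideal.Quotient.mk _ (PowerSeries.map (algebraMap S S) (q : PowerSeries S)) = _
  rw [Algebra.algebraMap_self, PowerSeries.map_id, id_eq]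

/-- **Evaluation at `u ∈ 𝔪_S`**: `ev_u : S⟦T⟧ → S`, `T ↦ u`, constants fixed (reduction modulo the
distinguished polynomial `T - u`, then `S[T]/(T - u) ≅ S`). -/
noncomputable def evS {u : S} (hu : u ∈ IsLocalRing.maximalIdeal S) : PowerSeries S →+* S :=
  (Polynomial.quotientSpanXSubCAlgEquiv u).toRingEquiv.toRingHom.comp
    ((weqvS hu).symm.toRingHom.comp (Ideal.Quotient.mk _))

theorem evS_apply {u : S} (hu : u ∈ IsLocalRing.maximalIdeal S) (F : PowerSeries S) :
    evS hu F = Polynomial.quotientSpanXSubCAlgEquiv u ((weqvS hu).symm (Ideal.Quotient.mk _ F)) := rfl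

theorem evS_coe {u : S} (hu : u ∈ IsLocalRing.maximalIdeal S) (q : Polynomial S) :
    evS hu (q : PowerSeries S) = q.eval u := by
  rw [evS_apply, ← weqvS_mk hu, RingEquiv.symm_apply_apply, Polynomial.quotientSpanXSubCAlgEquiv_mk]

theorem evS_C {u : S} (hu : u ∈ IsLocalRing.maximalIdeal S) (a : S) : evS hu (PowerSeries.C a) = a := by
  rw [← Polynomial.coe_C, evS_coe, Polynomial.eval_C]

theorem evS_X {u : S} (hu : u ∈ IsLocalRing.maximalIdeal S) : evS hu PowerSeries.X = u := by
  rw [← Polynomial.coe_X, evS_coe, Polynomial.eval_X]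

/-- `ker ev_u = (T - u)`. -/
theorem evS_eq_zero_iff {u : S} (hu : u ∈ IsLocalRing.maximalIdeal S) (F : PowerSeries S) :
    evS hu F = 0 ↔ PowerSeries.X - PowerSeries.C u ∣ F := by
  rw [← Ideal.mem_span_singleton, ← coe_X_sub_C, ← Ideal.Quotient.eq_zero_iff_mem, evS_apply,
    map_eq_zero_iff _ (AlgEquiv.injective _), map_eq_zero_iff _ (RingEquiv.injective _)]

/-- **Congruence**: `u' - u ∣ ev_{u'} F - ev_u F`. -/
theorem sub_dvd_evS_sub {u u' : S} (hu : u ∈ IsLocalRing.maximalIdeal S)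
    (hu' : u' ∈ IsLocalRing.maximalIdeal S) (F : PowerSeries S) : u' - u ∣ evS hu' F - evS hu F := by
  have hdvd : PowerSeries.X - PowerSeries.C u ∣ F - PowerSeries.C (evS hu F) := by
    rw [← evS_eq_zero_iff hu, map_sub, evS_C, sub_self]
  obtain ⟨H, hH⟩ := hdvd
  have h1 := congrArg (evS hu') hH
  rw [map_sub, evS_C, map_mul, map_sub, evS_X, evS_C] at h1
  exact ⟨evS hu' H, h1⟩

/-- `ev_u F ≡ F(0) (mod 𝔪_S)`. -/
theorem evS_sub_constantCoeff_mem {u : S} (hu : u ∈ IsLocalRing.maximalIdeal S) (F : PowerSeries S) :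
    evS hu F - PowerSeries.constantCoeff F ∈ IsLocalRing.maximalIdeal S := by
  have hdvd : PowerSeries.X ∣ F - PowerSeries.C (PowerSeries.constantCoeff F) := by
    rw [PowerSeries.X_dvd_iff, map_sub, PowerSeries.constantCoeff_C, sub_self]
  obtain ⟨H, hH⟩ := hdvd
  have h1 := congrArg (evS hu) hH
  rw [map_sub, evS_C, map_mul, evS_X] at h1
  rw [h1]
  exact Ideal.mul_mem_right _ _ hu

end EvalS

/-! ### E9.3 The coefficient rings `S`: complete DVRs, module-finite over `ℤ_p`, of characteristic zero -/

section SFacts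

variable {p : ℕ} [Fact p.Prime]
variable (S : Type) [CommRing S] [IsDomain S] [IsDiscreteValuationRing S] [CharZero S]
  [Algebra ℤ_[p] S] [Module.Finite ℤ_[p] S]

/-- `p ∈ 𝔪_S` (Nakayama: `S = p·S` would force `S = 0`). -/
theorem natCast_p_mem_maximalIdeal : (p : S) ∈ IsLocalRing.maximalIdeal S := by
  by_contra h
  have hu : IsUnit (p : S) := by
    rwa [IsLocalRing.mem_maximalIdeal, mem_nonunits_iff, not_not] at h
  obtain ⟨v, hv⟩ := hu.exists_left_inv
  have hle : (⊤ : Submodule ℤ_[p] S) ≤ IsLocalRing.maximalIdeal ℤ_[p] • (⊤ : Submodule ℤ_[p] S) := by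
    intro s _
    have hs : s = (p : ℤ_[p]) • (v * s) := by
      rw [Algebra.smul_def, map_natCast, ← mul_assoc, mul_comm (p : S) v, hv, one_mul]
    rw [hs]
    refine Submodule.smul_mem_smul ?_ Submodule.mem_top
    rw [PadicInt.maximalIdeal_eq_span_p]; exact Ideal.mem_span_singleton_self _
  have htop := Submodule.eq_bot_of_le_smul_of_le_jacobson_bot _ _ Module.Finite.fg_top hle
    (IsLocalRing.maximalIdeal_le_jacobson _)
  have h1 : (1 : S) ∈ (⊤ : Submodule ℤ_[p] S) := Submodule.mem_top
  rw [htop, Submodule.mem_bot] at h1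
  exact one_ne_zero h1

theorem isUnit_one_sub_p_mulS (x : S) : IsUnit (1 - (p : S) * x) :=
  IsLocalRing.isUnit_one_sub_self_of_mem_nonunits _
    ((IsLocalRing.maximalIdeal S).mul_mem_right x (natCast_p_mem_maximalIdeal S))

theorem natCast_p_ne_zeroS : (p : S) ≠ 0 := Nat.cast_ne_zero.mpr (Fact.out : p.Prime).ne_zero

theorem algebraMap_injectiveS : Function.Injective (algebraMap ℤ_[p] S) := by
  rw [injective_iff_map_eq_zero]
  intro c hc
  by_contra h0
  rw [PadicInt.unitCoeff_spec h0, map_mul, map_pow, map_natCast] at hc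
  rcases mul_eq_zero.mp hc with h | h
  · exact ((PadicInt.unitCoeff h0).isUnit.map (algebraMap ℤ_[p] S)).ne_zero h
  · exact pow_ne_zero _ (natCast_p_ne_zeroS S) h

/-- Some power of `p` lies in `(u)` for `u ≠ 0` (`u` is integral over `ℤ_p`; the constant term of a monic relation
with non-zero constant term is a multiple of `u` and divides a power of `p`). -/
theorem exists_pow_p_mem_spanS {u : S} (hu0 : u ≠ 0) : ∃ d : ℕ, (p : S) ^ d ∈ Ideal.span {u} := by
  classical
  obtain ⟨q, hqm, hq⟩ := (Algebra.IsIntegral.isIntegral (R := ℤ_[p]) u)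
  rw [← Polynomial.aeval_def] at hq
  obtain ⟨q', hqq', hXq'⟩ := Polynomial.exists_eq_pow_rootMultiplicity_mul_and_not_dvd q hqm.ne_zero 0
  rw [map_zero, sub_zero] at hqq' hXq'
  have hq'0 : Polynomial.aeval u q' = 0 := by
    rw [hqq', map_mul, map_pow, Polynomial.aeval_X] at hq
    exact (mul_eq_zero.mp hq).resolve_left (pow_ne_zero _ hu0)
  have hc0 : q'.coeff 0 ≠ 0 := fun h0 => hXq' (Polynomial.X_dvd_iff.mpr h0)
  have hc_mem : algebraMap ℤ_[p] S (q'.coeff 0) ∈ Ideal.span {u} := by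
    have h1 := congrArg (Polynomial.aeval u) (Polynomial.X_mul_divX_add q')
    rw [hq'0, map_add, map_mul, Polynomial.aeval_X, Polynomial.aeval_C] at h1
    have h2 : algebraMap ℤ_[p] S (q'.coeff 0) = u * (-(Polynomial.aeval u q'.divX)) := by
      linear_combination h1
    rw [h2]
    exact Ideal.mul_mem_right _ _ (Ideal.mem_span_singleton_self _)
  obtain ⟨n, hn⟩ := PadicInt.ideal_eq_span_pow_p (s := Ideal.span {q'.coeff 0})
    (by rwa [Ne, Ideal.span_singleton_eq_bot])
  have hpn : (p : ℤ_[p]) ^ n ∈ Ideal.span {q'.coeff 0} := hn ▸ Ideal.mem_span_singleton_self _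
  obtain ⟨r, hr⟩ := Ideal.mem_span_singleton'.mp hpn
  refine ⟨n, ?_⟩
  have : (p : S) ^ n = algebraMap ℤ_[p] S r * algebraMap ℤ_[p] S (q'.coeff 0) := by
    rw [← map_mul, hr, map_pow, map_natCast]
  rw [this]
  exact Ideal.mul_mem_left _ _ hc_mem

/-- **Depth is locally constant**: `(u + p^N a) = (u)` for `N > d`, `p^d ∈ (u)`. -/
theorem span_add_eqS {u : S} {d : ℕ} (hd : (p : S) ^ d ∈ Ideal.span {u}) {N : ℕ} (hN : d + 1 ≤ N) (a : S) :
    Ideal.span {u + (p : S) ^ N * a} = Ideal.span {u} := by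
  obtain ⟨r, hr⟩ := Ideal.mem_span_singleton'.mp hd
  obtain ⟨e, rfl⟩ := Nat.exists_eq_add_of_le hN
  have key : u + (p : S) ^ (d + 1 + e) * a = u * (1 - (p : S) * (-(r * (p : S) ^ e * a))) := by
    rw [show d + 1 + e = d + (e + 1) from by ring, pow_add, ← hr]; ring
  rw [key]
  exact Ideal.span_singleton_mul_right_unit (isUnit_one_sub_p_mulS S _) _

/-- Krull: a non-zero element of `S` is not divisible by every power of `p`. -/
theorem exists_not_pow_dvdS {a : S} (ha : a ≠ 0) : ∃ N : ℕ, ¬ (p : S) ^ N ∣ a := by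
  by_contra h
  have h' : ∀ N : ℕ, (p : S) ^ N ∣ a := fun N => not_not.mp (not_exists.mp h N)
  have hmem : a ∈ ⨅ n : ℕ, (Ideal.span {(p : S)}) ^ n := by
    rw [Ideal.mem_iInf]
    intro n
    rw [Ideal.span_singleton_pow, Ideal.mem_span_singleton]
    exact h' n
  have hne : Ideal.span {(p : S)} ≠ ⊤ := by
    rw [Ne, Ideal.eq_top_iff_one, Ideal.mem_span_singleton]
    exact fun h1 => natCast_p_mem_maximalIdeal S (isUnit_of_dvd_one h1)
  rw [Ideal.iInf_pow_eq_bot_of_isLocalRing _ hne, Ideal.mem_bot] at hmem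
  exact ha hmem

/-- `u + p^{N+1} ∈ 𝔪_S` for `u ∈ 𝔪_S`: the APPROXIMANTS of a point. -/
theorem approx_mem {u : S} (hu : u ∈ IsLocalRing.maximalIdeal S) (N : ℕ) :
    u + (p : S) ^ (N + 1) ∈ IsLocalRing.maximalIdeal S := by
  rw [pow_succ]
  exact Ideal.add_mem _ hu (Ideal.mul_mem_left _ _ (natCast_p_mem_maximalIdeal S))

end SFacts

/-! ### E9.4 `Λ_{2,S} = S⟦T₂⟧⟦T₁⟧`: the vertical prime through `u ∈ 𝔪_S`, `ev₂`, `𝔔̄_u`, (FT_S) -/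

section LamS

open Summit.BirchSwinnertonDyer.BirchSwinnertonDyer.Theorems.SignedBaseChangeAcDivSpecialization

variable {p : ℕ} [Fact p.Prime]
variable {S : Type} [CommRing S] [IsDomain S] [IsDiscreteValuationRing S]
  [IsAdicComplete (IsLocalRing.maximalIdeal S) S] [CharZero S] [Algebra ℤ_[p] S] [Module.Finite ℤ_[p] S]

theorem natCast_p_eq_CC : (p : PowerSeries (PowerSeries S)) = PowerSeries.C (PowerSeries.C (p : S)) := by
  rw [map_natCast, map_natCast]

theorem X_sub_C_ne_zero (u : S) : (PowerSeries.X - PowerSeries.C u : PowerSeries S) ≠ 0 := fun h => by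
  have h1 := congrArg (PowerSeries.coeff 1) h
  rw [map_sub, PowerSeries.coeff_one_X, PowerSeries.coeff_C, if_neg one_ne_zero, sub_zero, map_zero] at h1
  exact one_ne_zero h1

theorem verticalPrimeO_ne_zero (u : S) : verticalPrimeO S u ≠ 0 := fun h => by
  have h1 : PowerSeries.constantCoeff (verticalPrimeO S u) = PowerSeries.X - PowerSeries.C u :=
    PowerSeries.constantCoeff_C _
  rw [h, map_zero] at h1
  exact X_sub_C_ne_zero u h1.symm

/-- `T₂ - u` is prime in `S⟦T₂⟧` (`u ∈ 𝔪_S`): the kernel of `ev_u` onto the domain `S`. -/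
theorem prime_X_sub_C {u : S} (hu : u ∈ IsLocalRing.maximalIdeal S) :
    Prime (PowerSeries.X - PowerSeries.C u : PowerSeries S) := by
  have hker : RingHom.ker (evS hu) = Ideal.span {PowerSeries.X - PowerSeries.C u} := by
    ext F; rw [RingHom.mem_ker, evS_eq_zero_iff, Ideal.mem_span_singleton]
  rw [← Ideal.span_singleton_prime (X_sub_C_ne_zero u), ← hker]
  exact RingHom.ker_isPrime _

/-- **Evaluation `T₂ ↦ u` on `Λ_{2,S}`**: `S⟦T₂⟧⟦T₁⟧ → S⟦T₁⟧`, `T₁`-coefficientwise `ev_u`. -/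
noncomputable def ev₂ {u : S} (hu : u ∈ IsLocalRing.maximalIdeal S) :
    PowerSeries (PowerSeries S) →+* PowerSeries S :=
  PowerSeries.map (evS hu)

theorem coeff_ev₂ {u : S} (hu : u ∈ IsLocalRing.maximalIdeal S) (F : PowerSeries (PowerSeries S)) (n : ℕ) :
    PowerSeries.coeff n (ev₂ hu F) = evS hu (PowerSeries.coeff n F) := by
  rw [ev₂, PowerSeries.coeff_map]

theorem ev₂_fibreSection {u : S} (hu : u ∈ IsLocalRing.maximalIdeal S) (b : PowerSeries S) :
    ev₂ hu (fibreSection S b) = b := by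
  ext n
  rw [coeff_ev₂, fibreSection, PowerSeries.coeff_map, evS_C]

theorem ev₂_comp_fibreSection {u : S} (hu : u ∈ IsLocalRing.maximalIdeal S) :
    (ev₂ hu).comp (fibreSection S) = RingHom.id _ :=
  RingHom.ext (ev₂_fibreSection hu)

theorem ev₂_C {u : S} (hu : u ∈ IsLocalRing.maximalIdeal S) (f : PowerSeries S) :
    ev₂ hu (PowerSeries.C f) = PowerSeries.C (evS hu f) := by
  rw [ev₂, PowerSeries.map_C]

theorem ev₂_verticalPrimeO {u : S} (hu : u ∈ IsLocalRing.maximalIdeal S) : ev₂ hu (verticalPrimeO S u) = 0 := by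
  rw [verticalPrimeO, ev₂_C, map_sub, evS_X, evS_C, sub_self, map_zero]

/-- `ker ev₂ = (T₂ - u)`. -/
theorem ev₂_eq_zero_iff {u : S} (hu : u ∈ IsLocalRing.maximalIdeal S) (F : PowerSeries (PowerSeries S)) :
    ev₂ hu F = 0 ↔ verticalPrimeO S u ∣ F := by
  constructor
  · intro h
    show PowerSeries.C (PowerSeries.X - PowerSeries.C u) ∣ F
    refine C_dvd_of_forall_dvd_coeff fun n => (evS_eq_zero_iff hu _).mp ?_
    rw [← coeff_ev₂, h, map_zero]
  · rintro ⟨H, rfl⟩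
    rw [map_mul, ev₂_verticalPrimeO, zero_mul]

theorem ev₂_surjective {u : S} (hu : u ∈ IsLocalRing.maximalIdeal S) : Function.Surjective (ev₂ hu) :=
  fun b => ⟨fibreSection S b, ev₂_fibreSection hu b⟩

theorem ker_ev₂ {u : S} (hu : u ∈ IsLocalRing.maximalIdeal S) :
    RingHom.ker (ev₂ hu) = Ideal.span {verticalPrimeO S u} := by
  ext F; rw [RingHom.mem_ker, ev₂_eq_zero_iff, Ideal.mem_span_singleton]

/-- `T₂ - u` is PRIME in `Λ_{2,S}`. -/
theorem prime_verticalPrimeO {u : S} (hu : u ∈ IsLocalRing.maximalIdeal S) : Prime (verticalPrimeO S u) := by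
  rw [← Ideal.span_singleton_prime (verticalPrimeO_ne_zero u), ← ker_ev₂ hu]
  exact RingHom.ker_isPrime _

/-- The point `(T₂ - u) ∈ Spec Λ_{2,S}`. -/
noncomputable def ptS {u : S} (hu : u ∈ IsLocalRing.maximalIdeal S) : PrimeSpectrum (PowerSeries (PowerSeries S)) :=
  ⟨Ideal.span {verticalPrimeO S u},
    (Ideal.span_singleton_prime (verticalPrimeO_ne_zero u)).mpr (prime_verticalPrimeO hu)⟩

theorem ptS_asIdeal {u : S} (hu : u ∈ IsLocalRing.maximalIdeal S) :
    (ptS hu).asIdeal = Ideal.span {verticalPrimeO S u} := rfl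

theorem height_ptS {u : S} (hu : u ∈ IsLocalRing.maximalIdeal S) : (ptS hu).asIdeal.height = 1 :=
  Ideal.height_span_singleton_eq_one_of_mem_nonZeroDivisors
    (mem_nonZeroDivisors_of_ne_zero (verticalPrimeO_ne_zero u)) (prime_verticalPrimeO hu).not_unit

/-- **`S⟦T₁⟧ ≅ Λ_{2,S}/(T₂ - u)`** induced by `ev₂`. -/
noncomputable def eqvS {u : S} (hu : u ∈ IsLocalRing.maximalIdeal S) :
    PowerSeries S ≃+* (PowerSeries (PowerSeries S) ⧸ Ideal.span {verticalPrimeO S u}) :=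
  ((ev₂ hu).quotientKerEquivOfSurjective (ev₂_surjective hu)).symm.trans (Ideal.quotEquivOfEq (ker_ev₂ hu))

theorem eqvS_ev₂ {u : S} (hu : u ∈ IsLocalRing.maximalIdeal S) (x : PowerSeries (PowerSeries S)) :
    eqvS hu (ev₂ hu x) = Ideal.Quotient.mk _ x := by
  rw [eqvS, RingEquiv.trans_apply, RingHom.quotientKerEquivOfSurjective_symm_apply, Ideal.quotEquivOfEq_mk]

theorem eqvS_apply {u : S} (hu : u ∈ IsLocalRing.maximalIdeal S) (b : PowerSeries S) :
    eqvS hu b = Ideal.Quotient.mk _ (fibreSection S b) := by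
  rw [← eqvS_ev₂ hu, ev₂_fibreSection]

theorem eqvS_symm_mk {u : S} (hu : u ∈ IsLocalRing.maximalIdeal S) (x : PowerSeries (PowerSeries S)) :
    (eqvS hu).symm (Ideal.Quotient.mk _ x) = ev₂ hu x := by
  rw [← eqvS_ev₂ hu, RingEquiv.symm_apply_apply]

variable (S) in
/-- `𝔫_S = ker(S⟦T₁⟧ → κ_S⟦T₁⟧) = 𝔪_S · S⟦T₁⟧`. -/
noncomputable def kerRes₁ : Ideal (PowerSeries S) := RingHom.ker (PowerSeries.map (IsLocalRing.residue S))

theorem mem_kerRes₁_iff {f : PowerSeries S} :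
    f ∈ kerRes₁ S ↔ ∀ n, PowerSeries.coeff n f ∈ IsLocalRing.maximalIdeal S := by
  rw [kerRes₁, RingHom.mem_ker, PowerSeries.ext_iff]
  refine forall_congr' fun n => ?_
  rw [PowerSeries.coeff_map, map_zero, IsLocalRing.residue_eq_zero_iff]

theorem kerRes₁_isPrime : (kerRes₁ S).IsPrime := RingHom.ker_isPrime _

theorem kerRes₁_eq_span {ϖ : S} (hϖ : IsLocalRing.maximalIdeal S = Ideal.span {ϖ}) :
    kerRes₁ S = Ideal.span {PowerSeries.C ϖ} := by
  ext f
  rw [mem_kerRes₁_iff, Ideal.mem_span_singleton, hϖ]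
  simp_rw [Ideal.mem_span_singleton]
  exact ⟨C_dvd_of_forall_dvd_coeff, dvd_coeff_of_C_dvd⟩

variable (S) in
/-- `𝔔₀,S = ker(Λ_{2,S} → κ_{S⟦T₂⟧}⟦T₁⟧)`: `T₁`-coefficientwise reduction modulo `𝔪_{S⟦T₂⟧} = (ϖ, T₂)`. -/
noncomputable def kerResS : Ideal (PowerSeries (PowerSeries S)) :=
  RingHom.ker (PowerSeries.map (IsLocalRing.residue (PowerSeries S)))

theorem mem_kerResS_iff {F : PowerSeries (PowerSeries S)} :
    F ∈ kerResS S ↔ ∀ n, PowerSeries.constantCoeff (PowerSeries.coeff n F) ∈ IsLocalRing.maximalIdeal S := by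
  rw [kerResS, RingHom.mem_ker, PowerSeries.ext_iff]
  refine forall_congr' fun n => ?_
  rw [PowerSeries.coeff_map, map_zero, IsLocalRing.residue_eq_zero_iff, IsLocalRing.mem_maximalIdeal,
    IsLocalRing.mem_maximalIdeal, mem_nonunits_iff, mem_nonunits_iff, PowerSeries.isUnit_iff_constantCoeff]

theorem kerResS_isPrime : (kerResS S).IsPrime := RingHom.ker_isPrime _

theorem natCast_mem_kerResS : (p : PowerSeries (PowerSeries S)) ∈ kerResS S := by
  rw [mem_kerResS_iff]
  intro n
  rw [natCast_p_eq_CC, PowerSeries.coeff_C]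
  split_ifs
  · rw [PowerSeries.constantCoeff_C]; exact natCast_p_mem_maximalIdeal S
  · rw [map_zero]; exact Ideal.zero_mem _

/-- **The residue criterion**: `ev₂_u F ∈ 𝔫_S ⟺ F ∈ 𝔔₀,S` — independent of `u ∈ 𝔪_S`. -/
theorem ev₂_mem_kerRes₁_iff {u : S} (hu : u ∈ IsLocalRing.maximalIdeal S) (F : PowerSeries (PowerSeries S)) :
    ev₂ hu F ∈ kerRes₁ S ↔ F ∈ kerResS S := by
  rw [mem_kerRes₁_iff, mem_kerResS_iff]
  refine forall_congr' fun n => ?_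
  rw [coeff_ev₂]
  have h := evS_sub_constantCoeff_mem hu (PowerSeries.coeff n F)
  constructor
  · intro h1; have := Ideal.sub_mem _ h1 h; rwa [sub_sub_cancel] at this
  · intro h1; have := Ideal.add_mem _ h h1; rwa [sub_add_cancel] at this

/-- The prime `𝔔̄_u` of the fibre ring `Λ_{2,S}/(T₂ - u)`: the transport of `𝔫_S` along `eqvS`. -/
noncomputable def qbarS {u : S} (hu : u ∈ IsLocalRing.maximalIdeal S) :
    PrimeSpectrum (PowerSeries (PowerSeries S) ⧸ Ideal.span {verticalPrimeO S u}) :=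
  ⟨(kerRes₁ S).comap (eqvS hu).symm, by haveI := kerRes₁_isPrime (S := S); infer_instance⟩

theorem qbarS_asIdeal {u : S} (hu : u ∈ IsLocalRing.maximalIdeal S) :
    (qbarS hu).asIdeal = (kerRes₁ S).comap (eqvS hu).symm := rfl

/-- `v̄ ∈ 𝔔̄_u ⟺ v ∈ 𝔔₀,S`. -/
theorem mk_mem_qbarS_iff {u : S} (hu : u ∈ IsLocalRing.maximalIdeal S) {v : PowerSeries (PowerSeries S)} :
    Ideal.Quotient.mk (Ideal.span {verticalPrimeO S u}) v ∈ (qbarS hu).asIdeal ↔ v ∈ kerResS S := by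
  show (eqvS hu).symm (Ideal.Quotient.mk _ v) ∈ kerRes₁ S ↔ _
  rw [eqvS_symm_mk, ev₂_mem_kerRes₁_iff]

theorem natCast_mem_qbarS {u : S} (hu : u ∈ IsLocalRing.maximalIdeal S) :
    Ideal.Quotient.mk (Ideal.span {verticalPrimeO S u}) (p : PowerSeries (PowerSeries S)) ∈
      (qbarS hu).asIdeal :=
  (mk_mem_qbarS_iff hu).mpr natCast_mem_kerResS

theorem not_verticalPrimeO_dvd_natCast {u : S} (hu : u ∈ IsLocalRing.maximalIdeal S) :
    ¬ verticalPrimeO S u ∣ (p : PowerSeries (PowerSeries S)) := by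
  rw [← ev₂_eq_zero_iff hu, map_natCast]
  intro h
  have := congrArg PowerSeries.constantCoeff h
  rw [map_natCast, map_zero] at this
  exact natCast_p_ne_zeroS S this

theorem mk_natCast_ne_zeroS {u : S} (hu : u ∈ IsLocalRing.maximalIdeal S) :
    Ideal.Quotient.mk (Ideal.span {verticalPrimeO S u}) (p : PowerSeries (PowerSeries S)) ≠ 0 := by
  rw [Ne, Ideal.Quotient.eq_zero_iff_mem, Ideal.mem_span_singleton]
  exact not_verticalPrimeO_dvd_natCast hu

/-- `𝔔̄_u = (ϖ̄)` for a uniformiser `ϖ` of `S`. -/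
theorem qbarS_asIdeal_eq_span {u : S} (hu : u ∈ IsLocalRing.maximalIdeal S) {ϖ : S}
    (hϖ : IsLocalRing.maximalIdeal S = Ideal.span {ϖ}) :
    (qbarS hu).asIdeal = Ideal.span {Ideal.Quotient.mk (Ideal.span {verticalPrimeO S u})
      (PowerSeries.C (PowerSeries.C ϖ))} := by
  rw [qbarS_asIdeal, Ideal.comap_symm, kerRes₁_eq_span hϖ, Ideal.map_span, Set.image_singleton, eqvS_apply,
    fibreSection, PowerSeries.map_C]

/-- **`𝔔̄_u` has height one.** -/
theorem height_qbarS {u : S} (hu : u ∈ IsLocalRing.maximalIdeal S) : (qbarS hu).asIdeal.height = 1 := by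
  obtain ⟨ϖ, hirr⟩ := IsDiscreteValuationRing.exists_irreducible S
  have hϖ := (IsDiscreteValuationRing.irreducible_iff_uniformizer ϖ).mp hirr
  have heq := qbarS_asIdeal_eq_span hu hϖ
  haveI : (Ideal.span {verticalPrimeO S u}).IsPrime := (ptS hu).isPrime
  rw [heq]
  refine Ideal.height_span_singleton_eq_one_of_mem_nonZeroDivisors (mem_nonZeroDivisors_of_ne_zero ?_) ?_
  · rw [Ne, Ideal.Quotient.eq_zero_iff_mem, Ideal.mem_span_singleton, ← ev₂_eq_zero_iff hu, ev₂_C, evS_C]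
    intro h
    have := congrArg PowerSeries.constantCoeff h
    rw [PowerSeries.constantCoeff_C, map_zero] at this
    exact hirr.ne_zero this
  · intro hunit
    refine (qbarS hu).isPrime.ne_top (Ideal.eq_top_of_isUnit_mem _ ?_ hunit)
    rw [heq]; exact Ideal.mem_span_singleton_self _

/-- **(FT_S) fibre transport over `S`**: the fibre bound `p^t G ∈ ch(Y/(T₂-u)Y)·section + (T₂ - u)` (the
`S⟦T₁⟧`-structure through the section) IS `p^t · Ḡ ∈ ch_{Λ_{2,S}/(T₂-u)}(Y/(T₂-u)Y)` along `eqvS`. -/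
theorem fibre_transportS {u : S} (hu : u ∈ IsLocalRing.maximalIdeal S) (Y : Type) [AddCommGroup Y]
    [Module (PowerSeries (PowerSeries S)) Y] (G : PowerSeries (PowerSeries S)) (t : ℕ)
    (h : FibreBoundAt S p Y G u t) :
    Ideal.Quotient.mk (Ideal.span {verticalPrimeO S u}) ((p : PowerSeries (PowerSeries S)) ^ t * G) ∈
      Module.charIdeal (PowerSeries (PowerSeries S) ⧸ Ideal.span {verticalPrimeO S u})
        (QuotSMulTop (verticalPrimeO S u) Y) := by
  letI inst : Module (PowerSeries S) (QuotSMulTop (verticalPrimeO S u) Y) := Module.compHom _ (fibreSection S)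
  have h0 : (p : PowerSeries (PowerSeries S)) ^ t * G ∈
      (Module.charIdeal (PowerSeries S) (QuotSMulTop (verticalPrimeO S u) Y)).map (fibreSection S) ⊔
        Ideal.span {verticalPrimeO S u} := h
  have h1 := Ideal.mem_map_of_mem (ev₂ hu) h0
  rw [Ideal.map_sup, Ideal.map_map, ev₂_comp_fibreSection, Ideal.map_id, Ideal.map_span, Set.image_singleton,
    ev₂_verticalPrimeO, Ideal.span_singleton_zero, sup_bot_eq] at h1
  have he : ∀ (b : PowerSeries S) (f : QuotSMulTop (verticalPrimeO S u) Y),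
      (AddEquiv.refl _) (b • f) = eqvS hu b • (AddEquiv.refl _) f := by
    intro b f
    obtain ⟨y, rfl⟩ := Submodule.Quotient.mk_surjective _ f
    rw [AddEquiv.refl_apply, AddEquiv.refl_apply, eqvS_apply]
    rfl
  rw [Module.charIdeal_eq_map_of_semilinearEquiv (eqvS hu) (AddEquiv.refl _) he, ← eqvS_ev₂]
  exact Ideal.mem_map_of_mem _ h1

/-! ### E9.5 Isolated zeros along the approximants `u₀ + p^{N+1}` -/

/-- **Isolated zeros**: `f ≠ 0` in `S⟦T₂⟧` ⟹ `f(u₀ + p^{N+1}) ≠ 0` for all `N ≥ N₁` (`f = (T₂-u₀)^r d`,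
`d(u₀) ≠ 0`, Krull `p^{N₁} ∤ d(u₀)`, congruence `d(u') ≡ d(u₀) mod p^{N+1}`). -/
theorem eventually_evS_ne_zero {u₀ : S} (hu₀ : u₀ ∈ IsLocalRing.maximalIdeal S) {f : PowerSeries S}
    (hf : f ≠ 0) : ∃ N₁ : ℕ, ∀ N, N₁ ≤ N → evS (approx_mem (p := p) S hu₀ N) f ≠ 0 := by
  classical
  obtain ⟨r, d, hd, rfl⟩ := WfDvdMonoid.max_power_factor hf (prime_X_sub_C hu₀).irreducible
  have ha : evS hu₀ d ≠ 0 := fun h => hd ((evS_eq_zero_iff hu₀ d).mp h)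
  obtain ⟨N₁, hN₁⟩ := exists_not_pow_dvdS (p := p) S ha
  refine ⟨N₁, fun N hN h0 => hN₁ ?_⟩
  rw [map_mul, map_pow, map_sub, evS_X, evS_C, add_sub_cancel_left, mul_eq_zero] at h0
  have h1 : evS (approx_mem (p := p) S hu₀ N) d = 0 :=
    h0.resolve_left (pow_ne_zero _ (pow_ne_zero _ (natCast_p_ne_zeroS S)))
  have h2 := sub_dvd_evS_sub hu₀ (approx_mem (p := p) S hu₀ N) d
  rw [add_sub_cancel_left, h1, zero_sub, dvd_neg] at h2
  exact (pow_dvd_pow _ (by omega : N₁ ≤ N + 1)).trans h2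

theorem exists_coeff_ne_zero' {F : PowerSeries (PowerSeries S)} (hF : F ≠ 0) :
    ∃ n, PowerSeries.coeff n F ≠ 0 := by
  by_contra h
  exact hF (PowerSeries.ext fun n => by rw [map_zero]; exact not_not.mp (not_exists.mp h n))

/-- **Annihilator avoidance along the approximants**: `(T₂ - u₀ - p^{N+1}) ∤ c` for `N ≥ N₁` (`c ≠ 0`). -/
theorem eventually_not_dvd {u₀ : S} (hu₀ : u₀ ∈ IsLocalRing.maximalIdeal S)
    {c : PowerSeries (PowerSeries S)} (hc : c ≠ 0) :
    ∃ N₁ : ℕ, ∀ N, N₁ ≤ N → ¬ verticalPrimeO S (u₀ + (p : S) ^ (N + 1)) ∣ c := by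
  obtain ⟨n, hn⟩ := exists_coeff_ne_zero' hc
  obtain ⟨N₁, hN₁⟩ := eventually_evS_ne_zero (p := p) hu₀ hn
  refine ⟨N₁, fun N hN hdvd => hN₁ N hN ?_⟩
  rw [← ev₂_eq_zero_iff (approx_mem S hu₀ N)] at hdvd
  rw [← coeff_ev₂, hdvd, map_zero]

/-- `T₂ - u₀ = (T₂ - u₀ - p^{N+1}) + p^{N+1}` in `Λ_{2,S}`. -/
theorem verticalPrimeO_eq_add (u₀ : S) (N : ℕ) :
    verticalPrimeO S u₀ = verticalPrimeO S (u₀ + (p : S) ^ (N + 1)) +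
      (p : PowerSeries (PowerSeries S)) ^ (N + 1) := by
  show PowerSeries.C (PowerSeries.X - PowerSeries.C u₀) =
    PowerSeries.C (PowerSeries.X - PowerSeries.C (u₀ + (p : S) ^ (N + 1))) +
      (p : PowerSeries (PowerSeries S)) ^ (N + 1)
  rw [natCast_p_eq_CC, ← map_pow, ← map_pow, ← map_add, map_add (PowerSeries.C (R := S)) u₀]
  congr 1
  ring

/-! ### E9.6 The degree-one vertical theorem over `S` (PROVED) -/

/-- **The vertical theorem over `S`**: `Y` f.g. over `Λ_{2,S}` killed by `c ≠ 0`, fibre bounds of slack `≤ t₀`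
at `u' = u₀ + p^{N+1}` (`N ≥ N₀`) ⟹ `(T₂-u₀)^{ℓ(Y)} ∣ G` (= `vertical_dvd` with `r = 1`, isolated zeros). -/
theorem verticalS_dvd {u₀ : S} (hu₀ : u₀ ∈ IsLocalRing.maximalIdeal S)
    (Y : Type) [AddCommGroup Y] [Module (PowerSeries (PowerSeries S)) Y]
    [Module.Finite (PowerSeries (PowerSeries S)) Y]
    {c : PowerSeries (PowerSeries S)} (hc0 : c ≠ 0) (hcY : ∀ y : Y, c • y = 0)
    (G : PowerSeries (PowerSeries S)) (N₀ t₀ : ℕ)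
    (hbd : ∀ N, N₀ ≤ N → ∃ t, t ≤ t₀ ∧ FibreBoundAt S p Y G (u₀ + (p : S) ^ (N + 1)) t) :
    verticalPrimeO S u₀ ^ (Module.lengthAt (PowerSeries (PowerSeries S)) Y (ptS hu₀)).toNat ∣ G := by
  classical
  have hπ : Prime (verticalPrimeO S u₀) := prime_verticalPrimeO hu₀
  set k := (Module.lengthAt (PowerSeries (PowerSeries S)) Y (ptS hu₀)).toNat with hk
  by_cases hG0 : G = 0
  · rw [hG0]; exact dvd_zero _
  obtain ⟨g, G₁, hG₁, rfl⟩ := WfDvdMonoid.max_power_factor hG0 hπ.irreducible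
  by_cases hkg : k ≤ g
  · exact (pow_dvd_pow _ hkg).trans (dvd_mul_right _ _)
  exfalso
  have hgk : g < k := by omega
  have hktop : Module.lengthAt (PowerSeries (PowerSeries S)) Y (ptS hu₀) ≠ ⊤ :=
    Module.lengthAt_ne_top_of_isTorsionBy hc0 (fun y => hcY y) _ (height_ptS hu₀).le
  have hkeq : (k : ℕ∞) = Module.lengthAt (PowerSeries (PowerSeries S)) Y (ptS hu₀) := by
    rw [hk]; exact ENat.coe_toNat hktop
  -- DEPTH of `G₁` at `u₀`, read at `𝔔̄_{u₀}`
  haveI : (Ideal.span {verticalPrimeO S u₀}).IsPrime := (ptS hu₀).isPrime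
  have hG₁bar : Ideal.Quotient.mk (Ideal.span {verticalPrimeO S u₀}) G₁ ≠ 0 := by
    rw [Ne, Ideal.Quotient.eq_zero_iff_mem, Ideal.mem_span_singleton]; exact hG₁
  obtain ⟨m, sbar, hbar, hs𝔔, hdepth⟩ :=
    exists_depth (qbarS hu₀) (height_qbarS hu₀) (natCast_mem_qbarS (p := p) hu₀) hG₁bar
  obtain ⟨s₀, rfl⟩ := Ideal.Quotient.mk_surjective sbar
  obtain ⟨h₀, rfl⟩ := Ideal.Quotient.mk_surjective hbar
  have hs₀ : s₀ ∉ kerResS S := fun h => hs𝔔 ((mk_mem_qbarS_iff hu₀).mpr h)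
  have hr₁ : ∃ r₁ : PowerSeries (PowerSeries S),
      s₀ * (p : PowerSeries (PowerSeries S)) ^ m = G₁ * h₀ + verticalPrimeO S u₀ * r₁ := by
    have h1 : Ideal.Quotient.mk (Ideal.span {verticalPrimeO S u₀}) (s₀ * (p : PowerSeries (PowerSeries S)) ^ m) =
        Ideal.Quotient.mk (Ideal.span {verticalPrimeO S u₀}) (G₁ * h₀) := by
      rw [map_mul, map_mul, map_pow]; exact hdepth
    rw [Ideal.Quotient.eq, Ideal.mem_span_singleton] at h1
    obtain ⟨r₁, hr₁⟩ := h1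
    exact ⟨r₁, by rw [← hr₁]; ring⟩
  obtain ⟨r₁, hr₁⟩ := hr₁
  -- ISOLATED ZEROS: the approximant `u' = u₀ + p^{N+1}` with `π' ∤ c`, `N ≥ N₀`, `N ≥ m + 1 + t₀`
  obtain ⟨N₁, hN₁⟩ := eventually_not_dvd (p := p) hu₀ hc0
  obtain ⟨N, hNN₀, hNN₁, hNm⟩ : ∃ N, N₀ ≤ N ∧ N₁ ≤ N ∧ m + 1 + t₀ ≤ N :=
    ⟨N₀ + N₁ + (m + 1 + t₀), by omega, by omega, by omega⟩
  obtain ⟨t, ht, hFB⟩ := hbd N hNN₀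
  have hcN : ¬ verticalPrimeO S (u₀ + (p : S) ^ (N + 1)) ∣ c := hN₁ N hNN₁
  have hu' : u₀ + (p : S) ^ (N + 1) ∈ IsLocalRing.maximalIdeal S := approx_mem S hu₀ N
  have hCP := verticalPrimeO_eq_add (p := p) u₀ N
  set π' := verticalPrimeO S (u₀ + (p : S) ^ (N + 1)) with hπ'def
  have hs : Prime π' := prime_verticalPrimeO hu'
  -- `π ∤ π'` and `π' ∤ π` (else a vertical prime divides `p`)
  have hπs : ¬ verticalPrimeO S u₀ ∣ π' := fun h => by
    have h2 : verticalPrimeO S u₀ ∣ (p : PowerSeries (PowerSeries S)) ^ (N + 1) := by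
      have h3 := dvd_sub (dvd_refl (verticalPrimeO S u₀)) h
      rwa [hCP, add_sub_cancel_left, ← hCP] at h3
    exact not_verticalPrimeO_dvd_natCast hu₀ (hπ.dvd_of_dvd_pow h2)
  have hsπ : ¬ π' ∣ verticalPrimeO S u₀ := fun h => by
    have h2 : π' ∣ (p : PowerSeries (PowerSeries S)) ^ (N + 1) := by
      have h3 := dvd_sub h (dvd_refl π')
      rwa [hCP, add_sub_cancel_left] at h3
    exact not_verticalPrimeO_dvd_natCast hu' (hs.dvd_of_dvd_pow h2)
  obtain ⟨e, hNe⟩ : ∃ e, N + 1 = m + (1 + t + e) := ⟨N - m - t, by omega⟩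
  -- currency `A = Λ_{2,S}/(π')`, `M = Y/π'Y`
  haveI : (Ideal.span {π'}).IsPrime := (Ideal.span_singleton_prime hs.ne_zero).mpr hs
  haveI := LB.isScalarTower_quotSMulTop π' Y
  haveI : Module.Finite (PowerSeries (PowerSeries S) ⧸ Ideal.span {π'}) (QuotSMulTop π' Y) :=
    Module.Finite.of_restrictScalars_finite (PowerSeries (PowerSeries S)) _ _
  -- (FT_S) and (LB) at `u'`
  have hmem := fibre_transportS hu' Y (verticalPrimeO S u₀ ^ g * G₁) t hFB
  have hlen := le_trans le_self_add
    (LB.lowerBound_devissage hs hπ hπs hcN (qbarS hu') (height_qbarS hu') Y hcY)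
  have hpt : (⟨Ideal.span {verticalPrimeO S u₀}, (Ideal.span_singleton_prime hπ.ne_zero).mpr hπ⟩ :
      PrimeSpectrum (PowerSeries (PowerSeries S))) = ptS hu₀ := rfl
  rw [hpt, ← hkeq] at hlen
  -- the elements of `A`
  set mk := Ideal.Quotient.mk (Ideal.span {π'}) with hmk
  have hcbar : mk c ≠ 0 := by
    rw [Ne, hmk, Ideal.Quotient.eq_zero_iff_mem, Ideal.mem_span_singleton]; exact hcN
  have hcM : ∀ x : QuotSMulTop π' Y, mk c • x = 0 := by
    intro x
    obtain ⟨x, rfl⟩ := Submodule.mkQ_surjective _ x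
    show c • (Submodule.Quotient.mk x : QuotSMulTop π' Y) = 0
    rw [← Submodule.Quotient.mk_smul, hcY, Submodule.Quotient.mk_zero]
  have hq0 : mk (p : PowerSeries (PowerSeries S)) ≠ 0 := mk_natCast_ne_zeroS hu'
  have hπ0 : mk (verticalPrimeO S u₀) ≠ 0 := by
    rw [Ne, hmk, Ideal.Quotient.eq_zero_iff_mem, Ideal.mem_span_singleton]; exact hsπ
  have hπr : mk (verticalPrimeO S u₀) = mk (p : PowerSeries (PowerSeries S)) ^ (N + 1) * 1 := by
    rw [hCP, map_add, map_pow, hmk, Ideal.Quotient.eq_zero_iff_mem.mpr (Ideal.mem_span_singleton_self _),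
      zero_add, mul_one]
  -- `v = s₀ - p^{1+t+e} r₁ ∉ 𝔔₀,S`, `Ḡ₁ h̄₀ = q^m v̄`
  set v : PowerSeries (PowerSeries S) := s₀ - (p : PowerSeries (PowerSeries S)) ^ (1 + t + e) * r₁ with hv
  have hv𝔔 : mk v ∉ (qbarS hu').asIdeal := by
    intro h
    rw [hmk, mk_mem_qbarS_iff] at h
    apply hs₀
    have hmem' : (p : PowerSeries (PowerSeries S)) ^ (1 + t + e) * r₁ ∈ kerResS S := by
      rw [pow_add, pow_add, pow_one, mul_assoc, mul_assoc]
      exact Ideal.mul_mem_right _ _ (natCast_mem_kerResS (p := p))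
    have := (kerResS S).add_mem h hmem'
    rwa [hv, sub_add_cancel] at this
  have hGh : mk (G₁ * h₀) = mk (p : PowerSeries (PowerSeries S)) ^ m * mk v := by
    have hid : G₁ * h₀ = (p : PowerSeries (PowerSeries S)) ^ m * v - π' * r₁ := by
      have hN' : (p : PowerSeries (PowerSeries S)) ^ (N + 1) = (p : PowerSeries (PowerSeries S)) ^ m *
          (p : PowerSeries (PowerSeries S)) ^ (1 + t + e) := by
        rw [← pow_add, hNe]
      have h1 : G₁ * h₀ = s₀ * (p : PowerSeries (PowerSeries S)) ^ m - verticalPrimeO S u₀ * r₁ := by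
        rw [hr₁]; ring
      rw [h1, hCP, hN', hv]; ring
    rw [hid, map_sub, map_mul, map_mul, map_pow, hmk,
      Ideal.Quotient.eq_zero_iff_mem.mpr (Ideal.mem_span_singleton_self _), zero_mul, sub_zero]
  -- H2: `q^t π̄^g (q^m v̄) ∈ ch_A(M)`
  have H2 : mk (p : PowerSeries (PowerSeries S)) ^ t * mk (verticalPrimeO S u₀) ^ g *
      (mk (p : PowerSeries (PowerSeries S)) ^ m * mk v) ∈
      Module.charIdeal (PowerSeries (PowerSeries S) ⧸ Ideal.span {π'}) (QuotSMulTop π' Y) := by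
    have h2 := Ideal.mul_mem_right (mk h₀) _ hmem
    have heq : mk ((p : PowerSeries (PowerSeries S)) ^ t * (verticalPrimeO S u₀ ^ g * G₁)) * mk h₀ =
        mk (p : PowerSeries (PowerSeries S)) ^ t * mk (verticalPrimeO S u₀) ^ g *
          (mk (p : PowerSeries (PowerSeries S)) ^ m * mk v) := by
      rw [← hGh]; simp only [map_mul, map_pow]; ring
    rw [hmk] at heq h2
    rw [hmk, ← heq]; exact h2
  have hN : t + m < N + 1 := by omega
  exact endgame_quant hcbar hcM (qbarS hu') (height_qbarS hu') (natCast_mem_qbarS (p := p) hu') hq0 hπ0 hπr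
    hv𝔔 hgk hN hlen H2

end LamS

/-! ### E9.7 Flat base change `Λ₂ → Λ_{2,S}` (free on `C C bⱼ`) and the dévissage inequality
`ℓ_{𝔓'}(Λ_{2,S}/C P) · ℓ_𝔓(N) ≤ ℓ_{𝔓'}(Λ_{2,S} ⊗_{Λ₂} N)` -/

section DoorS

variable {p : ℕ} [Fact p.Prime]

/-- `Λ_{2,S}` as a `Λ₂`-algebra by coefficient extension — the `letI` structure of `PatchingBeta` /
`FibreBoundOver` (a local instance for §E9.7–E9.9). -/
@[reducible] noncomputable def algS (p : ℕ) [Fact p.Prime] (S : Type) [CommRing S] [Algebra ℤ_[p] S] :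
    Algebra (IwasawaAlgebra₂ p) (PowerSeries (PowerSeries S)) :=
  (PowerSeries.map (PowerSeries.map (algebraMap ℤ_[p] S))).toAlgebra

attribute [local instance] algS

section BaseChange

variable (S : Type) [CommRing S] [IsDomain S] [IsDiscreteValuationRing S]
  [IsAdicComplete (IsLocalRing.maximalIdeal S) S] [CharZero S] [Algebra ℤ_[p] S] [Module.Finite ℤ_[p] S]

theorem algebraMap_S (r : IwasawaAlgebra₂ p) :
    algebraMap (IwasawaAlgebra₂ p) (PowerSeries (PowerSeries S)) r =
      PowerSeries.map (PowerSeries.map (algebraMap ℤ_[p] S)) r := rfl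

theorem coeff_coeff_algebraMap (r : IwasawaAlgebra₂ p) (i k : ℕ) :
    PowerSeries.coeff k (PowerSeries.coeff i (algebraMap (IwasawaAlgebra₂ p) (PowerSeries (PowerSeries S)) r)) =
      algebraMap ℤ_[p] S (PowerSeries.coeff k (PowerSeries.coeff i r)) := by
  rw [algebraMap_S, PowerSeries.coeff_map, PowerSeries.coeff_map]

theorem algebraMap_injective₂ :
    Function.Injective (algebraMap (IwasawaAlgebra₂ p) (PowerSeries (PowerSeries S))) := by
  intro a b h
  ext i k
  apply algebraMap_injectiveS S
  rw [← coeff_coeff_algebraMap, ← coeff_coeff_algebraMap, h]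

theorem algebraMap_ne_zero₂ {r : IwasawaAlgebra₂ p} (hr : r ≠ 0) :
    algebraMap (IwasawaAlgebra₂ p) (PowerSeries (PowerSeries S)) r ≠ 0 :=
  fun h => hr (algebraMap_injective₂ S (by rw [h, map_zero]))

/-- `r • C (C s)` coefficientwise. -/
theorem coeff_coeff_smul_CC (r : IwasawaAlgebra₂ p) (s : S) (i k : ℕ) :
    PowerSeries.coeff k (PowerSeries.coeff i
        (r • (PowerSeries.C (PowerSeries.C s) : PowerSeries (PowerSeries S)))) =
      PowerSeries.coeff k (PowerSeries.coeff i r) • s := by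
  rw [Algebra.smul_def, algebraMap_S, PowerSeries.coeff_mul_C, PowerSeries.coeff_map, PowerSeries.coeff_mul_C,
    PowerSeries.coeff_map, Algebra.smul_def]

/-- **`Λ_{2,S}` is free of finite rank over `Λ₂`** (on `C C bⱼ` for a `ℤ_p`-basis `bⱼ` of the finite
torsion-free, hence free, `ℤ_p`-module `S`). -/
theorem exists_linearEquiv_pi :
    ∃ n : ℕ, Nonempty (PowerSeries (PowerSeries S) ≃ₗ[IwasawaAlgebra₂ p] (Fin n → IwasawaAlgebra₂ p)) := by
  classical
  haveI : Module.IsTorsionFree ℤ_[p] S := Module.isTorsionFree_iff_smul_eq_zero.mpr fun r m h => by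
    rw [Algebra.smul_def, mul_eq_zero] at h
    exact h.imp_left fun h0 => algebraMap_injectiveS S (by rw [h0, map_zero])
  haveI : Module.Free ℤ_[p] S := Module.free_of_finite_type_torsion_free'
  let b := Module.finBasis ℤ_[p] S
  refine ⟨Module.finrank ℤ_[p] S, ⟨?_⟩⟩
  let Φ : (Fin (Module.finrank ℤ_[p] S) → IwasawaAlgebra₂ p) →ₗ[IwasawaAlgebra₂ p]
      PowerSeries (PowerSeries S) :=
    { toFun := fun f => ∑ j, f j • (PowerSeries.C (PowerSeries.C (b j)) : PowerSeries (PowerSeries S))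
      map_add' := fun f g => by
        simp only [Pi.add_apply, add_smul, Finset.sum_add_distrib]
      map_smul' := fun r f => by
        simp only [Pi.smul_apply, smul_eq_mul, mul_smul, Finset.smul_sum, RingHom.id_apply] }
  have hΦ : ∀ f i k, PowerSeries.coeff k (PowerSeries.coeff i (Φ f)) =
      b.equivFun.symm (fun j => PowerSeries.coeff k (PowerSeries.coeff i (f j))) := by
    intro f i k
    rw [b.equivFun_symm_apply]
    show PowerSeries.coeff k (PowerSeries.coeff i
      (∑ j, f j • (PowerSeries.C (PowerSeries.C (b j)) : PowerSeries (PowerSeries S)))) = _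
    rw [map_sum, map_sum]
    exact Finset.sum_congr rfl fun j _ => coeff_coeff_smul_CC S (f j) (b j) i k
  have hinj : Function.Injective Φ := by
    intro f g h
    funext j
    ext i k
    have h1 := congrArg (fun F => b.equivFun (PowerSeries.coeff k (PowerSeries.coeff i F))) h
    simp only [hΦ, LinearEquiv.apply_symm_apply] at h1
    exact congrFun h1 j
  have hsurj : Function.Surjective Φ := by
    intro F
    refine ⟨fun j => PowerSeries.mk fun i => PowerSeries.mk fun k =>
      b.equivFun (PowerSeries.coeff k (PowerSeries.coeff i F)) j, ?_⟩
    ext i k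
    rw [hΦ]
    simp only [PowerSeries.coeff_mk]
    exact b.equivFun.symm_apply_apply _
  exact (LinearEquiv.ofBijective Φ ⟨hinj, hsurj⟩).symm

/-- Hence `Λ_{2,S}` is flat over `Λ₂`. -/
theorem flatS : Module.Flat (IwasawaAlgebra₂ p) (PowerSeries (PowerSeries S)) := by
  obtain ⟨n, ⟨e⟩⟩ := exists_linearEquiv_pi (p := p) S
  exact Module.Flat.of_linearEquiv e

/-- **Length under the flat base change**: `ℓ_{𝔓'}(Λ_{2,S}/C P) · ℓ_{(C P)}(N) ≤ ℓ_{𝔓'}(Λ_{2,S} ⊗_{Λ₂} N)`. -/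
theorem lengthAt_baseChange_ge (P : GoodPrime p) (𝔓' : PrimeSpectrum (PowerSeries (PowerSeries S)))
    (N : Type) [AddCommGroup N] [Module (IwasawaAlgebra₂ p) N] [hN : Module.Finite (IwasawaAlgebra₂ p) N]
    {c : IwasawaAlgebra₂ p} (hc : c ≠ 0) (hcN : ∀ x : N, c • x = 0) :
    Module.lengthAt (PowerSeries (PowerSeries S))
        (PowerSeries (PowerSeries S) ⧸ Ideal.span
          {algebraMap (IwasawaAlgebra₂ p) (PowerSeries (PowerSeries S)) (PowerSeries.C P.P)}) 𝔓' *
      Module.lengthAt (IwasawaAlgebra₂ p) N P.pt ≤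
    Module.lengthAt (PowerSeries (PowerSeries S)) ((PowerSeries (PowerSeries S)) ⊗[IwasawaAlgebra₂ p] N) 𝔓' := by
  classical
  haveI := flatS (p := p) S
  revert hcN
  induction hN using IsNoetherianRing.induction_on_isQuotientEquivQuotientPrime (IwasawaAlgebra₂ p) with
  | subsingleton N =>
    intro _
    rw [Module.lengthAt_eq_zero_of_subsingleton (R := IwasawaAlgebra₂ p) (M := N), mul_zero]
    exact bot_le
  | quotient N 𝔮 e =>
    intro hcN
    have hc𝔮 : c ∈ 𝔮.asIdeal := LB.mem_of_equiv_quotient e hcN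
    by_cases h𝔮 : 𝔮 = P.pt
    · subst h𝔮
      rw [Module.lengthAt_eq_of_linearEquiv e, Module.lengthAt_quotient_self, mul_one]
      have hmap : Ideal.span {algebraMap (IwasawaAlgebra₂ p) (PowerSeries (PowerSeries S)) (PowerSeries.C P.P)} =
          P.pt.asIdeal.map (algebraMap (IwasawaAlgebra₂ p) (PowerSeries (PowerSeries S))) := by
        rw [GoodPrime.pt_asIdeal, Ideal.map_span, Set.image_singleton]
      have e' := ((Ideal.quotientEquivAlgOfEq (PowerSeries (PowerSeries S)) hmap).trans
        (Algebra.TensorProduct.quotIdealMapEquivTensorQuot (PowerSeries (PowerSeries S))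
          P.pt.asIdeal)).toLinearEquiv
      exact (Module.lengthAt_eq_of_linearEquiv
        (e'.trans (LinearEquiv.baseChange (IwasawaAlgebra₂ p) (PowerSeries (PowerSeries S)) _ _ e).symm) 𝔓').le
    · have hne : ¬ 𝔮.asIdeal ≤ P.pt.asIdeal := by
        intro hle
        have h0 : 𝔮.asIdeal ≠ ⊥ := by
          intro h
          rw [h, Ideal.mem_bot] at hc𝔮
          exact hc hc𝔮
        have h1 : P.pt.asIdeal.height ≤ 𝔮.asIdeal.height := by
          rw [GoodPrime.height_pt, Order.one_le_iff_ne_zero, Ne, Ideal.height_eq_zero_iff_eq_bot]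
          exact h0
        exact h𝔮 (PrimeSpectrum.ext (Ideal.eq_of_le_of_height_le (I := 𝔮.asIdeal) (J := P.pt.asIdeal) hle h1))
      rw [Module.lengthAt_eq_of_linearEquiv e, Module.lengthAt_quotient_eq_zero_of_not_le hne, mul_zero]
      exact bot_le
  | exact N₁ N₂ N₃ f g hf hg hfg ih₁ ih₃ =>
    intro hcN₂
    have hcN₁ : ∀ x : N₁, c • x = 0 := fun x => hf (by rw [map_smul, hcN₂, map_zero])
    have hcN₃ : ∀ x : N₃, c • x = 0 := fun x => by
      obtain ⟨y, rfl⟩ := hg x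
      rw [← map_smul, hcN₂, map_zero]
    have hf' : Function.Injective (f.baseChange (PowerSeries (PowerSeries S))) := by
      rw [LinearMap.baseChange_eq_ltensor]
      exact Module.Flat.lTensor_preserves_injective_linearMap f hf
    have hg' : Function.Surjective (g.baseChange (PowerSeries (PowerSeries S))) := by
      rw [LinearMap.baseChange_eq_ltensor]
      exact LinearMap.lTensor_surjective _ hg
    have hfg' : Function.Exact (f.baseChange (PowerSeries (PowerSeries S)))
        (g.baseChange (PowerSeries (PowerSeries S))) := by
      rw [LinearMap.baseChange_eq_ltensor, LinearMap.baseChange_eq_ltensor]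
      exact lTensor_exact _ hfg hg
    rw [Module.lengthAt_eq_add_of_exact f g hf hg hfg P.pt,
      Module.lengthAt_eq_add_of_exact _ _ hf' hg' hfg' 𝔓', mul_add]
    exact add_le_add (ih₁ hcN₁) (ih₃ hcN₃)

/-! ### E9.8 Descent `Λ_{2,S} → Λ₂` at a root `u₀ ∈ 𝔪_S` of `P`: (K) `a(u₀) = 0 ⟹ P ∣ a` (heights in `Λ₁`),
(D1) `π_{u₀} ∣ H ⟹ C P ∣ H`, (D) `m'k ≤ k_S ≤ m'g` ⟹ `(C P)^k ∣ G` in `Λ₂` -/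

variable {S}

/-- (K) **Kernel of evaluation at a root.** -/
theorem dvd_of_evS_eq_zero (P : GoodPrime p) {u₀ : S} (hu₀ : u₀ ∈ IsLocalRing.maximalIdeal S)
    (hroot : evS hu₀ (PowerSeries.map (algebraMap ℤ_[p] S) P.P) = 0) {a : IwasawaAlgebra p}
    (ha : evS hu₀ (PowerSeries.map (algebraMap ℤ_[p] S) a) = 0) : P.P ∣ a := by
  classical
  by_contra hPa
  let φ : IwasawaAlgebra p →+* S := (evS hu₀).comp (PowerSeries.map (algebraMap ℤ_[p] S))
  haveI hI : (RingHom.ker φ).IsPrime := RingHom.ker_isPrime φ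
  haveI : (Ideal.span {P.P}).IsPrime := (Ideal.span_singleton_prime P.prime.ne_zero).mpr P.prime
  have hlt : Ideal.span {P.P} < RingHom.ker φ := by
    refine lt_of_le_of_ne ?_ fun h => hPa ?_
    · rw [Ideal.span_le, Set.singleton_subset_iff, SetLike.mem_coe, RingHom.mem_ker]
      exact hroot
    · have ha' : a ∈ RingHom.ker φ := ha
      rw [← h, Ideal.mem_span_singleton] at ha'
      exact ha'
  have h2 := two_le_height_of_span_lt (mem_nonZeroDivisors_of_ne_zero P.prime.ne_zero) hlt
  have hm : (IsLocalRing.maximalIdeal (IwasawaAlgebra p)).height = 2 := by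
    have h : ((IsLocalRing.maximalIdeal (IwasawaAlgebra p)).height : WithBot ℕ∞) =
        ((2 : ℕ∞) : WithBot ℕ∞) := by
      rw [IsLocalRing.maximalIdeal_height_eq_ringKrullDim]
      exact IwasawaAlgebra.ringKrullDim_eq_two p
    exact_mod_cast h
  have heq : RingHom.ker φ = IsLocalRing.maximalIdeal (IwasawaAlgebra p) :=
    Ideal.eq_of_le_of_height_le (I := RingHom.ker φ) (J := IsLocalRing.maximalIdeal (IwasawaAlgebra p))
      (IsLocalRing.le_maximalIdeal hI.ne_top) (by rw [hm]; exact h2)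
  have hp : (p : IwasawaAlgebra p) ∈ RingHom.ker φ := by
    rw [heq]
    exact GoodPrime.not_isUnit_p
  rw [RingHom.mem_ker, map_natCast] at hp
  exact natCast_p_ne_zeroS S hp

/-- (D1) `π_{u₀} ∣ H` in `Λ_{2,S}` for `H ∈ Λ₂` ⟹ `C P ∣ H` in `Λ₂`. -/
theorem C_dvd_of_verticalPrimeO_dvd (P : GoodPrime p) {u₀ : S} (hu₀ : u₀ ∈ IsLocalRing.maximalIdeal S)
    (hroot : evS hu₀ (PowerSeries.map (algebraMap ℤ_[p] S) P.P) = 0) {H : IwasawaAlgebra₂ p}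
    (h : verticalPrimeO S u₀ ∣ algebraMap (IwasawaAlgebra₂ p) (PowerSeries (PowerSeries S)) H) :
    (PowerSeries.C P.P : IwasawaAlgebra₂ p) ∣ H := by
  refine C_dvd_of_forall_dvd_coeff fun n => dvd_of_evS_eq_zero P hu₀ hroot ?_
  rw [evS_eq_zero_iff]
  have h1 := dvd_coeff_of_C_dvd h n
  rwa [algebraMap_S, PowerSeries.coeff_map] at h1

/-- **(D) Descent**: `verticalS_dvd` for `Λ_{2,S} ⊗ X` at a root `u₀` gives `(C P)^{ℓ_𝔓(X)} ∣ G` in `Λ₂`. -/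
theorem GoodPrime.C_pow_dvd_of_root (P : GoodPrime p) (X : Type) [AddCommGroup X]
    [Module (IwasawaAlgebra₂ p) X] [Module.Finite (IwasawaAlgebra₂ p) X] (G : IwasawaAlgebra₂ p)
    {c : IwasawaAlgebra₂ p} (hc0 : c ≠ 0) (hcX : ∀ x : X, c • x = 0)
    {u₀ : S} (hu₀ : u₀ ∈ IsLocalRing.maximalIdeal S)
    (hroot : evS hu₀ (PowerSeries.map (algebraMap ℤ_[p] S) P.P) = 0) (N₀ t₀ : ℕ)
    (hbd : ∀ N, N₀ ≤ N → ∃ t, t ≤ t₀ ∧ FibreBoundOver p S X G (u₀ + (p : S) ^ (N + 1)) t) :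
    (PowerSeries.C P.P : IwasawaAlgebra₂ p) ^ (Module.lengthAt (IwasawaAlgebra₂ p) X P.pt).toNat ∣ G := by
  classical
  have hπ : Prime (verticalPrimeO S u₀) := prime_verticalPrimeO hu₀
  -- `c_S` kills `Y = Λ_{2,S} ⊗ X`
  have hcS0 : algebraMap (IwasawaAlgebra₂ p) (PowerSeries (PowerSeries S)) c ≠ 0 := algebraMap_ne_zero₂ S hc0
  have hcY : ∀ y : (PowerSeries (PowerSeries S)) ⊗[IwasawaAlgebra₂ p] X,
      algebraMap (IwasawaAlgebra₂ p) (PowerSeries (PowerSeries S)) c • y = 0 := by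
    intro y
    induction y using TensorProduct.induction_on with
    | zero => rw [smul_zero]
    | tmul a x =>
      rw [TensorProduct.smul_tmul', smul_eq_mul, ← Algebra.smul_def, TensorProduct.smul_tmul, hcX,
        TensorProduct.tmul_zero]
    | add y z hy hz => rw [smul_add, hy, hz, add_zero]
  -- the vertical theorem over `Λ_{2,S}`
  have hv := verticalS_dvd (p := p) hu₀ ((PowerSeries (PowerSeries S)) ⊗[IwasawaAlgebra₂ p] X) hcS0 hcY
    (algebraMap (IwasawaAlgebra₂ p) (PowerSeries (PowerSeries S)) G) N₀ t₀
    (fun N hN => by obtain ⟨t, ht, hF⟩ := hbd N hN; exact ⟨t, ht, hF⟩)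
  -- `algebraMap (C P) = π^{m'} · w`, `π ∤ w`, `m' ≥ 1`
  have hCP0 : algebraMap (IwasawaAlgebra₂ p) (PowerSeries (PowerSeries S)) (PowerSeries.C P.P) ≠ 0 :=
    algebraMap_ne_zero₂ S P.C_ne_zero
  obtain ⟨m', w, hw, hfac⟩ := WfDvdMonoid.max_power_factor hCP0 hπ.irreducible
  have hπCP : verticalPrimeO S u₀ ∣
      algebraMap (IwasawaAlgebra₂ p) (PowerSeries (PowerSeries S)) (PowerSeries.C P.P) := by
    rw [algebraMap_S, PowerSeries.map_C]
    exact map_dvd PowerSeries.C ((evS_eq_zero_iff hu₀ _).mp hroot)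
  have hm' : 0 < m' := by
    rcases Nat.eq_zero_or_pos m' with h0 | h0
    · rw [hfac, h0, pow_zero, one_mul] at hπCP; exact absurd hπCP hw
    · exact h0
  by_cases hG0 : G = 0
  · rw [hG0]; exact dvd_zero _
  obtain ⟨g, G₁, hG₁, hGfac⟩ := WfDvdMonoid.max_power_factor hG0 P.prime_C.irreducible
  -- (D3) `k_S ≤ m' g`
  have hndvd : ¬ verticalPrimeO S u₀ ∣
      w ^ g * algebraMap (IwasawaAlgebra₂ p) (PowerSeries (PowerSeries S)) G₁ := by
    intro h
    rcases hπ.dvd_or_dvd h with h1 | h1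
    · exact hw (hπ.dvd_of_dvd_pow h1)
    · exact hG₁ (C_dvd_of_verticalPrimeO_dvd P hu₀ hroot h1)
  have h3 : (Module.lengthAt (PowerSeries (PowerSeries S))
      ((PowerSeries (PowerSeries S)) ⊗[IwasawaAlgebra₂ p] X) (ptS hu₀)).toNat ≤ m' * g := by
    have heq : algebraMap (IwasawaAlgebra₂ p) (PowerSeries (PowerSeries S)) G =
        verticalPrimeO S u₀ ^ (m' * g) *
          (w ^ g * algebraMap (IwasawaAlgebra₂ p) (PowerSeries (PowerSeries S)) G₁) := by
      rw [hGfac, map_mul, map_pow, hfac, mul_pow, ← pow_mul, mul_assoc]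
    rw [heq] at hv
    exact (pow_dvd_pow_iff hπ.ne_zero hπ.not_unit).mp (hπ.pow_dvd_of_dvd_mul_right _ hndvd hv)
  -- (D4) `m' k ≤ k_S`
  have hmS : Module.lengthAt (PowerSeries (PowerSeries S))
      (PowerSeries (PowerSeries S) ⧸ Ideal.span
        {algebraMap (IwasawaAlgebra₂ p) (PowerSeries (PowerSeries S)) (PowerSeries.C P.P)}) (ptS hu₀) = m' := by
    rw [Module.lengthAt_eq_of_linearEquiv (Ideal.quotientEquivAlgOfEq (PowerSeries (PowerSeries S))
      (show Ideal.span {algebraMap (IwasawaAlgebra₂ p) (PowerSeries (PowerSeries S)) (PowerSeries.C P.P)} =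
        Ideal.span {verticalPrimeO S u₀ ^ m' * w} by rw [hfac])).toLinearEquiv]
    exact Module.lengthAt_quotient_span_singleton_pow_mul hπ m' hw (ptS hu₀) (ptS_asIdeal hu₀)
  have hdev := lengthAt_baseChange_ge S P (ptS hu₀) X hc0 hcX
  rw [hmS] at hdev
  have hXfin : Module.lengthAt (IwasawaAlgebra₂ p) X P.pt ≠ ⊤ :=
    Module.lengthAt_ne_top_of_isTorsionBy hc0 hcX P.pt (by rw [GoodPrime.height_pt])
  have hYfin : Module.lengthAt (PowerSeries (PowerSeries S))
      ((PowerSeries (PowerSeries S)) ⊗[IwasawaAlgebra₂ p] X) (ptS hu₀) ≠ ⊤ :=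
    Module.lengthAt_ne_top_of_isTorsionBy hcS0 hcY (ptS hu₀) (by rw [height_ptS])
  have h4 : m' * (Module.lengthAt (IwasawaAlgebra₂ p) X P.pt).toNat ≤
      (Module.lengthAt (PowerSeries (PowerSeries S))
        ((PowerSeries (PowerSeries S)) ⊗[IwasawaAlgebra₂ p] X) (ptS hu₀)).toNat := by
    rw [← ENat.coe_toNat hXfin, ← ENat.coe_toNat hYfin] at hdev
    exact_mod_cast hdev
  -- (D5) `k ≤ g`
  have hkg : (Module.lengthAt (IwasawaAlgebra₂ p) X P.pt).toNat ≤ g := Nat.le_of_mul_le_mul_left (h4.trans h3) hm'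
  rw [hGfac]
  exact (pow_dvd_pow _ hkg).mul_right _

/-! ### E9.9 The binder over the DVR class and the second door -/

variable (p) in
/-- **(Q1-S) fibre bounds over the DVR class, depth currency**: ONE `F` and ONE `z ≠ 0` such that at every
point `u ∈ 𝔪_S` (any complete DVR `S` finite over `ℤ_p`) off the zeros of `z` the fibre class of `Λ_{2,S} ⊗ X`
at `T₂ = u` has exponent `≤ F(#(S/u), rk S)` (shape of CGLS20 Thm 3.2.1's error term). -/
def DepthFibreBoundsDVR (X : Type) [AddCommGroup X] [Module (IwasawaAlgebra₂ p) X] (G : IwasawaAlgebra₂ p) :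
    Prop :=
  ∃ (F : ℕ → ℕ → ℕ) (z : Polynomial ℤ_[p]), z ≠ 0 ∧
    ∀ (S : Type) [CommRing S] [IsDomain S] [IsDiscreteValuationRing S]
      [IsAdicComplete (IsLocalRing.maximalIdeal S) S] [CharZero S] [Algebra ℤ_[p] S] [Module.Finite ℤ_[p] S]
      (u : S), u ∈ IsLocalRing.maximalIdeal S → Polynomial.aeval u z ≠ 0 →
      ∃ t : ℕ, t ≤ F (Nat.card (S ⧸ Ideal.span {u})) (Module.finrank ℤ_[p] S) ∧ FibreBoundOver p S X G u t

variable (p) in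
/-- **Root datum** of a good prime `P`: a complete DVR `S`, finite over `ℤ_p`, with a root `u₀ ∈ 𝔪_S` of `P`
(constructed for every `P` in §E10, `rootDatumS`). -/
def RootDatumS (P : GoodPrime p) : Prop :=
  ∃ (S : Type) (_ : CommRing S) (_ : IsDomain S) (_ : IsDiscreteValuationRing S)
    (_ : IsAdicComplete (IsLocalRing.maximalIdeal S) S) (_ : CharZero S) (_ : Algebra ℤ_[p] S)
    (_ : Module.Finite ℤ_[p] S) (u₀ : S) (hu₀ : u₀ ∈ IsLocalRing.maximalIdeal S),
    evS hu₀ (PowerSeries.map (algebraMap ℤ_[p] S) P.P) = 0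

/-- `engine` with the per-prime vertical input in the form the proof USES (fibre torsion, or the divisibility
`(C P)^{ℓ_𝔓(X)} ∣ G`), so that (FT)/(LB)/`VFamily` are not hypotheses. -/
theorem engine_of_dvd (X : Type) [AddCommGroup X] [Module (IwasawaAlgebra₂ p) X]
    [Module.Finite (IwasawaAlgebra₂ p) X] (G : IwasawaAlgebra₂ p)
    (hPT : PatchingTarget p X G) (hPB : PatchingBeta p X G)
    (hT : Module.IsTorsion (IwasawaAlgebra₂ p) X)
    (hnv : ∃ z : Polynomial ℤ_[p], z ≠ 0 ∧
      ∀ (O : Type) [CommRing O] [IsDomain O] [CharZero O] [Algebra ℤ_[p] O] [Module.Finite ℤ_[p] O]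
        (u : O), u ∈ nonunits O → Polynomial.aeval u z ≠ 0 →
        letI : Algebra (IwasawaAlgebra₂ p) (PowerSeries (PowerSeries O)) :=
          (PowerSeries.map (PowerSeries.map (algebraMap ℤ_[p] O))).toAlgebra
        ∃ t : ℕ, FibreBoundAt O p ((PowerSeries (PowerSeries O)) ⊗[IwasawaAlgebra₂ p] X)
          (PowerSeries.map (PowerSeries.map (algebraMap ℤ_[p] O)) G) u t)
    (hv : ∀ P : GoodPrime p, FibreTorsionAt p P X ∨
      (PowerSeries.C P.P : IwasawaAlgebra₂ p) ^ (Module.lengthAt (IwasawaAlgebra₂ p) X P.pt).toNat ∣ G) :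
    ∃ a : ℕ, Ideal.span {(p : IwasawaAlgebra₂ p) ^ a * G} ≤
      Literature.NumberTheory.EllipticCurves.Module.charIdeal (IwasawaAlgebra₂ p) X := by
  classical
  refine hPT hT fun 𝔓 hht hp𝔓 => ?_
  by_cases hvert : Ideal.comap (PowerSeries.C (R := IwasawaAlgebra p)) 𝔓.asIdeal = ⊥
  · exact hPB hT hnv 𝔓 hht hvert
  obtain ⟨P, rfl⟩ := exists_goodPrime_of_comap_ne_bot 𝔓 hht hp𝔓 hvert
  have goal_of : ∀ {k : ℕ} {H : IwasawaAlgebra₂ p}, (PowerSeries.C P.P : IwasawaAlgebra₂ p) ^ k ∣ H →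
      P.pt.asIdeal ^ k ∣ Ideal.span {H} := fun {k H} ⟨K, hK⟩ =>
    ⟨Ideal.span {K}, by
      rw [hK, GoodPrime.pt_asIdeal, Ideal.span_singleton_pow, Ideal.span_singleton_mul_span_singleton]⟩
  rcases hv P with ⟨s, hs, hsX⟩ | hdvd
  · have h0 : Module.lengthAt (IwasawaAlgebra₂ p) X P.pt = 0 :=
      lengthAt_eq_zero_of_fibre_torsion (M := X) P.prime_C hs hsX
    rw [h0]
    simp
  · exact goal_of hdvd

/-- **THE SECOND DOOR (N4, PROVED algebra)**: `PatchingTarget` + `PatchingBeta` + non-vertical fibre bounds +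
Kato-line torsion + a root datum per good prime `P ≁ T₂` + `DepthFibreBoundsDVR` ⟹ `(p^a · G) ⊆ ch_{Λ₂}(X)`
(no twists / (UNIF) / `VFamily` / (FT) / (LB) hypotheses; see `engine_doorS'` for the root-free form). -/
theorem engine_doorS (X : Type) [AddCommGroup X] [Module (IwasawaAlgebra₂ p) X]
    [Module.Finite (IwasawaAlgebra₂ p) X] (G : IwasawaAlgebra₂ p)
    (hPT : PatchingTarget p X G) (hPB : PatchingBeta p X G)
    (hnv : ∃ z : Polynomial ℤ_[p], z ≠ 0 ∧
      ∀ (O : Type) [CommRing O] [IsDomain O] [CharZero O] [Algebra ℤ_[p] O] [Module.Finite ℤ_[p] O]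
        (u : O), u ∈ nonunits O → Polynomial.aeval u z ≠ 0 →
        letI : Algebra (IwasawaAlgebra₂ p) (PowerSeries (PowerSeries O)) :=
          (PowerSeries.map (PowerSeries.map (algebraMap ℤ_[p] O))).toAlgebra
        ∃ t : ℕ, FibreBoundAt O p ((PowerSeries (PowerSeries O)) ⊗[IwasawaAlgebra₂ p] X)
          (PowerSeries.map (PowerSeries.map (algebraMap ℤ_[p] O)) G) u t)
    (hKato : Module.IsTorsion
      (IwasawaAlgebra₂ p ⧸ Ideal.span {(PowerSeries.C PowerSeries.X : IwasawaAlgebra₂ p)})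
      (QuotSMulTop (PowerSeries.C PowerSeries.X : IwasawaAlgebra₂ p) X))
    (hroot : ∀ P : GoodPrime p, ¬ Associated P.P PowerSeries.X → RootDatumS p P)
    (hQ1 : DepthFibreBoundsDVR p X G) :
    ∃ a : ℕ, Ideal.span {(p : IwasawaAlgebra₂ p) ^ a * G} ≤
      Literature.NumberTheory.EllipticCurves.Module.charIdeal (IwasawaAlgebra₂ p) X := by
  classical
  have hFTk := fibreTorsionAt_of_isTorsion (katoLine p) X hKato
  have hT : Module.IsTorsion (IwasawaAlgebra₂ p) X := isTorsion_of_fibreTorsionAt' (katoLine p) X hFTk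
  refine engine_of_dvd X G hPT hPB hT hnv fun P => ?_
  by_cases hPX : Associated P.P PowerSeries.X
  · exact Or.inl (fibreTorsionAt_of_associated (katoLine p) P hPX.symm X hFTk)
  right
  obtain ⟨c, hc, hc0⟩ := Submodule.exists_mem_ne_zero_of_ne_bot (Module.annihilator_ne_bot_of_isTorsion X hT)
  have hcX : ∀ x : X, c • x = 0 := fun x => Module.mem_annihilator.mp hc x
  obtain ⟨S, _, _, _, _, _, _, _, u₀, hu₀, hr⟩ := hroot P hPX
  obtain ⟨F, z, hz, hF⟩ := hQ1
  -- `u₀ ≠ 0` (else `T₂ ∣ P`, i.e. `P ~ T₂`)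
  have hu0 : u₀ ≠ 0 := by
    intro h0
    apply hPX
    have h1 := (evS_eq_zero_iff hu₀ _).mp hr
    rw [h0, map_zero, sub_zero, PowerSeries.X_dvd_iff, ← PowerSeries.coeff_zero_eq_constantCoeff_apply,
      PowerSeries.coeff_map] at h1
    have h2 : PowerSeries.constantCoeff P.P = 0 := by
      rw [← PowerSeries.coeff_zero_eq_constantCoeff_apply]
      exact algebraMap_injectiveS S (by rw [h1, map_zero])
    exact (PowerSeries.X_prime.associated_of_dvd P.prime (PowerSeries.X_dvd_iff.mpr h2)).symm
  -- depth constancy along `u₀ + p^{N+1}` and the isolated zeros of `z`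
  obtain ⟨d, hd⟩ := exists_pow_p_mem_spanS (p := p) S hu0
  have hzS : ((z.map (algebraMap ℤ_[p] S) : Polynomial S) : PowerSeries S) ≠ 0 := by
    rw [Ne, Polynomial.coe_eq_zero_iff, Polynomial.map_eq_zero_iff (algebraMap_injectiveS S)]
    exact hz
  obtain ⟨N₁, hN₁⟩ := eventually_evS_ne_zero (p := p) hu₀ hzS
  refine GoodPrime.C_pow_dvd_of_root P X G hc0 hcX hu₀ hr (max d N₁)
    (F (Nat.card (S ⧸ Ideal.span {u₀})) (Module.finrank ℤ_[p] S)) fun N hN => ?_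
  have hspan : Ideal.span {u₀ + (p : S) ^ (N + 1)} = Ideal.span {u₀} := by
    have h := span_add_eqS S hd (Nat.succ_le_succ ((le_max_left _ _).trans hN)) (1 : S)
    rwa [mul_one] at h
  have hz' : Polynomial.aeval (u₀ + (p : S) ^ (N + 1)) z ≠ 0 := by
    rw [← Polynomial.eval_map_algebraMap, ← evS_coe (approx_mem (p := p) S hu₀ N)]
    exact hN₁ N ((le_max_right _ _).trans hN)
  obtain ⟨t, ht, hFB⟩ := hF S (u₀ + (p : S) ^ (N + 1)) (approx_mem (p := p) S hu₀ N) hz'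
  rw [hspan] at ht
  exact ⟨t, ht, hFB⟩

end BaseChange

end DoorS


/-! ## E10 (v1.4, g17) ROOT DATA EXIST — `hroot` of `engine_doorS` discharged

For a good prime `P` (`P = f · h`, `f` distinguished of degree `≥ 1`): `K` = a splitting field of `f` over `ℚ_p`
with the spectral norm (`spectralNorm.nontriviallyNormedField`, ultrametric), `S = O_K` its closed unit ball —
compact (`FiniteDimensional.proper`) ⟹ DVR (`Valued.integer.isDiscreteValuationRing_of_compactSpace`), `𝔪`-adically
complete (closed ideals + Cantor intersection, as in Mathlib's `IsNonarchimedeanLocalField` instance), module-finite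
over `ℤ_p` (continuous coordinates ⟹ `p^k · O_K ↪ ℤ_p^n`), characteristic `0`; a root `α` of `f` has `‖α‖ < 1`
(ultrametric inequality), so `u₀ = α ∈ 𝔪_S` and `P(u₀) = f(u₀) h(u₀) = 0`. Hence `rootDatumS` and **`engine_doorS'`**. -/

namespace RD

open scoped NNReal
section Generic

variable (p : ℕ) [Fact p.Prime]
variable (L : Type) [NontriviallyNormedField L] [IsUltrametricDist L] [NormedAlgebra ℚ_[p] L]
  [FiniteDimensional ℚ_[p] L]

/-- The closed unit ball of `L`, as a subring (valuation ring of the norm). -/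
noncomputable abbrev O : Subring L := (NormedField.valuation (K := L)).integer

omit [NormedAlgebra ℚ_[p] L] [FiniteDimensional ℚ_[p] L] in
theorem mem_O_iff (x : L) : x ∈ O L ↔ ‖x‖ ≤ 1 := by
  rw [Valuation.mem_integer_iff, NormedField.valuation_apply, ← NNReal.coe_le_coe, coe_nnnorm, NNReal.coe_one]

include p in
theorem properSpace' : ProperSpace L := FiniteDimensional.proper ℚ_[p] L

theorem norm_algebraMap_padic (x : ℚ_[p]) : ‖algebraMap ℚ_[p] L x‖ = ‖x‖ := norm_algebraMap' L x

/-- `ι : ℤ_p → O_L`. -/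
noncomputable def ι : ℤ_[p] →+* O L :=
  ((algebraMap ℚ_[p] L).comp (PadicInt.Coe.ringHom (p := p))).codRestrict (O L) (fun x => by
    rw [mem_O_iff]
    show ‖algebraMap ℚ_[p] L (x : ℚ_[p])‖ ≤ 1
    rw [norm_algebraMap_padic]
    exact PadicInt.norm_le_one x)

theorem ι_apply_coe (x : ℤ_[p]) : ((ι p L x : O L) : L) = algebraMap ℚ_[p] L (x : ℚ_[p]) := rfl

include p in
theorem isCompact_O : IsCompact (O L : Set L) := by
  haveI := properSpace' p L
  have h : (O L : Set L) = Metric.closedBall (0 : L) 1 := by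
    ext x
    simp only [SetLike.mem_coe, mem_O_iff, Metric.mem_closedBall, dist_zero_right]
  rw [h]
  exact isCompact_closedBall (0 : L) 1

include p in
theorem compactSpace_O : CompactSpace (O L) :=
  isCompact_iff_compactSpace.mp (isCompact_O p L)

theorem norm_p_lt_one : ‖algebraMap ℚ_[p] L (p : ℚ_[p])‖ < 1 := by
  rw [norm_algebraMap_padic, Padic.norm_p]
  have hp : (1 : ℝ) < p := by exact_mod_cast (Fact.out : p.Prime).one_lt
  exact inv_lt_one_of_one_lt₀ hp

theorem norm_p_ne_zero : ‖algebraMap ℚ_[p] L (p : ℚ_[p])‖ ≠ 0 := by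
  rw [norm_algebraMap_padic, Padic.norm_p]
  have hp : (0 : ℝ) < p := by exact_mod_cast (Fact.out : p.Prime).pos
  exact (inv_pos.mpr hp).ne'

include p in
/-- `O_L` is a DVR (compact valuation ring with a non-trivial valuation). -/
theorem isDVR : IsDiscreteValuationRing (O L) := by
  letI : Valued L ℝ≥0 := NormedField.toValued
  haveI : CompactSpace (Valued.integer L) := compactSpace_O p L
  haveI : (Valued.v : Valuation L ℝ≥0).IsNontrivial := by
    refine ⟨algebraMap ℚ_[p] L (p : ℚ_[p]), ?_, ?_⟩
    · show NormedField.valuation (algebraMap ℚ_[p] L (p : ℚ_[p])) ≠ 0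
      rw [ne_eq, NormedField.valuation_apply, ← NNReal.coe_eq_zero, coe_nnnorm]
      exact norm_p_ne_zero p L
    · show NormedField.valuation (algebraMap ℚ_[p] L (p : ℚ_[p])) ≠ 1
      rw [ne_eq, NormedField.valuation_apply, ← NNReal.coe_eq_one, coe_nnnorm]
      exact (norm_p_lt_one p L).ne
  exact Valued.integer.isDiscreteValuationRing_of_compactSpace

include p in
/-- `O_L` is `𝔪`-adically complete (compact + Noetherian: ideals are closed). -/
theorem isAdicComplete :
    haveI := isDVR p L
    IsAdicComplete (IsLocalRing.maximalIdeal (O L)) (O L) := by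
  haveI := isDVR p L
  haveI : CompactSpace (O L) := compactSpace_O p L
  exact
  { prec' := fun f hf => by
      open scoped Pointwise in
      let S : ℕ → Set (O L) := fun n =>
        f n +ᵥ ((IsLocalRing.maximalIdeal (O L) ^ n : Ideal (O L)) : Set (O L))
      have hS : ∀ n, S (n + 1) ⊆ S n := by
        intro n
        apply (Set.vadd_set_subset_vadd_set_iff.mpr (Ideal.pow_le_pow_right n.le_succ)).trans
        simpa [S] using (hf n.le_succ).symm
      have h : ∀ n, IsClosed (S n) := fun n =>
        (IsNoetherianRing.isClosed_ideal (IsLocalRing.maximalIdeal (O L) ^ n)).vadd (f n)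
      obtain ⟨x, hx⟩ := (h 0).isCompact.nonempty_iInter_of_sequence_nonempty_isCompact_isClosed S hS
        (fun n => by simp [S]) h
      refine ⟨x, fun n => ?_⟩
      obtain ⟨y, hy, rfl⟩ := Set.mem_iInter.mp hx n
      simpa [SModEq.sub_mem] using hy }

/-- The `ℤ_p`-algebra structure on `O_L` (restriction of `ℚ_p → L`). -/
@[reducible] noncomputable def algZp : Algebra ℤ_[p] (O L) := (ι p L).toAlgebra

include p in
theorem charZero_L : CharZero L := charZero_of_injective_algebraMap (algebraMap ℚ_[p] L).injective

include p in
theorem charZero_O : CharZero (O L) := by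
  haveI := charZero_L p L
  infer_instance

include p in
/-- `O_L` is module-finite over `ℤ_p`: bounded coordinates w.r.t. a `ℚ_p`-basis embed `O_L` into `ℤ_p^n`. -/
theorem moduleFinite_O : letI := algZp p L; Module.Finite ℤ_[p] (O L) := by
  letI := algZp p L
  haveI : CompleteSpace ℚ_[p] := inferInstance
  set n := Module.finrank ℚ_[p] L
  let b := Module.finBasis ℚ_[p] L
  let ℓ : Fin n → (L →L[ℚ_[p]] ℚ_[p]) := fun i => LinearMap.toContinuousLinearMap (b.coord i)
  have hℓ : ∀ i (x : L), ℓ i x = b.coord i x := fun i x => rfl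
  obtain ⟨C, hC0, hC⟩ : ∃ C : ℝ, 0 ≤ C ∧ ∀ i, ‖ℓ i‖ ≤ C :=
    ⟨∑ i, ‖ℓ i‖, Finset.sum_nonneg (fun i _ => norm_nonneg _),
      fun i => Finset.single_le_sum (fun j _ => norm_nonneg (ℓ j)) (Finset.mem_univ i)⟩
  have hp1 : (1 : ℝ) < p := by exact_mod_cast (Fact.out : p.Prime).one_lt
  obtain ⟨k, hk⟩ := pow_unbounded_of_one_lt C hp1
  -- the scaled coordinates of a point of `O_L` are `p`-adic integers
  have hint : ∀ (x : O L) (i : Fin n), ‖(p : ℚ_[p]) ^ k * b.coord i (x : L)‖ ≤ 1 := by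
    intro x i
    have hx : ‖(x : L)‖ ≤ 1 := (mem_O_iff L x).mp x.2
    have h1 : ‖b.coord i (x : L)‖ ≤ C := by
      rw [← hℓ]
      calc ‖ℓ i (x : L)‖ ≤ ‖ℓ i‖ * ‖(x : L)‖ := (ℓ i).le_opNorm _
        _ ≤ C * 1 := mul_le_mul (hC i) hx (norm_nonneg _) hC0
        _ = C := mul_one C
    rw [norm_mul, norm_pow, Padic.norm_p]
    have hpk : (0 : ℝ) < (p : ℝ) ^ k := pow_pos (by exact_mod_cast (Fact.out : p.Prime).pos) k
    rw [inv_pow, ← div_eq_inv_mul, div_le_one hpk]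
    exact h1.trans hk.le
  let φ : O L →ₗ[ℤ_[p]] (Fin n → ℤ_[p]) :=
    { toFun := fun x i => ⟨(p : ℚ_[p]) ^ k * b.coord i (x : L), hint x i⟩
      map_add' := fun x y => by
        funext i
        apply Subtype.ext
        show (p : ℚ_[p]) ^ k * b.coord i ((x : L) + (y : L)) =
          (p : ℚ_[p]) ^ k * b.coord i (x : L) + (p : ℚ_[p]) ^ k * b.coord i (y : L)
        rw [map_add, mul_add]
      map_smul' := fun r x => by
        funext i
        apply Subtype.ext
        have hrx : ((r • x : O L) : L) = (r : ℚ_[p]) • (x : L) := by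
          rw [Algebra.smul_def, Subring.coe_mul, Algebra.smul_def]
          rfl
        show (p : ℚ_[p]) ^ k * b.coord i ((r • x : O L) : L) =
          (r : ℚ_[p]) * ((p : ℚ_[p]) ^ k * b.coord i (x : L))
        rw [hrx, map_smul, smul_eq_mul]
        ring }
  have hφ : Function.Injective φ := by
    intro x y hxy
    apply Subtype.ext
    rw [b.ext_elem_iff]
    intro i
    have h := congrArg (fun v : Fin n → ℤ_[p] => ((v i : ℤ_[p]) : ℚ_[p])) hxy
    simp only [φ, LinearMap.coe_mk, AddHom.coe_mk] at h
    have hpk : ((p : ℚ_[p]) ^ k) ≠ 0 := pow_ne_zero _ (by exact_mod_cast (Fact.out : p.Prime).ne_zero)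
    exact mul_left_cancel₀ hpk h
  exact Module.Finite.of_injective φ hφ

/-- `j : ℤ_p → L`. -/
noncomputable def j : ℤ_[p] →+* L := (algebraMap ℚ_[p] L).comp (PadicInt.Coe.ringHom (p := p))

theorem norm_j (a : ℤ_[p]) : ‖j p L a‖ = ‖a‖ := by
  show ‖algebraMap ℚ_[p] L (a : ℚ_[p])‖ = ‖a‖
  rw [norm_algebraMap_padic]
  rfl

theorem subtype_comp_ι : (O L).subtype.comp (ι p L) = j p L := RingHom.ext (fun _ => rfl)

include p in
/-- A root in `L` of a distinguished polynomial over `ℤ_p` of positive degree has norm `< 1`. -/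
theorem norm_lt_one_of_root (f : Polynomial ℤ_[p])
    (hf : f.IsDistinguishedAt (IsLocalRing.maximalIdeal ℤ_[p])) (hdeg : 0 < f.natDegree) (α : L)
    (hα : f.eval₂ (j p L) α = 0) : ‖α‖ < 1 := by
  by_contra h
  rw [not_lt] at h
  set m := f.natDegree with hm
  have hαm : 0 < ‖α‖ ^ m := pow_pos (lt_of_lt_of_le one_pos h) m
  rw [Polynomial.eval₂_eq_sum_range, Finset.sum_range_succ, hf.monic.coeff_natDegree, map_one, one_mul]
    at hα
  have hsum : α ^ m = -(∑ i ∈ Finset.range m, j p L (f.coeff i) * α ^ i) :=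
    eq_neg_of_add_eq_zero_right hα
  have hne : (Finset.range m).Nonempty := Finset.nonempty_range_iff.mpr hdeg.ne'
  obtain ⟨i, hi, hle⟩ := IsUltrametricDist.exists_norm_finsetSum_le_of_nonempty hne
    (fun i => j p L (f.coeff i) * α ^ i)
  rw [Finset.mem_range] at hi
  have hai : ‖f.coeff i‖ < 1 := PadicInt.mem_nonunits.mp (hf.mem hi)
  have hterm : ‖j p L (f.coeff i) * α ^ i‖ < ‖α‖ ^ m := by
    rw [norm_mul, norm_pow, norm_j]
    calc ‖f.coeff i‖ * ‖α‖ ^ i ≤ ‖f.coeff i‖ * ‖α‖ ^ m :=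
          mul_le_mul_of_nonneg_left (pow_le_pow_right₀ h hi.le) (norm_nonneg _)
      _ < ‖α‖ ^ m := mul_lt_of_lt_one_left hαm hai
  have : ‖α‖ ^ m < ‖α‖ ^ m := by
    calc ‖α‖ ^ m = ‖α ^ m‖ := (norm_pow α m).symm
      _ = ‖∑ i ∈ Finset.range m, j p L (f.coeff i) * α ^ i‖ := by rw [hsum, norm_neg]
      _ ≤ _ := hle
      _ < ‖α‖ ^ m := hterm
  exact lt_irrefl _ this

include p in
/-- Such a root is a point of `𝔪_{O_L}` and a root of `f` mapped to `O_L`. -/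
theorem exists_root_O (f : Polynomial ℤ_[p])
    (hf : f.IsDistinguishedAt (IsLocalRing.maximalIdeal ℤ_[p])) (hdeg : 0 < f.natDegree) (α : L)
    (hα : f.eval₂ (j p L) α = 0) :
    haveI := isDVR p L
    ∃ u₀ : O L, u₀ ∈ IsLocalRing.maximalIdeal (O L) ∧ f.eval₂ (ι p L) u₀ = 0 := by
  haveI := isDVR p L
  have hlt := norm_lt_one_of_root p L f hf hdeg α hα
  refine ⟨⟨α, (mem_O_iff L α).mpr hlt.le⟩, ?_, ?_⟩
  · rw [IsLocalRing.mem_maximalIdeal, mem_nonunits_iff, Valuation.Integer.not_isUnit_iff_valuation_lt_one]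
    show NormedField.valuation α < 1
    rw [NormedField.valuation_apply, ← NNReal.coe_lt_coe, coe_nnnorm, NNReal.coe_one]
    exact hlt
  · apply (injective_iff_map_eq_zero (O L).subtype).mp Subtype.val_injective
    rw [Polynomial.hom_eval₂, subtype_comp_ι]
    exact hα

end Generic

/-! ### The field: a splitting field of the distinguished polynomial, with the spectral norm -/

section Field

variable (p : ℕ) [Fact p.Prime]

theorem exists_dvr_root (f : Polynomial ℤ_[p])
    (hf : f.IsDistinguishedAt (IsLocalRing.maximalIdeal ℤ_[p])) (hdeg : 0 < f.natDegree) :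
    ∃ (S : Type) (_ : CommRing S) (_ : IsDomain S) (_ : IsDiscreteValuationRing S)
      (_ : IsAdicComplete (IsLocalRing.maximalIdeal S) S) (_ : CharZero S) (_ : Algebra ℤ_[p] S)
      (_ : Module.Finite ℤ_[p] S) (u₀ : S),
      u₀ ∈ IsLocalRing.maximalIdeal S ∧ f.eval₂ (algebraMap ℤ_[p] S) u₀ = 0 := by
  let f₀ : Polynomial ℚ_[p] := f.map (PadicInt.Coe.ringHom (p := p))
  let K : Type := f₀.SplittingField
  letI : NontriviallyNormedField K := spectralNorm.nontriviallyNormedField ℚ_[p] K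
  letI : NormedAlgebra ℚ_[p] K := spectralNorm.normedAlgebra ℚ_[p] K
  haveI : IsUltrametricDist K :=
    IsUltrametricDist.isUltrametricDist_of_forall_norm_add_le_max_norm isNonarchimedean_spectralNorm
  -- a root of `f` in `K`
  have hdeg₀ : f₀.degree ≠ 0 := by
    have hinj : Function.Injective (PadicInt.Coe.ringHom (p := p)) := Subtype.val_injective
    show (f.map (PadicInt.Coe.ringHom (p := p))).degree ≠ 0
    rw [Polynomial.degree_map_eq_of_injective hinj, Polynomial.degree_eq_natDegree hf.monic.ne_zero]
    exact_mod_cast hdeg.ne'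
  obtain ⟨α, hα⟩ := (Polynomial.SplittingField.splits f₀).exists_eval_eq_zero (by
    rwa [Polynomial.degree_map])
  have hα' : f.eval₂ (j p K) α = 0 := by
    rw [Polynomial.eval_map, Polynomial.eval₂_map] at hα
    exact hα
  obtain ⟨u₀, hu₀, hroot⟩ := exists_root_O p K f hf hdeg α hα'
  exact ⟨O K, inferInstance, inferInstance, isDVR p K, isAdicComplete p K, charZero_O p K, algZp p K,
    moduleFinite_O p K, u₀, hu₀, hroot⟩

end Field
end RD

/-! ### E10.3 Root data for every good prime; door 2 without `hroot` -/

section RootDatum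

variable {p : ℕ} [Fact p.Prime]

attribute [local instance] algS

/-- **Root data exist** for every good prime (`S = O_K`, `K` a splitting field of the Weierstrass polynomial of
`P` over `ℚ_p` with the spectral norm, `u₀` a root). -/
theorem rootDatumS (P : GoodPrime p) : RootDatumS p P := by
  have hres := P.map_residue_ne_zero
  have HW := P.isWeierstrassFactorization
  set f := (P.P).weierstrassDistinguished hres with hfdef
  set h := (P.P).weierstrassUnit hres with hhdef
  have hf : f.IsDistinguishedAt (IsLocalRing.maximalIdeal ℤ_[p]) := HW.isDistinguishedAt
  have hdeg : 0 < f.natDegree := by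
    rw [Nat.pos_iff_ne_zero]
    intro h0
    have hf1 : f = 1 := (hf.monic.natDegree_eq_zero).mp h0
    apply P.prime.not_unit
    rw [HW.eq_mul, hf1, Polynomial.coe_one, one_mul]
    exact HW.isUnit
  obtain ⟨S, _, _, _, _, _, _, _, u₀, hu₀, hroot⟩ := RD.exists_dvr_root p f hf hdeg
  refine ⟨S, inferInstance, inferInstance, inferInstance, inferInstance, inferInstance, inferInstance,
    inferInstance, u₀, hu₀, ?_⟩
  rw [HW.eq_mul, map_mul, map_mul, ← Polynomial.polynomial_map_coe, evS_coe, Polynomial.eval_map, hroot,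
    zero_mul]

/-- **Door 2 without the root hypothesis**: `PatchingTarget`, `PatchingBeta`, non-vertical fibre bounds,
Kato-line torsion, `DepthFibreBoundsDVR` ⟹ `(p^a · G) ⊆ ch_{Λ₂}(X)`. -/
theorem engine_doorS' (X : Type) [AddCommGroup X] [Module (IwasawaAlgebra₂ p) X]
    [Module.Finite (IwasawaAlgebra₂ p) X] (G : IwasawaAlgebra₂ p)
    (hPT : PatchingTarget p X G) (hPB : PatchingBeta p X G)
    (hnv : ∃ z : Polynomial ℤ_[p], z ≠ 0 ∧
      ∀ (O : Type) [CommRing O] [IsDomain O] [CharZero O] [Algebra ℤ_[p] O] [Module.Finite ℤ_[p] O]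
        (u : O), u ∈ nonunits O → Polynomial.aeval u z ≠ 0 →
        letI : Algebra (IwasawaAlgebra₂ p) (PowerSeries (PowerSeries O)) :=
          (PowerSeries.map (PowerSeries.map (algebraMap ℤ_[p] O))).toAlgebra
        ∃ t : ℕ, FibreBoundAt O p ((PowerSeries (PowerSeries O)) ⊗[IwasawaAlgebra₂ p] X)
          (PowerSeries.map (PowerSeries.map (algebraMap ℤ_[p] O)) G) u t)
    (hKato : Module.IsTorsion
      (IwasawaAlgebra₂ p ⧸ Ideal.span {(PowerSeries.C PowerSeries.X : IwasawaAlgebra₂ p)})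
      (QuotSMulTop (PowerSeries.C PowerSeries.X : IwasawaAlgebra₂ p) X))
    (hQ1 : DepthFibreBoundsDVR p X G) :
    ∃ a : ℕ, Ideal.span {(p : IwasawaAlgebra₂ p) ^ a * G} ≤
      Literature.NumberTheory.EllipticCurves.Module.charIdeal (IwasawaAlgebra₂ p) X :=
  engine_doorS X G hPT hPB hnv hKato (fun P _ => rootDatumS P) hQ1

end RootDatum

end Summit.BirchSwinnertonDyer.BirchSwinnertonDyer.Cruxes.TwoVariableEulerSystemDivisibility.QtameEngine
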